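import Literature.Analysis.FluidPDE.JiaSverak2013AprioriEstimate
import Literature.Analysis.FluidPDE.LocalLerayInitialEnergyGradient
import Literature.Analysis.FluidPDE.LocalLerayPressureBoundProofs
import Literature.Analysis.FluidPDE.LocalLerayPressureDecompositionHolds
import Literature.Analysis.FluidPDE.LocalLerayPressureRenormalisation
import Literature.Analysis.FluidPDE.LocalLerayRescaling
import Literature.Analysis.FluidPDE.LocalEnergyTimeShift
import Literature.Analysis.FluidPDE.NSSuitableESSProofs
import Literature.Analysis.FluidPDE.LaplaceDivFormRoundOne
import Literature.Analysis.FluidPDE.SelfSimilarProofs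
import HarnessLib

/-!
# Jia–Šverák's Lemma 2 (Lemarié-Rieusset's a priori estimate for Leray solutions), proved

Analysis/FluidPDE proofs file (theorems only, no new definitions, no new named facts)
**discharging the named fact `Literature.Analysis.FluidPDE.jia_sverak_2013_lemma_2`**
(`JiaSverak2013AprioriEstimate.lean`; Jia–Šverák, SIAM J. Math. Anal. 45 (2013) =
arXiv:1201.1592, **Lemma 2** "(A priori estimate for Leray solution)" with (2.7), (2.9) and the
Remark, pp. 3–4; = Kang–Miura–Tsai 2021, Lemma 3.5; after Lemarié-Rieusset 2002, Ch. 32–33 /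
2016, Thm. 14.1): for a local Leray solution `(u, p)` with weakly divergence-free datum
`u₀ ∈ E²`, `sup_{x₀} ∫_{B_R(x₀)} |u₀|² ≤ 2α`, and `T = λR²` with `λ ≤ ε₀ min{α⁻²R², 1}`, the
uniformly local energy and dissipation on `(0, T)` are `≤ Cα` and the gauged pressure satisfies
`∫∫_{(0,T)×B_R(x₀)} |p - c_{x₀,R}(t)|^{3/2} ≤ Cα^{3/2}R^{1/2}`.

## The printed proof and this formalisation

Jia–Šverák (p. 3) test the local energy inequality from `t = 0` with `φ(x - x₀)` (`φ = 1` on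
`B_R`, supported in `B_{2R}`), bound the cubic term by "Sobolev embedding"
(`∫₀^{λR²}∫_{B_{2R}} |u|³ ≤ CA(λ)^{3/2}R^{1/2}λ^{1/4}`) and the gauged pressure by "elliptic
estimates and `|k(x-y) - k(x₀-y)| ≤ CR|x₀-y|⁻⁴`", obtaining
`A(λ) ≤ α + CλA(λ) + CA(λ)^{3/2}λ^{1/4}R^{-1/2}` for the running uniformly local energy `A(λ)`,
and conclude "by the usual continuation in `λ` argument", `A(λ)` being "a priori bounded" and
"continuous in `λ`". This file follows the same route with the tree's tools, after reducing to
`R = 1` by the Navier–Stokes scaling (the printed estimate is scale invariant):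

* the local energy inequality from the initial time with the dissipation term
  (`IsLocalLeraySolution.ae_lintegral_sq_mul_add_grad_le_datum_add`, `LocalLerayInitialEnergyGradient`),
  tested with the translated radial cut-offs `θ_{2,3}(y - ·)` of `LaplaceDivFormRoundOne` at the
  integer lattice of centres `y ∈ ℤ³` (every unit ball lies in some `B̄_2(y)`), for the pressure
  renormalised by a measurable gauge (`IsLocalLeraySolution.sub_pressure`; the gauge is the
  horizon-independent one of `exists_gauge_of_pressure_decomposition` from the proved pressure
  decomposition `kangMiuraTsai_pressure_decomposition_holds`, modified on a null set of times);
* the cubic term through the explicit cubic functional `exists_lintegral_cube_box_le_explicit`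
  (Sobolev on balls and Lebesgue interpolation, `LocalLerayPressureBoundTools`) on time windows
  (`HasWeakSpatialGradientOn.timeShift`): `∫∫_{(t₁,t₂)×B_ρ} |u|³ ≤ 2K_c M^{3/2}(t₂-t₁)^{1/4}`;
* the gauged pressure on time windows exactly as in the tree's proof of
  `kangMiuraTsai_local_pressure_bound` (near field by the proved Calderón–Zygmund bound
  `stein1970_normalisedPressure_ae_Lp_bound_holds`, far field by the two-centre kernel bound and
  the uniformly local tail), giving the flux bound
  `FLUX(t₁,t₂) ≤ K₁(t₂-t₁)M + K₂M^{3/2}(t₂-t₁)^{1/4}` (`exists_window_flux_le`) — the printed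
  `CλA + CA^{3/2}λ^{1/4}`;
* the continuation argument made **discrete** (`core_bounds`): instead of the continuity of
  `λ ↦ A(λ)` (asserted but not proved in print), the threshold `θ = 8nα + η` (`η > 0` arbitrary,
  `η ↓ 0` at the end) is propagated along a grid `s_k = kT/n` whose step is so small — in terms of
  the finite uniformly local bounds that the class `IsLocalLeraySolution` carries by definition —
  that the flux over one step is `≤ θ/4`, while the flux over `(0, s_k)` is `≤ θ/4` by the
  smallness of `T` (`T ≤ ε₀`, `Tα² ≤ ε₀`); bounds at the grid points are recovered from the a.e.
  bounds by exhaustion of the boxes (`setLIntegral_prod_le_of_ae`);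
* the scaling `u ↦ Ru(R²t, Rx)` (`IsLocalLeraySolution.stRescale`,
  `HasWeakSpatialGradientOn.stRescale`, `IsWeaklyDivFree.nsRescaleData`, and `memE2_rescale`
  proved here) to pass from `R = 1` (`apriori_unit_scale`) to the printed radius `R`
  (`jia_sverak_2013_lemma_2_holds`).

## References

* H. Jia, V. Šverák, *Minimal L³-initial data for potential Navier–Stokes singularities*,
  SIAM J. Math. Anal. 45 (2013) 1448–1459 = arXiv:1201.1592: Lemma 2 with (2.7), (2.9), the
  Remark, and its proof (pp. 3–4). Bib key `JiaSverak2013`.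
* K. Kang, H. Miura, T.-P. Tsai, IMRN 2021 = arXiv:1812.10509, Lemma 3.4 and §8 (pressure
  decomposition and its bounds), Lemma 3.5. Bib key `KangMiuraTsai2020`.
* P. G. Lemarié-Rieusset, *The Navier–Stokes Problem in the 21st Century* (2016), Thm. 14.1,
  Prop. 14.1; (13.17)–(13.18). Bib key `LemarieRieusset2016`.
-/

noncomputable section

open MeasureTheory TopologicalSpace Set Function Filter Metric
open _root_.Topology
open scoped ENNReal NNReal RealInnerProductSpace Laplacian

namespace Literature.Analysis.FluidPDE

namespace JiaSverak2013

/-! ### Time windows: translation to windows starting at `0` -/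

/-- An a.e. statement on the window `(t₁, t₂)` is an a.e. statement on `(0, t₂ - t₁)` for the
translated times `t₁ + s` (translation invariance of Lebesgue measure). [folklore] -/
theorem ae_restrict_Ioo_comp_add {P : ℝ → Prop} {t₁ t₂ : ℝ}
    (h : ∀ᵐ t ∂(volume.restrict (Ioo t₁ t₂)), P t) :
    ∀ᵐ s ∂(volume.restrict (Ioo 0 (t₂ - t₁))), P (t₁ + s) := by
  have hmp : MeasurePreserving (fun s : ℝ => t₁ + s)
      (volume.restrict ((fun s : ℝ => t₁ + s) ⁻¹' Ioo t₁ t₂)) (volume.restrict (Ioo t₁ t₂)) :=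
    (measurePreserving_add_left volume t₁).restrict_preimage measurableSet_Ioo
  rw [Set.preimage_const_add_Ioo, sub_self] at hmp
  exact hmp.quasiMeasurePreserving.ae h

/-- **The cubic functional on a time window** `(t₁, t₂) ⊆ (0, ∞)`, `t₂ - t₁ ≤ 1`, of a field
with a weak spatial gradient on the slab `(0,∞) × ℝ³`: if `∫_{B_ρ(x₀)} |u(t)|² ≤ M` for a.e.
`t ∈ (t₁, t₂)` and `∫∫_{(t₁,t₂)×B_ρ(x₀)} |∇u|² ≤ M`, then
`∫∫_{(t₁,t₂)×B_ρ(x₀)} |u|³ ≤ 2 K_c(ρ) M^{3/2} (t₂ - t₁)^{1/4}` (the tree's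
`exists_lintegral_cube_box_le_explicit` on the translated window; Jia–Šverák 2013, proof of
Lemma 2: "Sobolev embedding theorem gives `sup_{x₀} ∫₀^{λR²}∫_{B_{2R}(x₀)} |u|³ ≤ C A(λ)^{3/2} R^{1/2} λ^{1/4}`").
[cite: JiaSverak2013, proof of Lemma 2 (arXiv:1201.1592 p. 3)] -/
theorem exists_lintegral_cube_window_le (ρ : ℝ) :
    ∃ Kc : ℝ≥0, ∀ (u : ℝ → (EuclideanSpace ℝ (Fin 3)) → (EuclideanSpace ℝ (Fin 3))) (G : ℝ → (EuclideanSpace ℝ (Fin 3)) → (EuclideanSpace ℝ (Fin 3)) →L[ℝ] (EuclideanSpace ℝ (Fin 3))) (t₁ t₂ : ℝ) (x₀ : (EuclideanSpace ℝ (Fin 3))) (M : ℝ≥0∞),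
      0 ≤ t₁ → t₁ ≤ t₂ → t₂ - t₁ ≤ 1 → M ≠ ⊤ →
      HasWeakSpatialGradientOn (slab (EuclideanSpace ℝ (Fin 3)) (Ioi 0) isOpen_Ioi) u G →
      (∀ᵐ t ∂(volume.restrict (Ioo t₁ t₂)), ∫⁻ x in ball x₀ ρ, ‖u t x‖ₑ ^ 2 ≤ M) →
      ∫⁻ z in Ioo t₁ t₂ ×ˢ ball x₀ ρ, ENNReal.ofReal (frobeniusNormSq (G z.1 z.2)) ≤ M →
      ∫⁻ z in Ioo t₁ t₂ ×ˢ ball x₀ ρ, ‖u z.1 z.2‖ₑ ^ (3 : ℕ) ≤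
        2 * Kc * M ^ (3 / 2 : ℝ) * ENNReal.ofReal (t₂ - t₁) ^ (1 / 4 : ℝ) := by
  obtain ⟨Kc, hKc⟩ := exists_lintegral_cube_box_le_explicit ρ
  refine ⟨Kc, fun u G t₁ t₂ x₀ M h0 h12 hδ1 hMtop hG hE hD => ?_⟩
  set δ : ℝ := t₂ - t₁ with hδ
  have hδ0 : 0 ≤ δ := by rw [hδ]; linarith
  -- the translated field on the slab `(0, δ) × ℝ³`
  set v : ℝ → (EuclideanSpace ℝ (Fin 3)) → (EuclideanSpace ℝ (Fin 3)) := fun s y => u (t₁ + s) y with hv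
  set G' : ℝ → (EuclideanSpace ℝ (Fin 3)) → (EuclideanSpace ℝ (Fin 3)) →L[ℝ] (EuclideanSpace ℝ (Fin 3)) := fun s y => G (t₁ + s) y with hG'
  have hsub : Ioo t₁ t₂ ⊆ Ioi (0 : ℝ) := fun t ht => lt_of_le_of_lt h0 ht.1
  have hGw : HasWeakSpatialGradientOn (slab (EuclideanSpace ℝ (Fin 3)) (Ioo t₁ t₂) isOpen_Ioo) u G :=
    hG.mono (slab_mono hsub)
  have hG'' : HasWeakSpatialGradientOn (slab (EuclideanSpace ℝ (Fin 3)) (Ioo 0 δ) isOpen_Ioo) v G' := by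
    have h1 := hGw.timeShift t₁
    simp only [sub_self] at h1
    exact h1
  -- the hypotheses on the translated window
  have hE' : ∀ᵐ s ∂(volume.restrict (Ioo 0 δ)), ∫⁻ x in ball x₀ ρ, ‖v s x‖ₑ ^ 2 ≤ M :=
    ae_restrict_Ioo_comp_add hE
  have hD' : ∫⁻ z in Ioo 0 δ ×ˢ ball x₀ ρ, ENNReal.ofReal (frobeniusNormSq (G' z.1 z.2)) ≤ M := by
    have e := setLIntegral_prod_timeShift t₁ t₁ t₂ (ball x₀ ρ)
      (fun z : ℝ × (EuclideanSpace ℝ (Fin 3)) => ENNReal.ofReal (frobeniusNormSq (G z.1 z.2)))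
    rw [sub_self] at e
    rw [hG']
    exact e.le.trans hD
  have hcube := hKc δ v G' x₀ M M hMtop hG'' hE' hD'
  have e3 := setLIntegral_prod_timeShift t₁ t₁ t₂ (ball x₀ ρ)
    (fun z : ℝ × (EuclideanSpace ℝ (Fin 3)) => ‖u z.1 z.2‖ₑ ^ (3 : ℕ))
  rw [sub_self] at e3
  rw [← e3]
  refine hcube.trans ?_
  -- ## the algebra `M^{1/2} (M δ)^{1/4} (M δ + M)^{3/4} ≤ 2 M^{3/2} δ^{1/4}`
  have hvol : volume (Ioo (0 : ℝ) δ) = ENNReal.ofReal δ := by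
    rw [Real.volume_Ioo, sub_zero]
  rw [hvol]
  set d : ℝ≥0∞ := ENNReal.ofReal δ with hd
  have hd1 : d ≤ 1 := by
    rw [hd]; exact ENNReal.ofReal_le_one.2 hδ1
  have h1 : (M * d) ^ (1 / 4 : ℝ) = M ^ (1 / 4 : ℝ) * d ^ (1 / 4 : ℝ) :=
    ENNReal.mul_rpow_of_nonneg _ _ (by norm_num)
  have h2 : (M * d + M) ^ (3 / 4 : ℝ) ≤ 2 * M ^ (3 / 4 : ℝ) := by
    have hle : M * d + M ≤ 2 * M := by
      calc M * d + M ≤ M * 1 + M := by gcongr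
        _ = 2 * M := by ring
    calc (M * d + M) ^ (3 / 4 : ℝ) ≤ (2 * M) ^ (3 / 4 : ℝ) := ENNReal.rpow_le_rpow hle (by norm_num)
      _ = (2 : ℝ≥0∞) ^ (3 / 4 : ℝ) * M ^ (3 / 4 : ℝ) := ENNReal.mul_rpow_of_nonneg _ _ (by norm_num)
      _ ≤ 2 * M ^ (3 / 4 : ℝ) := by
          gcongr
          conv_rhs => rw [← ENNReal.rpow_one 2]
          exact ENNReal.rpow_le_rpow_of_exponent_le (by norm_num) (by norm_num)
  have h3 : M ^ (1 / 2 : ℝ) * M ^ (1 / 4 : ℝ) * M ^ (3 / 4 : ℝ) = M ^ (3 / 2 : ℝ) := by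
    rw [← ENNReal.rpow_add_of_nonneg _ _ (by norm_num) (by norm_num),
      ← ENNReal.rpow_add_of_nonneg _ _ (by norm_num) (by norm_num)]
    norm_num
  calc (Kc : ℝ≥0∞) * M ^ (1 / 2 : ℝ) * ((M * d) ^ (1 / 4 : ℝ) * (M * d + M) ^ (3 / 4 : ℝ))
      ≤ (Kc : ℝ≥0∞) * M ^ (1 / 2 : ℝ) * ((M ^ (1 / 4 : ℝ) * d ^ (1 / 4 : ℝ)) * (2 * M ^ (3 / 4 : ℝ))) := by
        rw [h1]; gcongr
    _ = 2 * Kc * (M ^ (1 / 2 : ℝ) * M ^ (1 / 4 : ℝ) * M ^ (3 / 4 : ℝ)) * d ^ (1 / 4 : ℝ) := by ring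
    _ = 2 * Kc * M ^ (3 / 2 : ℝ) * d ^ (1 / 4 : ℝ) := by rw [h3]

/-! ### Uniformly local bounds on boxes -/

/-- Volume of the unit ball of `ℝ³` (a name). [folklore] -/
theorem volume_unitBall_ne_zero : volume (ball (0 : (EuclideanSpace ℝ (Fin 3))) 1) ≠ 0 :=
  (measure_ball_pos volume _ one_pos).ne'

/-- **From unit balls to balls of radius `ρ` on a time box**: if `∫∫_{I×B_1(z)} F ≤ A` for all
centres `z`, then `∫∫_{I×B_ρ(x₀)} F ≤ |B_1|⁻¹ A |B_{ρ+1}|` (Tonelli and the covering lemma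
`setLIntegral_ball_le_of_forall_unitBall`). [folklore] -/
theorem lintegral_box_ball_le_of_forall_unitBall {I : Set ℝ}
    {F : ℝ × (EuclideanSpace ℝ (Fin 3)) → ℝ≥0∞} (hF : AEMeasurable F (volume.restrict (I ×ˢ (univ : Set (EuclideanSpace ℝ (Fin 3))))))
    {A : ℝ≥0∞} (hA : ∀ z : (EuclideanSpace ℝ (Fin 3)), ∫⁻ w in I ×ˢ ball z 1, F w ≤ A) (x₀ : (EuclideanSpace ℝ (Fin 3))) (ρ : ℝ) :
    ∫⁻ w in I ×ˢ ball x₀ ρ, F w ≤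
      (volume (ball (0 : (EuclideanSpace ℝ (Fin 3))) 1))⁻¹ * (A * volume (ball (0 : (EuclideanSpace ℝ (Fin 3))) (ρ + 1))) := by
  set μt : Measure ℝ := volume.restrict I with hμt
  have hbox : ∀ S : Set (EuclideanSpace ℝ (Fin 3)), μt.prod (volume.restrict S) = volume.restrict (I ×ˢ S) := fun S => by
    rw [hμt, Measure.prod_restrict, ← Measure.volume_eq_prod]
  have hboxu : μt.prod (volume : Measure (EuclideanSpace ℝ (Fin 3))) = volume.restrict (I ×ˢ (univ : Set (EuclideanSpace ℝ (Fin 3)))) := by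
    conv_lhs => rw [← Measure.restrict_univ (μ := (volume : Measure (EuclideanSpace ℝ (Fin 3))))]
    exact hbox univ
  set gG : (EuclideanSpace ℝ (Fin 3)) → ℝ≥0∞ := fun y => ∫⁻ t in I, F (t, y) with hgG
  have hFm : AEMeasurable F (μt.prod (volume : Measure (EuclideanSpace ℝ (Fin 3)))) := by rw [hboxu]; exact hF
  have hton : ∀ S : Set (EuclideanSpace ℝ (Fin 3)), ∫⁻ w in I ×ˢ S, F w = ∫⁻ y in S, gG y := fun S => by
    have hFS : AEMeasurable F (μt.prod (volume.restrict S)) := by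
      rw [hbox]
      exact hF.mono_measure (Measure.restrict_mono (Set.prod_mono Subset.rfl (subset_univ _)) le_rfl)
    rw [← hbox S, lintegral_prod_symm _ hFS]
  have hgGm : AEMeasurable gG volume := hFm.prod_swap.lintegral_prod_right'
  have hunit : ∀ z : (EuclideanSpace ℝ (Fin 3)), ∫⁻ y in ball z 1, gG y ≤ A := fun z => by
    rw [← hton]; exact hA z
  rw [hton]
  exact setLIntegral_ball_le_of_forall_unitBall hgGm hunit x₀ ρ

/-! ### The gauged pressure on a time window -/

/-- **The gauged pressure on a time window** (Jia–Šverák 2013, proof of Lemma 2: "by elliptic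
estimates and `|k(x-y) - k(x₀-y)| ≤ CR|x₀-y|⁻⁴` … we easily obtain
`‖p - p(t)‖_{L^{3/2}(B_{2R}(x₀)×(0,λR²))} ≤ C(‖u‖²_{L³(B_{8R}(x₀)×(0,λR²))} + ‖R⁻³A(λ)‖_{L^{3/2}})`";
Kang–Miura–Tsai 2021, §8, the bounds for `p_loc` (Calderón–Zygmund, slice by slice) and `p_far`
(two-centre kernel bound and the uniformly local tail), here on an arbitrary window
`(t₁, t₂) ⊆ (0, S)` at unit scale, radius `3`): if `π - c = π_loc + π_far` a.e. on
`(0,S) × B_3(y)` and the unit-ball energies of `u(t)` are `≤ E` for a.e. `t ∈ (t₁, t₂)`, then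
`∫∫_{(t₁,t₂)×B_3(y)} |π - c|^{3/2} ≤ √2 Cₙ ∫∫_{(t₁,t₂)×B_6(y)} |u|³ + √2 |B_3| (3C_K · Tail(E))^{3/2} (t₂ - t₁)`,
`Tail(E) = |B_1|⁻¹ E · 16 ∫_{|z|≥5} |z|⁻⁴`.
[cite: JiaSverak2013, proof of Lemma 2 (arXiv:1201.1592 p. 3)] [cite: KangMiuraTsai2020, §8 proof of Lemma 3.4 (bounds for p_loc, p_far), arXiv:1812.10509 p. 18] -/
theorem lintegral_window_pressure_le
    {Cn : ℝ≥0∞}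
    (hnear : ∀ (x₀ : (EuclideanSpace ℝ (Fin 3))) (r : ℝ) (v : ℝ → (EuclideanSpace ℝ (Fin 3)) → (EuclideanSpace ℝ (Fin 3))) (t : ℝ), AEStronglyMeasurable (v t) volume →
        ∫⁻ x in ball x₀ (2 * r), ‖v t x‖ₑ ^ (3 : ℕ) ≠ ⊤ →
          ∫⁻ x, ‖localPressureNear x₀ r v t x‖ₑ ^ (3 / 2 : ℝ) ≤
            Cn * ∫⁻ x in ball x₀ (2 * r), ‖v t x‖ₑ ^ (3 : ℕ))
    {CK : ℝ} (hCK0 : 0 ≤ CK)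
    (hCK : ∀ x₀ x y a : (EuclideanSpace ℝ (Fin 3)), 2 * ‖x - x₀‖ ≤ ‖y - x₀‖ → y ≠ x₀ →
      |pressureKernel (x - y) a - pressureKernel (x₀ - y) a| ≤
        CK * ‖x - x₀‖ * ‖a‖ ^ 2 / ‖y - x₀‖ ^ 4)
    {ν : ℝ} {u₀ : (EuclideanSpace ℝ (Fin 3)) → (EuclideanSpace ℝ (Fin 3))} {u : ℝ → (EuclideanSpace ℝ (Fin 3)) → (EuclideanSpace ℝ (Fin 3))} {p : ℝ → (EuclideanSpace ℝ (Fin 3)) → ℝ}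
    (hv : IsLocalLeraySolution ν u₀ u p)
    {S t₁ t₂ : ℝ} (h0 : 0 ≤ t₁) (h12 : t₁ ≤ t₂) (h2S : t₂ ≤ S) (y : (EuclideanSpace ℝ (Fin 3)))
    {c : ℝ → ℝ} (hcm : AEStronglyMeasurable c (volume.restrict (Ioo 0 S)))
    (hdec : ∀ᵐ z ∂(volume.restrict (Ioo 0 S ×ˢ ball y 3)),
      p z.1 z.2 - c z.1 = localPressureNear y 3 u z.1 z.2 + localPressureFar y 3 u z.1 z.2)
    {E : ℝ≥0∞} (hE : ∀ᵐ t ∂(volume.restrict (Ioo t₁ t₂)), ∀ z : (EuclideanSpace ℝ (Fin 3)),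
      ∫⁻ x in ball z 1, ‖u t x‖ₑ ^ 2 ≤ E) :
    ∫⁻ z in Ioo t₁ t₂ ×ˢ ball y 3, ‖p z.1 z.2 - c z.1‖ₑ ^ (3 / 2 : ℝ) ≤
      (2 : ℝ≥0∞) ^ (1 / 2 : ℝ) * Cn * (∫⁻ z in Ioo t₁ t₂ ×ˢ ball y (2 * 3), ‖u z.1 z.2‖ₑ ^ (3 : ℕ)) +
      (2 : ℝ≥0∞) ^ (1 / 2 : ℝ) *
        ((ENNReal.ofReal (CK * 3) * ((volume (ball (0 : (EuclideanSpace ℝ (Fin 3))) 1))⁻¹ *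
            (E * (16 * ∫⁻ z in (ball (0 : (EuclideanSpace ℝ (Fin 3))) (2 * 3 - 1))ᶜ, RieszKernel.powKer 4 z)))) ^ (3 / 2 : ℝ) *
          volume (ball (0 : (EuclideanSpace ℝ (Fin 3))) 3)) * ENNReal.ofReal (t₂ - t₁) := by
  -- ## names
  set B : Set (EuclideanSpace ℝ (Fin 3)) := ball y 3 with hB
  set N := localPressureNear y 3 u with hN
  set Fa := localPressureFar y 3 u with hFa
  set μt : Measure ℝ := volume.restrict (Ioo t₁ t₂) with hμt
  set μB : Measure (EuclideanSpace ℝ (Fin 3)) := volume.restrict B with hμB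
  set s2 : ℝ≥0∞ := (2 : ℝ≥0∞) ^ (1 / 2 : ℝ) with hs2
  set V1 : ℝ≥0∞ := volume (ball (0 : (EuclideanSpace ℝ (Fin 3))) 1) with hV1
  set VR : ℝ≥0∞ := volume (ball (0 : (EuclideanSpace ℝ (Fin 3))) 3) with hVR
  set cK : ℝ≥0∞ := ENNReal.ofReal (CK * 3) with hcK
  set Tail : ℝ≥0∞ := V1⁻¹ * (E * (16 * ∫⁻ z in (ball (0 : (EuclideanSpace ℝ (Fin 3))) (2 * 3 - 1))ᶜ, RieszKernel.powKer 4 z))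
    with hTail
  set g₃ : ℝ → ℝ≥0∞ := fun t => ∫⁻ x in ball y (2 * 3), ‖u t x‖ₑ ^ (3 : ℕ) with hg₃
  set G₃ : ℝ≥0∞ := ∫⁻ z in Ioo t₁ t₂ ×ˢ ball y (2 * 3), ‖u z.1 z.2‖ₑ ^ (3 : ℕ) with hG₃def
  have hs2top : s2 ≠ ⊤ := ENNReal.rpow_ne_top_of_nonneg (by norm_num) ENNReal.ofNat_ne_top
  have h3pos : (0 : ℝ) < 3 := by norm_num
  have h2R : (2 : ℝ) ≤ 2 * 3 := by norm_num
  have hsubI : Ioo t₁ t₂ ⊆ Ioi (0 : ℝ) := fun t ht => lt_of_le_of_lt h0 ht.1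
  -- ## measurability on the window slab and its boxes
  have hvm : AEStronglyMeasurable (uncurry u) (volume.restrict (Ioo t₁ t₂ ×ˢ (univ : Set (EuclideanSpace ℝ (Fin 3))))) :=
    hv.aestronglyMeasurable.mono_measure
      (Measure.restrict_mono (Set.prod_mono hsubI Subset.rfl) le_rfl)
  have hπm : AEStronglyMeasurable (uncurry p) (volume.restrict (Ioo t₁ t₂ ×ˢ (univ : Set (EuclideanSpace ℝ (Fin 3))))) :=
    hv.aestronglyMeasurable_pressure.mono_measure
      (Measure.restrict_mono (Set.prod_mono hsubI Subset.rfl) le_rfl)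
  have hbox : ∀ S' : Set (EuclideanSpace ℝ (Fin 3)), μt.prod (volume.restrict S') = volume.restrict (Ioo t₁ t₂ ×ˢ S') :=
    fun S' => by rw [hμt, Measure.prod_restrict, ← Measure.volume_eq_prod]
  have hboxu : μt.prod (volume : Measure (EuclideanSpace ℝ (Fin 3))) = volume.restrict (Ioo t₁ t₂ ×ˢ (univ : Set (EuclideanSpace ℝ (Fin 3)))) := by
    conv_lhs => rw [← Measure.restrict_univ (μ := (volume : Measure (EuclideanSpace ℝ (Fin 3))))]
    exact hbox univ
  have hsub : ∀ S' : Set (EuclideanSpace ℝ (Fin 3)), Ioo t₁ t₂ ×ˢ S' ⊆ Ioo t₁ t₂ ×ˢ (univ : Set (EuclideanSpace ℝ (Fin 3))) := fun S' =>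
    Set.prod_mono Subset.rfl (subset_univ _)
  have hvmS : ∀ S' : Set (EuclideanSpace ℝ (Fin 3)), AEStronglyMeasurable (uncurry u) (μt.prod (volume.restrict S')) :=
    fun S' => by
    rw [hbox]
    exact hvm.mono_measure (Measure.restrict_mono (hsub S') le_rfl)
  have hF : ∀ (S' : Set (EuclideanSpace ℝ (Fin 3))) (n : ℕ),
      AEMeasurable (fun z : ℝ × (EuclideanSpace ℝ (Fin 3)) => ‖u z.1 z.2‖ₑ ^ n) (μt.prod (volume.restrict S')) :=
    fun S' n => (hvmS S').enorm.pow_const n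
  -- slices of `u` are measurable for a.e. `t` in the window
  have hslice_meas : ∀ᵐ t ∂μt, AEStronglyMeasurable (u t) volume := by
    have h1 : AEStronglyMeasurable (uncurry u) (μt.prod (volume : Measure (EuclideanSpace ℝ (Fin 3)))) := by
      rw [hboxu]; exact hvm
    exact h1.prodMk_left
  -- ## the cubic functional on the box of radius `6` is finite, hence so are a.e. slices
  have hG₃top : G₃ ≠ ⊤ := by
    have hpos : 0 < t₂ + 1 := by linarith
    have hfin := hv.lintegral_cube_block_lt_top hpos (isCompact_closedBall y (2 * 3))
    refine ne_top_of_le_ne_top hfin.ne (lintegral_mono_set (Set.prod_mono ?_ ball_subset_closedBall))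
    exact Ioo_subset_Ioo h0 (by linarith)
  have hg₃m : AEMeasurable g₃ μt := (hF (ball y (2 * 3)) 3).lintegral_prod_right'
  have hT3 : G₃ = ∫⁻ t, g₃ t ∂μt := by
    rw [hG₃def, ← hbox, lintegral_prod _ (hF _ 3)]
  have hfin : ∀ᵐ t ∂μt, g₃ t < ⊤ := by
    refine ae_lt_top' hg₃m ?_
    rw [← hT3]
    exact hG₃top
  -- ## the expansion on the window, slice by slice
  have hdecw : ∀ᵐ z ∂(volume.restrict (Ioo t₁ t₂ ×ˢ B)), p z.1 z.2 - c z.1 = N z.1 z.2 + Fa z.1 z.2 :=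
    ae_restrict_of_ae_restrict_of_subset (Set.prod_mono (Ioo_subset_Ioo h0 h2S) Subset.rfl) hdec
  have hdec' : ∀ᵐ t ∂μt, ∀ᵐ x ∂μB, p t x - c t = N t x + Fa t x := by
    have h1 : ∀ᵐ z ∂μt.prod μB, p z.1 z.2 - c z.1 = N z.1 z.2 + Fa z.1 z.2 := by
      rw [hμB, hbox]
      exact hdecw
    exact Measure.ae_ae_of_ae_prod h1
  have hcmw : AEStronglyMeasurable c μt :=
    hcm.mono_measure (Measure.restrict_mono (Ioo_subset_Ioo h0 h2S) le_rfl)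
  have hGm' : AEStronglyMeasurable (fun z : ℝ × (EuclideanSpace ℝ (Fin 3)) => p z.1 z.2 - c z.1) (μt.prod μB) := by
    refine AEStronglyMeasurable.sub ?_ ?_
    · rw [hμB, hbox]
      exact hπm.mono_measure (Measure.restrict_mono (hsub B) le_rfl)
    · exact hcmw.comp_fst
  have hTI : ∫⁻ z in Ioo t₁ t₂ ×ˢ B, ‖p z.1 z.2 - c z.1‖ₑ ^ (3 / 2 : ℝ) =
      ∫⁻ t, ∫⁻ x, ‖p t x - c t‖ₑ ^ (3 / 2 : ℝ) ∂μB ∂μt := by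
    rw [← hbox B, ← hμB, lintegral_prod _ (hGm'.enorm.pow_const _)]
  -- ## the slice estimate
  have hinner : ∀ᵐ t ∂μt, ∫⁻ x, ‖p t x - c t‖ₑ ^ (3 / 2 : ℝ) ∂μB ≤
      s2 * Cn * g₃ t + s2 * ((cK * Tail) ^ (3 / 2 : ℝ) * VR) := by
    filter_upwards [hslice_meas, hfin, hdec', hE] with t hmt hft hdt hEt
    -- the far field at time `t`
    have hfar : ∫⁻ y' in (ball y (2 * 3))ᶜ,
        ‖u t y'‖ₑ ^ (2 : ℕ) * RieszKernel.powKer 4 (y' - y) ≤ Tail :=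
      lintegral_compl_ball_mul_powKer_le (hmt.enorm.pow_const _) hEt y h2R
    have hFaB : ∀ x ∈ B, ‖Fa t x‖ₑ ≤ cK * Tail := fun x hx =>
      (enorm_localPressureFar_le hCK0 hCK y h3pos u t hx).trans (mul_le_mul' le_rfl hfar)
    -- the near field at time `t`: Calderón–Zygmund
    have hNt : ∫⁻ x, ‖N t x‖ₑ ^ (3 / 2 : ℝ) ∂μB ≤ Cn * g₃ t :=
      (lintegral_mono' Measure.restrict_le_self le_rfl).trans (hnear y 3 u t hmt hft.ne)
    calc ∫⁻ x, ‖p t x - c t‖ₑ ^ (3 / 2 : ℝ) ∂μB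
        = ∫⁻ x, ‖N t x + Fa t x‖ₑ ^ (3 / 2 : ℝ) ∂μB := by
          refine lintegral_congr_ae ?_
          filter_upwards [hdt] with x hx
          rw [hx]
      _ ≤ ∫⁻ x, (‖N t x‖ₑ + cK * Tail) ^ (3 / 2 : ℝ) ∂μB := by
          rw [hμB]
          refine setLIntegral_mono' measurableSet_ball fun x hx => ?_
          exact ENNReal.rpow_le_rpow ((enorm_add_le _ _).trans
            (add_le_add le_rfl (hFaB x hx))) (by norm_num)
      _ ≤ ∫⁻ x, s2 * (‖N t x‖ₑ ^ (3 / 2 : ℝ) + (cK * Tail) ^ (3 / 2 : ℝ)) ∂μB :=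
          lintegral_mono fun x => add_rpow_threeHalves_le _ _
      _ = s2 * (∫⁻ x, ‖N t x‖ₑ ^ (3 / 2 : ℝ) ∂μB + (cK * Tail) ^ (3 / 2 : ℝ) * volume B) := by
          rw [lintegral_const_mul' _ _ hs2top, lintegral_add_right' _ aemeasurable_const,
            lintegral_const, hμB, Measure.restrict_apply_univ]
      _ ≤ s2 * (Cn * g₃ t + (cK * Tail) ^ (3 / 2 : ℝ) * VR) := by
          rw [hB, Measure.addHaar_ball_center volume y 3]
          gcongr
      _ = s2 * Cn * g₃ t + s2 * ((cK * Tail) ^ (3 / 2 : ℝ) * VR) := by ring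
  -- ## integrate in time
  have hμtuniv : μt univ = ENNReal.ofReal (t₂ - t₁) := by
    rw [hμt, Measure.restrict_apply_univ, Real.volume_Ioo]
  have hm1 : AEMeasurable (fun t => s2 * Cn * g₃ t) μt := hg₃m.const_mul _
  calc ∫⁻ z in Ioo t₁ t₂ ×ˢ B, ‖p z.1 z.2 - c z.1‖ₑ ^ (3 / 2 : ℝ)
      = ∫⁻ t, ∫⁻ x, ‖p t x - c t‖ₑ ^ (3 / 2 : ℝ) ∂μB ∂μt := hTI
    _ ≤ ∫⁻ t, (s2 * Cn * g₃ t + s2 * ((cK * Tail) ^ (3 / 2 : ℝ) * VR)) ∂μt :=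
        lintegral_mono_ae hinner
    _ = s2 * Cn * ∫⁻ t, g₃ t ∂μt + s2 * ((cK * Tail) ^ (3 / 2 : ℝ) * VR) * μt univ := by
        rw [lintegral_add_left' hm1, lintegral_const_mul'' _ hg₃m, lintegral_const]
    _ = s2 * Cn * G₃ + s2 * ((cK * Tail) ^ (3 / 2 : ℝ) * VR) * ENNReal.ofReal (t₂ - t₁) := by
        rw [← hT3, hμtuniv]

/-! ### The test functions `φ_y = θ(y - ·)` -/

/-- **The test function of the a priori estimate at unit scale**, centred at `y`:
`φ_y(x) = θ_{2,3}(y - x)` with `θ_{2,3}` the tree's radial cut-off (`= 1` on `B̄_2(y)`, `= 0` off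
`B_3(y)`, values in `[0,1]`, smooth); Jia–Šverák 2013, proof of Lemma 2: "`φ` is a nonnegative
smooth cutoff function with `φ = 1` in `B_R(0)`, `supp φ ⋐ B_{2R}(0)` and `|∇φ| ≤ C/R`" (here
`R = 2` after rescaling, plateau `B_2`, support `B_3`). [cite: JiaSverak2013, proof of Lemma 2 (arXiv:1201.1592 p. 3)] -/
theorem contDiff_testFn (y : (EuclideanSpace ℝ (Fin 3))) {n : ℕ∞} : ContDiff ℝ n (fun w => radialCutoff 2 3 (y - w)) :=
  LaplaceDivFormRoundOne.contDiff_cutoff 2 3 y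

/-- `φ_y ≥ 0`. [folklore] -/
theorem testFn_nonneg (y x : (EuclideanSpace ℝ (Fin 3))) : 0 ≤ radialCutoff 2 3 (y - x) := radialCutoff_nonneg _ _ _

/-- `φ_y ≤ 1`. [folklore] -/
theorem testFn_le_one (y x : (EuclideanSpace ℝ (Fin 3))) : radialCutoff 2 3 (y - x) ≤ 1 := radialCutoff_le_one _ _ _

/-- `φ_y = 1` on `B̄_2(y)`. [folklore] -/
theorem testFn_eq_one {y x : (EuclideanSpace ℝ (Fin 3))} (hx : x ∈ closedBall y 2) : radialCutoff 2 3 (y - x) = 1 :=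
  LaplaceDivFormRoundOne.cutoff_eq_one (by norm_num) (by norm_num) hx

/-- `φ_y = 0` off `B_3(y)`. [folklore] -/
theorem testFn_eq_zero {y x : (EuclideanSpace ℝ (Fin 3))} (hx : 3 ≤ dist x y) : radialCutoff 2 3 (y - x) = 0 :=
  LaplaceDivFormRoundOne.cutoff_eq_zero (by norm_num) (by norm_num) hx

/-- The support of `φ_y` lies in `B̄_3(y)`. [folklore] -/
theorem tsupport_testFn_subset (y : (EuclideanSpace ℝ (Fin 3))) : tsupport (fun w => radialCutoff 2 3 (y - w)) ⊆ closedBall y 3 :=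
  LaplaceDivFormRoundOne.tsupport_cutoff_subset (by norm_num) (by norm_num) y

/-- The support of `φ_y` lies in the ball `B(0, ‖y‖ + 4)` about the origin. [folklore] -/
theorem tsupport_testFn_subset_ball (y : (EuclideanSpace ℝ (Fin 3))) : tsupport (fun w => radialCutoff 2 3 (y - w)) ⊆ ball (0 : (EuclideanSpace ℝ (Fin 3))) (‖y‖ + 4) := by
  refine (tsupport_testFn_subset y).trans fun x hx => ?_
  rw [mem_closedBall] at hx
  rw [mem_ball, dist_zero_right]
  calc ‖x‖ = dist x 0 := (dist_zero_right x).symm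
    _ ≤ dist x y + dist y 0 := dist_triangle _ _ _
    _ ≤ 3 + ‖y‖ := by rw [dist_zero_right]; linarith
    _ < ‖y‖ + 4 := by linarith

/-- Uniform bounds for the Laplacian and the gradient of the test functions, independent of
the centre. [folklore] -/
theorem exists_testFn_bounds :
    ∃ CΔ Cg : ℝ, 0 ≤ CΔ ∧ 0 ≤ Cg ∧ (∀ y x : (EuclideanSpace ℝ (Fin 3)), |Δ (fun w => radialCutoff 2 3 (y - w)) x| ≤ CΔ) ∧
      ∀ y x : (EuclideanSpace ℝ (Fin 3)), ‖gradient (fun w => radialCutoff 2 3 (y - w)) x‖ ≤ Cg := by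
  obtain ⟨K₁, hK₁0, hK₁⟩ := LaplaceDivFormRoundOne.exists_bound_laplacian_radialCutoff
    (r₀ := 2) (r₁ := 3) (by norm_num) (by norm_num)
  obtain ⟨K₂, hK₂0, hK₂⟩ := LaplaceDivFormRoundOne.exists_bound_fderiv_radialCutoff
    (r₀ := 2) (r₁ := 3) (by norm_num) (by norm_num)
  refine ⟨K₁, K₂, hK₁0, hK₂0, fun y x => ?_, fun y x => ?_⟩
  · exact LaplaceDivFormRoundOne.abs_laplacian_cutoff_le hK₁ y x
  · have e : ‖gradient (fun w => radialCutoff 2 3 (y - w)) x‖ = ‖fderiv ℝ (fun w => radialCutoff 2 3 (y - w)) x‖ := by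
      rw [gradient]
      exact (InnerProductSpace.toDual ℝ (EuclideanSpace ℝ (Fin 3))).symm.norm_map _
    rw [e]
    exact LaplaceDivFormRoundOne.norm_fderiv_cutoff_le hK₂ y x

/-- Off `B̄_3(y)` the Laplacian of `φ_y` vanishes. [folklore] -/
theorem laplacian_testFn_eq_zero {y x : (EuclideanSpace ℝ (Fin 3))} (hx : x ∉ closedBall y 3) : Δ (fun w => radialCutoff 2 3 (y - w)) x = 0 :=
  laplacian_eq_zero_of_notMem_tsupport fun h => hx (tsupport_testFn_subset y h)

/-- Off `B̄_3(y)` the gradient of `φ_y` vanishes. [folklore] -/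
theorem gradient_testFn_eq_zero {y x : (EuclideanSpace ℝ (Fin 3))} (hx : x ∉ closedBall y 3) : gradient (fun w => radialCutoff 2 3 (y - w)) x = 0 := by
  have h : fderiv ℝ (fun w => radialCutoff 2 3 (y - w)) x = 0 :=
    fderiv_of_notMem_tsupport ℝ fun h => hx (tsupport_testFn_subset y h)
  simp [gradient, h]

/-- Boxes over a closed ball and over the open ball carry the same lower integrals (spheres are
Lebesgue-null). [folklore] -/
theorem setLIntegral_prod_closedBall_eq (I : Set ℝ) (y : (EuclideanSpace ℝ (Fin 3))) (r : ℝ) (F : ℝ × (EuclideanSpace ℝ (Fin 3)) → ℝ≥0∞) :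
    ∫⁻ z in I ×ˢ closedBall y r, F z = ∫⁻ z in I ×ˢ ball y r, F z := by
  refine setLIntegral_congr ?_
  have hnull : volume ((univ : Set ℝ) ×ˢ sphere y r) = 0 := by
    rw [Measure.volume_eq_prod, Measure.prod_prod, Measure.addHaar_sphere, mul_zero]
  refine (ae_eq_set).2 ⟨measure_mono_null (fun z hz => ?_) hnull, measure_mono_null (fun z hz => ?_) hnull⟩
  · have h1 : z.2 ∈ closedBall y r := hz.1.2
    have h2' : z.2 ∉ ball y r := fun h => hz.2 ⟨hz.1.1, h⟩
    refine ⟨mem_univ _, ?_⟩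
    rw [mem_closedBall] at h1
    rw [mem_ball, not_lt] at h2'
    exact mem_sphere.2 (le_antisymm h1 h2')
  · exact absurd (⟨hz.1.1, ball_subset_closedBall hz.1.2⟩ : z ∈ I ×ˢ closedBall y r) hz.2

/-! ### The flux of the local energy inequality on a time window -/

/-- The pointwise bound for the flux integrand of the local energy inequality tested with `φ_y`:
`| |u|²Δφ_y + (|u|² + 2q) u·∇φ_y | ≤ C_Δ|u|² + C_g|u|³ + 2C_g|q||u|`. [folklore] -/
theorem enorm_flux_le {CΔ Cg : ℝ} (hCΔ0 : 0 ≤ CΔ) (hCg0 : 0 ≤ Cg)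
    (hCΔ : ∀ y x : (EuclideanSpace ℝ (Fin 3)), |Δ (fun w => radialCutoff 2 3 (y - w)) x| ≤ CΔ) (hCg : ∀ y x : (EuclideanSpace ℝ (Fin 3)), ‖gradient (fun w => radialCutoff 2 3 (y - w)) x‖ ≤ Cg)
    (y : (EuclideanSpace ℝ (Fin 3))) (w : (EuclideanSpace ℝ (Fin 3))) (q : ℝ) (x : (EuclideanSpace ℝ (Fin 3))) :
    ‖‖w‖ ^ 2 * Δ (fun w => radialCutoff 2 3 (y - w)) x + (‖w‖ ^ 2 + 2 * q) * ⟪w, gradient (fun w => radialCutoff 2 3 (y - w)) x⟫‖ₑ ≤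
      ENNReal.ofReal CΔ * ‖w‖ₑ ^ 2 + ENNReal.ofReal Cg * ‖w‖ₑ ^ (3 : ℕ) +
        2 * ENNReal.ofReal Cg * (‖q‖ₑ * ‖w‖ₑ) := by
  set a : ℝ := ‖w‖ with ha
  have ha0 : 0 ≤ a := norm_nonneg _
  have hip : |⟪w, gradient (fun w => radialCutoff 2 3 (y - w)) x⟫| ≤ a * Cg :=
    (abs_real_inner_le_norm _ _).trans (mul_le_mul_of_nonneg_left (hCg y x) ha0)
  have hreal : |a ^ 2 * Δ (fun w => radialCutoff 2 3 (y - w)) x + (a ^ 2 + 2 * q) * ⟪w, gradient (fun w => radialCutoff 2 3 (y - w)) x⟫| ≤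
      CΔ * a ^ 2 + Cg * a ^ 3 + 2 * Cg * (|q| * a) := by
    calc |a ^ 2 * Δ (fun w => radialCutoff 2 3 (y - w)) x + (a ^ 2 + 2 * q) * ⟪w, gradient (fun w => radialCutoff 2 3 (y - w)) x⟫|
        ≤ |a ^ 2 * Δ (fun w => radialCutoff 2 3 (y - w)) x| + |(a ^ 2 + 2 * q) * ⟪w, gradient (fun w => radialCutoff 2 3 (y - w)) x⟫| := abs_add_le _ _
      _ = a ^ 2 * |Δ (fun w => radialCutoff 2 3 (y - w)) x| + |a ^ 2 + 2 * q| * |⟪w, gradient (fun w => radialCutoff 2 3 (y - w)) x⟫| := by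
          rw [abs_mul, abs_mul, abs_of_nonneg (sq_nonneg a)]
      _ ≤ a ^ 2 * CΔ + (a ^ 2 + 2 * |q|) * (a * Cg) := by
          gcongr
          · exact hCΔ y x
          · calc |a ^ 2 + 2 * q| ≤ |a ^ 2| + |2 * q| := abs_add_le _ _
              _ = a ^ 2 + 2 * |q| := by rw [abs_of_nonneg (sq_nonneg a), abs_mul, abs_two]
      _ = CΔ * a ^ 2 + Cg * a ^ 3 + 2 * Cg * (|q| * a) := by ring
  rw [Real.enorm_eq_ofReal_abs]
  refine (ENNReal.ofReal_le_ofReal hreal).trans (le_of_eq ?_)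
  have e1 : ‖w‖ₑ = ENNReal.ofReal a := by rw [ha, ofReal_norm]
  have e2 : ‖q‖ₑ = ENNReal.ofReal |q| := Real.enorm_eq_ofReal_abs q
  rw [e1, e2, ← ENNReal.ofReal_pow ha0, ← ENNReal.ofReal_pow ha0, ← ENNReal.ofReal_ofNat,
    ← ENNReal.ofReal_mul (abs_nonneg _), ← ENNReal.ofReal_mul hCΔ0, ← ENNReal.ofReal_mul hCg0,
    ← ENNReal.ofReal_mul (by norm_num), ← ENNReal.ofReal_mul (by positivity),
    ← ENNReal.ofReal_add (by positivity) (by positivity),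
    ← ENNReal.ofReal_add (by positivity) (by positivity)]

/-- `x^{2/3} y^{1/3}`-splitting of a common factor: `(a Y)^{2/3} (b Y)^{1/3} = a^{2/3} b^{1/3} Y`. [folklore] -/
theorem rpow_twoThirds_mul_rpow_third (a b Y : ℝ≥0∞) :
    (a * Y) ^ (2 / 3 : ℝ) * (b * Y) ^ (1 / 3 : ℝ) = a ^ (2 / 3 : ℝ) * b ^ (1 / 3 : ℝ) * Y := by
  rw [ENNReal.mul_rpow_of_nonneg _ _ (by norm_num), ENNReal.mul_rpow_of_nonneg _ _ (by norm_num)]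
  have hY : Y ^ (2 / 3 : ℝ) * Y ^ (1 / 3 : ℝ) = Y := by
    rw [← ENNReal.rpow_add_of_nonneg _ _ (by norm_num) (by norm_num)]
    norm_num
  calc a ^ (2 / 3 : ℝ) * Y ^ (2 / 3 : ℝ) * (b ^ (1 / 3 : ℝ) * Y ^ (1 / 3 : ℝ))
      = a ^ (2 / 3 : ℝ) * b ^ (1 / 3 : ℝ) * (Y ^ (2 / 3 : ℝ) * Y ^ (1 / 3 : ℝ)) := by ring
    _ = a ^ (2 / 3 : ℝ) * b ^ (1 / 3 : ℝ) * Y := by rw [hY]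

/-- **The flux of the local energy inequality on a time window** (Jia–Šverák 2013, proof of
Lemma 2, the estimate "`∫|u|²/2 φ(x-x₀) + ∫₀ᵗ∫|∇u|²φ(x-x₀) ≤ α + CλA(λ) + CA(λ)^{3/2}λ^{1/4}R^{-1/2}`"
at unit scale, for the window `(t₁, t₂)`, `t₂ - t₁ ≤ 1`, in place of `(0, λR²)`): there are
absolute constants `K₁, K₂` such that for every local Leray solution `(u, p)` with weak gradient
`G`, every centre `y` with gauge `c` (`p - c = p_loc + p_far` a.e. on `(0,S) × B_3(y)`), and all
bounds `E, D ≤ M < ∞` of the unit-ball energies of `u(t)` (a.e. `t` in the window) and of the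
unit-ball dissipations `∫∫_{(t₁,t₂)×B_1(z)} |G|²`,
`∫∫_{(t₁,t₂)×B_3(y)} | |u|²Δφ_y + (|u|² + 2(p - c)) u·∇φ_y | ≤ K₁ (t₂ - t₁) M + K₂ M^{3/2} (t₂ - t₁)^{1/4}`
(the three terms: `|u|²|Δφ|` by the uniformly local energy; `|u|³|∇φ|` by the cubic functional
`≲ M^{3/2}(t₂-t₁)^{1/4}`; `|p - c||u||∇φ|` by Hölder, the gauged pressure bound and the cubic
functional). [cite: JiaSverak2013, proof of Lemma 2 (arXiv:1201.1592 p. 3)] -/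
theorem exists_window_flux_le :
    ∃ K₁ K₂ : ℝ≥0, ∀ {ν : ℝ} {u₀ : (EuclideanSpace ℝ (Fin 3)) → (EuclideanSpace ℝ (Fin 3))} {u : ℝ → (EuclideanSpace ℝ (Fin 3)) → (EuclideanSpace ℝ (Fin 3))} {p : ℝ → (EuclideanSpace ℝ (Fin 3)) → ℝ}
      (_hv : IsLocalLeraySolution ν u₀ u p) {G : ℝ → (EuclideanSpace ℝ (Fin 3)) → (EuclideanSpace ℝ (Fin 3)) →L[ℝ] (EuclideanSpace ℝ (Fin 3))}
      (_hG : HasWeakSpatialGradientOn (slab (EuclideanSpace ℝ (Fin 3)) (Ioi 0) isOpen_Ioi) u G)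
      {S t₁ t₂ : ℝ} (_h0 : 0 ≤ t₁) (_h12 : t₁ ≤ t₂) (_h2S : t₂ ≤ S) (_hδ1 : t₂ - t₁ ≤ 1) (y : (EuclideanSpace ℝ (Fin 3)))
      {c : ℝ → ℝ} (_hcm : AEStronglyMeasurable c (volume.restrict (Ioo 0 S)))
      (_hdec : ∀ᵐ z ∂(volume.restrict (Ioo 0 S ×ˢ ball y 3)),
        p z.1 z.2 - c z.1 = localPressureNear y 3 u z.1 z.2 + localPressureFar y 3 u z.1 z.2)
      {E D M : ℝ≥0∞} (_hMtop : M ≠ ⊤) (_hEM : E ≤ M) (_hDM : D ≤ M)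
      (_hE : ∀ᵐ t ∂(volume.restrict (Ioo t₁ t₂)), ∀ z : (EuclideanSpace ℝ (Fin 3)), ∫⁻ x in ball z 1, ‖u t x‖ₑ ^ 2 ≤ E)
      (_hD : ∀ z : (EuclideanSpace ℝ (Fin 3)),
        ∫⁻ w in Ioo t₁ t₂ ×ˢ ball z 1, ENNReal.ofReal (frobeniusNormSq (G w.1 w.2)) ≤ D),
      ∫⁻ z in Ioo t₁ t₂ ×ˢ ball y 3,
          ‖‖u z.1 z.2‖ ^ 2 * Δ (fun w => radialCutoff 2 3 (y - w)) z.2 +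
            (‖u z.1 z.2‖ ^ 2 + 2 * (p z.1 z.2 - c z.1)) * ⟪u z.1 z.2, gradient (fun w => radialCutoff 2 3 (y - w)) z.2⟫‖ₑ ≤
        K₁ * ENNReal.ofReal (t₂ - t₁) * M +
          K₂ * M ^ (3 / 2 : ℝ) * ENNReal.ofReal (t₂ - t₁) ^ (1 / 4 : ℝ) := by
  obtain ⟨CΔ, Cg, hCΔ0, hCg0, hCΔ, hCg⟩ := exists_testFn_bounds
  obtain ⟨Cn, -, hCntop, hnear⟩ :=
    exists_lintegral_localPressureNear_le stein1970_normalisedPressure_ae_Lp_bound_holds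
  obtain ⟨CK, hCK0, hCK⟩ := exists_abs_pressureKernel_sub_le
  obtain ⟨Kc₃, hKc₃⟩ := exists_lintegral_cube_window_le 3
  obtain ⟨Kc₆, hKc₆⟩ := exists_lintegral_cube_window_le (2 * 3)
  -- ## constants
  set V1 : ℝ≥0∞ := volume (ball (0 : (EuclideanSpace ℝ (Fin 3))) 1) with hV1
  set N₃ : ℝ≥0∞ := V1⁻¹ * volume (ball (0 : (EuclideanSpace ℝ (Fin 3))) (3 + 1)) with hN₃
  set N₆ : ℝ≥0∞ := V1⁻¹ * volume (ball (0 : (EuclideanSpace ℝ (Fin 3))) (2 * 3 + 1)) with hN₆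
  set Q₀ : ℝ≥0∞ := 2 * Kc₃ * N₃ ^ (3 / 2 : ℝ) with hQ₀
  set s2 : ℝ≥0∞ := (2 : ℝ≥0∞) ^ (1 / 2 : ℝ) with hs2
  set cK : ℝ≥0∞ := ENNReal.ofReal (CK * 3) with hcK
  set τ₀ : ℝ≥0∞ := V1⁻¹ * (16 * ∫⁻ z in (ball (0 : (EuclideanSpace ℝ (Fin 3))) (2 * 3 - 1))ᶜ, RieszKernel.powKer 4 z)
    with hτ₀
  set V3 : ℝ≥0∞ := volume (ball (0 : (EuclideanSpace ℝ (Fin 3))) 3) with hV3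
  set P₀ : ℝ≥0∞ := s2 * Cn * (2 * Kc₆ * N₆ ^ (3 / 2 : ℝ)) + s2 * ((cK * τ₀) ^ (3 / 2 : ℝ) * V3)
    with hP₀
  set K₁ : ℝ≥0∞ := ENNReal.ofReal CΔ * N₃ with hK₁
  set K₂ : ℝ≥0∞ := ENNReal.ofReal Cg * Q₀ + 2 * ENNReal.ofReal Cg * (P₀ ^ (2 / 3 : ℝ) * Q₀ ^ (1 / 3 : ℝ))
    with hK₂
  -- ## finiteness of the constants
  have hV10 : V1 ≠ 0 := volume_unitBall_ne_zero
  have hV1inv : V1⁻¹ ≠ ⊤ := ENNReal.inv_ne_top.2 hV10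
  have hN₃top : N₃ ≠ ⊤ := ENNReal.mul_ne_top hV1inv measure_ball_lt_top.ne
  have hN₆top : N₆ ≠ ⊤ := ENNReal.mul_ne_top hV1inv measure_ball_lt_top.ne
  have hs2top : s2 ≠ ⊤ := ENNReal.rpow_ne_top_of_nonneg (by norm_num) ENNReal.ofNat_ne_top
  have hQ₀top : Q₀ ≠ ⊤ := ENNReal.mul_ne_top (ENNReal.mul_ne_top ENNReal.ofNat_ne_top ENNReal.coe_ne_top)
    (ENNReal.rpow_ne_top_of_nonneg (by norm_num) hN₃top)
  have hτ₀top : τ₀ ≠ ⊤ := by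
    refine ENNReal.mul_ne_top hV1inv (ENNReal.mul_ne_top (by norm_num) ?_)
    exact (RieszKernel.lintegral_compl_ball_powKer_lt_top (by norm_num) (by norm_num)).ne
  have hP₀top : P₀ ≠ ⊤ := by
    refine ENNReal.add_ne_top.2 ⟨?_, ?_⟩
    · exact ENNReal.mul_ne_top (ENNReal.mul_ne_top hs2top hCntop)
        (ENNReal.mul_ne_top (ENNReal.mul_ne_top ENNReal.ofNat_ne_top ENNReal.coe_ne_top)
          (ENNReal.rpow_ne_top_of_nonneg (by norm_num) hN₆top))
    · refine ENNReal.mul_ne_top hs2top (ENNReal.mul_ne_top ?_ measure_ball_lt_top.ne)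
      exact ENNReal.rpow_ne_top_of_nonneg (by norm_num)
        (ENNReal.mul_ne_top ENNReal.ofReal_ne_top hτ₀top)
  have hK₁top : K₁ ≠ ⊤ := ENNReal.mul_ne_top ENNReal.ofReal_ne_top hN₃top
  have hK₂top : K₂ ≠ ⊤ := by
    refine ENNReal.add_ne_top.2 ⟨ENNReal.mul_ne_top ENNReal.ofReal_ne_top hQ₀top, ?_⟩
    refine ENNReal.mul_ne_top (ENNReal.mul_ne_top ENNReal.ofNat_ne_top ENNReal.ofReal_ne_top) ?_
    exact ENNReal.mul_ne_top (ENNReal.rpow_ne_top_of_nonneg (by norm_num) hP₀top)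
      (ENNReal.rpow_ne_top_of_nonneg (by norm_num) hQ₀top)
  refine ⟨K₁.toNNReal, K₂.toNNReal, ?_⟩
  intro ν u₀ u p hv G hG S t₁ t₂ h0 h12 h2S hδ1 y c hcm hdec E D M hMtop hEM hDM hE hD
  rw [ENNReal.coe_toNNReal hK₁top, ENNReal.coe_toNNReal hK₂top]
  -- ## names
  set δ' : ℝ≥0∞ := ENNReal.ofReal (t₂ - t₁) with hδ'
  set Y : ℝ≥0∞ := M ^ (3 / 2 : ℝ) * δ' ^ (1 / 4 : ℝ) with hY
  set B : Set (EuclideanSpace ℝ (Fin 3)) := ball y 3 with hB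
  set μt : Measure ℝ := volume.restrict (Ioo t₁ t₂) with hμt
  set μB : Measure (EuclideanSpace ℝ (Fin 3)) := volume.restrict B with hμB
  set μ : Measure (ℝ × (EuclideanSpace ℝ (Fin 3))) := volume.restrict (Ioo t₁ t₂ ×ˢ B) with hμ
  have hδ'1 : δ' ≤ 1 := ENNReal.ofReal_le_one.2 hδ1
  have hsubI : Ioo t₁ t₂ ⊆ Ioi (0 : ℝ) := fun t ht => lt_of_le_of_lt h0 ht.1
  -- ## measurability
  have hvm : AEStronglyMeasurable (uncurry u) (volume.restrict (Ioo t₁ t₂ ×ˢ (univ : Set (EuclideanSpace ℝ (Fin 3))))) :=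
    hv.aestronglyMeasurable.mono_measure
      (Measure.restrict_mono (Set.prod_mono hsubI Subset.rfl) le_rfl)
  have hπm : AEStronglyMeasurable (uncurry p) (volume.restrict (Ioo t₁ t₂ ×ˢ (univ : Set (EuclideanSpace ℝ (Fin 3))))) :=
    hv.aestronglyMeasurable_pressure.mono_measure
      (Measure.restrict_mono (Set.prod_mono hsubI Subset.rfl) le_rfl)
  have hGm : AEStronglyMeasurable (uncurry G) (volume.restrict (Ioo t₁ t₂ ×ˢ (univ : Set (EuclideanSpace ℝ (Fin 3))))) := by
    have hGw : HasWeakSpatialGradientOn (slab (EuclideanSpace ℝ (Fin 3)) (Ioo t₁ t₂) isOpen_Ioo) u G :=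
      hG.mono (slab_mono hsubI)
    exact hGw.locallyIntegrableOn_grad.aestronglyMeasurable
  have hbox : ∀ S' : Set (EuclideanSpace ℝ (Fin 3)), μt.prod (volume.restrict S') = volume.restrict (Ioo t₁ t₂ ×ˢ S') :=
    fun S' => by rw [hμt, Measure.prod_restrict, ← Measure.volume_eq_prod]
  have hboxu : μt.prod (volume : Measure (EuclideanSpace ℝ (Fin 3))) = volume.restrict (Ioo t₁ t₂ ×ˢ (univ : Set (EuclideanSpace ℝ (Fin 3)))) := by
    conv_lhs => rw [← Measure.restrict_univ (μ := (volume : Measure (EuclideanSpace ℝ (Fin 3))))]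
    exact hbox univ
  have hsub : ∀ S' : Set (EuclideanSpace ℝ (Fin 3)), Ioo t₁ t₂ ×ˢ S' ⊆ Ioo t₁ t₂ ×ˢ (univ : Set (EuclideanSpace ℝ (Fin 3))) := fun S' =>
    Set.prod_mono Subset.rfl (subset_univ _)
  have hvmS : ∀ S' : Set (EuclideanSpace ℝ (Fin 3)), AEStronglyMeasurable (uncurry u) (volume.restrict (Ioo t₁ t₂ ×ˢ S')) :=
    fun S' => hvm.mono_measure (Measure.restrict_mono (hsub S') le_rfl)
  have hslice_meas : ∀ᵐ t ∂μt, AEStronglyMeasurable (u t) volume := by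
    have h1 : AEStronglyMeasurable (uncurry u) (μt.prod (volume : Measure (EuclideanSpace ℝ (Fin 3)))) := by
      rw [hboxu]; exact hvm
    exact h1.prodMk_left
  have hUm : AEMeasurable (fun z : ℝ × (EuclideanSpace ℝ (Fin 3)) => ‖u z.1 z.2‖ₑ) μ := (hvmS B).enorm
  have hQm : AEMeasurable (fun z : ℝ × (EuclideanSpace ℝ (Fin 3)) => ‖p z.1 z.2 - c z.1‖ₑ) μ := by
    refine (AEStronglyMeasurable.sub ?_ ?_).enorm
    · exact hπm.mono_measure (Measure.restrict_mono (hsub B) le_rfl)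
    · have hcmw : AEStronglyMeasurable c μt :=
        hcm.mono_measure (Measure.restrict_mono (Ioo_subset_Ioo h0 h2S) le_rfl)
      have h2 : AEStronglyMeasurable (fun z : ℝ × (EuclideanSpace ℝ (Fin 3)) => c z.1) (μt.prod μB) := hcmw.comp_fst
      rw [hμB, hbox] at h2
      exact h2
  -- ## radius-3 and radius-6 bounds from the unit-ball bounds
  have hE₃ : ∀ᵐ t ∂μt, ∫⁻ x in ball y 3, ‖u t x‖ₑ ^ 2 ≤ N₃ * M := by
    filter_upwards [hslice_meas, hE] with t hmt hEt
    calc ∫⁻ x in ball y 3, ‖u t x‖ₑ ^ 2 ≤ V1⁻¹ * (E * volume (ball (0 : (EuclideanSpace ℝ (Fin 3))) (3 + 1))) :=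
          setLIntegral_ball_le_of_forall_unitBall (hmt.enorm.pow_const 2) hEt y 3
      _ ≤ V1⁻¹ * (M * volume (ball (0 : (EuclideanSpace ℝ (Fin 3))) (3 + 1))) := by gcongr
      _ = N₃ * M := by rw [hN₃]; ring
  have hE₆ : ∀ᵐ t ∂μt, ∫⁻ x in ball y (2 * 3), ‖u t x‖ₑ ^ 2 ≤ N₆ * M := by
    filter_upwards [hslice_meas, hE] with t hmt hEt
    calc ∫⁻ x in ball y (2 * 3), ‖u t x‖ₑ ^ 2 ≤ V1⁻¹ * (E * volume (ball (0 : (EuclideanSpace ℝ (Fin 3))) (2 * 3 + 1))) :=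
          setLIntegral_ball_le_of_forall_unitBall (hmt.enorm.pow_const 2) hEt y (2 * 3)
      _ ≤ V1⁻¹ * (M * volume (ball (0 : (EuclideanSpace ℝ (Fin 3))) (2 * 3 + 1))) := by gcongr
      _ = N₆ * M := by rw [hN₆]; ring
  have hFG : AEMeasurable (fun w : ℝ × (EuclideanSpace ℝ (Fin 3)) => ENNReal.ofReal (frobeniusNormSq (G w.1 w.2)))
      (volume.restrict (Ioo t₁ t₂ ×ˢ (univ : Set (EuclideanSpace ℝ (Fin 3))))) :=
    (continuous_frobeniusNormSq'.comp_aestronglyMeasurable hGm).aemeasurable.ennreal_ofReal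
  have hD₃ : ∫⁻ w in Ioo t₁ t₂ ×ˢ ball y 3, ENNReal.ofReal (frobeniusNormSq (G w.1 w.2)) ≤ N₃ * M := by
    calc ∫⁻ w in Ioo t₁ t₂ ×ˢ ball y 3, ENNReal.ofReal (frobeniusNormSq (G w.1 w.2))
        ≤ V1⁻¹ * (D * volume (ball (0 : (EuclideanSpace ℝ (Fin 3))) (3 + 1))) :=
          lintegral_box_ball_le_of_forall_unitBall hFG hD y 3
      _ ≤ V1⁻¹ * (M * volume (ball (0 : (EuclideanSpace ℝ (Fin 3))) (3 + 1))) := by gcongr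
      _ = N₃ * M := by rw [hN₃]; ring
  have hD₆ : ∫⁻ w in Ioo t₁ t₂ ×ˢ ball y (2 * 3), ENNReal.ofReal (frobeniusNormSq (G w.1 w.2)) ≤
      N₆ * M := by
    calc ∫⁻ w in Ioo t₁ t₂ ×ˢ ball y (2 * 3), ENNReal.ofReal (frobeniusNormSq (G w.1 w.2))
        ≤ V1⁻¹ * (D * volume (ball (0 : (EuclideanSpace ℝ (Fin 3))) (2 * 3 + 1))) :=
          lintegral_box_ball_le_of_forall_unitBall hFG hD y (2 * 3)
      _ ≤ V1⁻¹ * (M * volume (ball (0 : (EuclideanSpace ℝ (Fin 3))) (2 * 3 + 1))) := by gcongr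
      _ = N₆ * M := by rw [hN₆]; ring
  -- ## the cubic functionals
  have hN₃Mtop : N₃ * M ≠ ⊤ := ENNReal.mul_ne_top hN₃top hMtop
  have hN₆Mtop : N₆ * M ≠ ⊤ := ENNReal.mul_ne_top hN₆top hMtop
  set CUBE₃ : ℝ≥0∞ := ∫⁻ z in Ioo t₁ t₂ ×ˢ ball y 3, ‖u z.1 z.2‖ₑ ^ (3 : ℕ) with hCUBE₃
  set CUBE₆ : ℝ≥0∞ := ∫⁻ z in Ioo t₁ t₂ ×ˢ ball y (2 * 3), ‖u z.1 z.2‖ₑ ^ (3 : ℕ) with hCUBE₆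
  have hC₃ : CUBE₃ ≤ Q₀ * Y := by
    have h := hKc₃ u G t₁ t₂ y (N₃ * M) h0 h12 hδ1 hN₃Mtop hG hE₃ hD₃
    refine h.trans (le_of_eq ?_)
    rw [hQ₀, hY, ENNReal.mul_rpow_of_nonneg _ _ (by norm_num : (0:ℝ) ≤ 3 / 2)]
    ring
  have hC₆ : CUBE₆ ≤ (2 * Kc₆ * N₆ ^ (3 / 2 : ℝ)) * Y := by
    have h := hKc₆ u G t₁ t₂ y (N₆ * M) h0 h12 hδ1 hN₆Mtop hG hE₆ hD₆
    refine h.trans (le_of_eq ?_)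
    rw [hY, ENNReal.mul_rpow_of_nonneg _ _ (by norm_num : (0:ℝ) ≤ 3 / 2)]
    ring
  -- ## the gauged pressure
  set PRESS : ℝ≥0∞ := ∫⁻ z in Ioo t₁ t₂ ×ˢ ball y 3, ‖p z.1 z.2 - c z.1‖ₑ ^ (3 / 2 : ℝ) with hPRESS
  have hP : PRESS ≤ P₀ * Y := by
    have h := lintegral_window_pressure_le hnear hCK0 hCK hv h0 h12 h2S y hcm hdec hE
    refine h.trans ?_
    have hTail : (cK * (V1⁻¹ * (E * (16 * ∫⁻ z in (ball (0 : (EuclideanSpace ℝ (Fin 3))) (2 * 3 - 1))ᶜ,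
        RieszKernel.powKer 4 z)))) ^ (3 / 2 : ℝ) ≤ (cK * τ₀) ^ (3 / 2 : ℝ) * M ^ (3 / 2 : ℝ) := by
      rw [← ENNReal.mul_rpow_of_nonneg _ _ (by norm_num : (0:ℝ) ≤ 3 / 2)]
      refine ENNReal.rpow_le_rpow ?_ (by norm_num)
      calc cK * (V1⁻¹ * (E * (16 * ∫⁻ z in (ball (0 : (EuclideanSpace ℝ (Fin 3))) (2 * 3 - 1))ᶜ, RieszKernel.powKer 4 z)))
          = cK * τ₀ * E := by rw [hτ₀]; ring
        _ ≤ cK * τ₀ * M := by gcongr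
    have hδY : M ^ (3 / 2 : ℝ) * δ' ≤ Y := by
      rw [hY]
      gcongr
      conv_lhs => rw [← ENNReal.rpow_one δ']
      exact ENNReal.rpow_le_rpow_of_exponent_ge hδ'1 (by norm_num)
    calc s2 * Cn * CUBE₆ + s2 * ((cK * (V1⁻¹ * (E * (16 * ∫⁻ z in (ball (0 : (EuclideanSpace ℝ (Fin 3))) (2 * 3 - 1))ᶜ,
            RieszKernel.powKer 4 z)))) ^ (3 / 2 : ℝ) * V3) * δ'
        ≤ s2 * Cn * ((2 * Kc₆ * N₆ ^ (3 / 2 : ℝ)) * Y) +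
            s2 * (((cK * τ₀) ^ (3 / 2 : ℝ) * M ^ (3 / 2 : ℝ)) * V3) * δ' := by gcongr
      _ = s2 * Cn * (2 * Kc₆ * N₆ ^ (3 / 2 : ℝ)) * Y +
            s2 * ((cK * τ₀) ^ (3 / 2 : ℝ) * V3) * (M ^ (3 / 2 : ℝ) * δ') := by ring
      _ ≤ s2 * Cn * (2 * Kc₆ * N₆ ^ (3 / 2 : ℝ)) * Y +
            s2 * ((cK * τ₀) ^ (3 / 2 : ℝ) * V3) * Y := by gcongr
      _ = P₀ * Y := by rw [hP₀]; ring
  -- ## Hölder for the pressure–velocity term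
  have hHolder : ∫⁻ z, ‖p z.1 z.2 - c z.1‖ₑ * ‖u z.1 z.2‖ₑ ∂μ ≤
      P₀ ^ (2 / 3 : ℝ) * Q₀ ^ (1 / 3 : ℝ) * Y := by
    have hpq : Real.HolderConjugate (3 / 2) 3 := Real.holderConjugate_iff.2 ⟨by norm_num, by norm_num⟩
    have key := ENNReal.lintegral_mul_le_Lp_mul_Lq μ hpq hQm hUm
    have e1 : (∫⁻ z, ‖p z.1 z.2 - c z.1‖ₑ ^ (3 / 2 : ℝ) ∂μ) = PRESS := rfl
    have e2 : (∫⁻ z, ‖u z.1 z.2‖ₑ ^ (3 : ℝ) ∂μ) = CUBE₃ := by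
      rw [hCUBE₃, hμ]
      refine lintegral_congr fun z => ?_
      exact_mod_cast ENNReal.rpow_natCast (‖u z.1 z.2‖ₑ) 3
    simp only [Pi.mul_apply] at key
    rw [e1, e2, show (1 : ℝ) / (3 / 2) = 2 / 3 by norm_num] at key
    calc ∫⁻ z, ‖p z.1 z.2 - c z.1‖ₑ * ‖u z.1 z.2‖ₑ ∂μ
        ≤ PRESS ^ (2 / 3 : ℝ) * CUBE₃ ^ (1 / 3 : ℝ) := key
      _ ≤ (P₀ * Y) ^ (2 / 3 : ℝ) * (Q₀ * Y) ^ (1 / 3 : ℝ) := by gcongr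
      _ = P₀ ^ (2 / 3 : ℝ) * Q₀ ^ (1 / 3 : ℝ) * Y := rpow_twoThirds_mul_rpow_third _ _ _
  -- ## the energy term
  have hT1 : ∫⁻ z, ‖u z.1 z.2‖ₑ ^ 2 ∂μ ≤ N₃ * M * δ' := by
    have hF2 : AEMeasurable (fun z : ℝ × (EuclideanSpace ℝ (Fin 3)) => ‖u z.1 z.2‖ₑ ^ 2) (μt.prod μB) := by
      rw [hμB, hbox]; exact (hvmS B).enorm.pow_const 2
    have e : ∫⁻ z, ‖u z.1 z.2‖ₑ ^ 2 ∂μ = ∫⁻ t, ∫⁻ x, ‖u t x‖ₑ ^ 2 ∂μB ∂μt := by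
      rw [hμ, ← hbox B, ← hμB, lintegral_prod _ hF2]
    rw [e]
    calc ∫⁻ t, ∫⁻ x, ‖u t x‖ₑ ^ 2 ∂μB ∂μt ≤ ∫⁻ _t, N₃ * M ∂μt := by
          refine lintegral_mono_ae ?_
          filter_upwards [hE₃] with t ht
          rw [hμB]; exact ht
      _ = N₃ * M * δ' := by
          rw [lintegral_const, hμt, Measure.restrict_apply_univ, Real.volume_Ioo]
  -- ## assemble
  have hpt : ∀ z : ℝ × (EuclideanSpace ℝ (Fin 3)),
      ‖‖u z.1 z.2‖ ^ 2 * Δ (fun w => radialCutoff 2 3 (y - w)) z.2 +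
          (‖u z.1 z.2‖ ^ 2 + 2 * (p z.1 z.2 - c z.1)) * ⟪u z.1 z.2, gradient (fun w => radialCutoff 2 3 (y - w)) z.2⟫‖ₑ ≤
        ENNReal.ofReal CΔ * ‖u z.1 z.2‖ₑ ^ 2 + ENNReal.ofReal Cg * ‖u z.1 z.2‖ₑ ^ (3 : ℕ) +
          2 * ENNReal.ofReal Cg * (‖p z.1 z.2 - c z.1‖ₑ * ‖u z.1 z.2‖ₑ) := fun z =>
    enorm_flux_le hCΔ0 hCg0 hCΔ hCg y (u z.1 z.2) (p z.1 z.2 - c z.1) z.2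
  have hm1 : AEMeasurable (fun z : ℝ × (EuclideanSpace ℝ (Fin 3)) => ENNReal.ofReal CΔ * ‖u z.1 z.2‖ₑ ^ 2) μ :=
    (hUm.pow_const 2).const_mul _
  have hm2 : AEMeasurable (fun z : ℝ × (EuclideanSpace ℝ (Fin 3)) => ENNReal.ofReal Cg * ‖u z.1 z.2‖ₑ ^ (3 : ℕ)) μ :=
    (hUm.pow_const 3).const_mul _
  have hm3 : AEMeasurable (fun z : ℝ × (EuclideanSpace ℝ (Fin 3)) => ‖p z.1 z.2 - c z.1‖ₑ * ‖u z.1 z.2‖ₑ) μ := hQm.mul hUm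
  have hm12 : AEMeasurable (fun z : ℝ × (EuclideanSpace ℝ (Fin 3)) =>
      ENNReal.ofReal CΔ * ‖u z.1 z.2‖ₑ ^ 2 + ENNReal.ofReal Cg * ‖u z.1 z.2‖ₑ ^ (3 : ℕ)) μ := hm1.add hm2
  calc ∫⁻ z in Ioo t₁ t₂ ×ˢ ball y 3,
          ‖‖u z.1 z.2‖ ^ 2 * Δ (fun w => radialCutoff 2 3 (y - w)) z.2 +
            (‖u z.1 z.2‖ ^ 2 + 2 * (p z.1 z.2 - c z.1)) * ⟪u z.1 z.2, gradient (fun w => radialCutoff 2 3 (y - w)) z.2⟫‖ₑ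
      ≤ ∫⁻ z, (ENNReal.ofReal CΔ * ‖u z.1 z.2‖ₑ ^ 2 + ENNReal.ofReal Cg * ‖u z.1 z.2‖ₑ ^ (3 : ℕ) +
          2 * ENNReal.ofReal Cg * (‖p z.1 z.2 - c z.1‖ₑ * ‖u z.1 z.2‖ₑ)) ∂μ :=
        lintegral_mono fun z => hpt z
    _ = ENNReal.ofReal CΔ * ∫⁻ z, ‖u z.1 z.2‖ₑ ^ 2 ∂μ + ENNReal.ofReal Cg * CUBE₃ +
          2 * ENNReal.ofReal Cg * ∫⁻ z, ‖p z.1 z.2 - c z.1‖ₑ * ‖u z.1 z.2‖ₑ ∂μ := by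
        rw [lintegral_add_left' hm12, lintegral_add_left' hm1,
          lintegral_const_mul' _ _ ENNReal.ofReal_ne_top,
          lintegral_const_mul' _ _ ENNReal.ofReal_ne_top,
          lintegral_const_mul' _ _ (ENNReal.mul_ne_top ENNReal.ofNat_ne_top ENNReal.ofReal_ne_top)]
    _ ≤ ENNReal.ofReal CΔ * (N₃ * M * δ') + ENNReal.ofReal Cg * (Q₀ * Y) +
          2 * ENNReal.ofReal Cg * (P₀ ^ (2 / 3 : ℝ) * Q₀ ^ (1 / 3 : ℝ) * Y) := by
        gcongr
    _ = K₁ * δ' * M + K₂ * M ^ (3 / 2 : ℝ) * δ' ^ (1 / 4 : ℝ) := by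
        rw [hK₁, hK₂, hY]; ring


/-- **The gauged pressure on a time window, closed form**: an absolute `P₀` with
`∫∫_{(t₁,t₂)×B_3(y)} |p - c|^{3/2} ≤ P₀ M^{3/2} (t₂ - t₁)^{1/4}` under the hypotheses of
`exists_window_flux_le` (Jia–Šverák 2013, (2.9): "`sup_{x₀} ∫₀^{λR²}∫_{B_R(x₀)} |p - p(t)|^{3/2} ≤ Cα^{3/2}R^{1/2}`",
before inserting `A(λ) ≤ Cα`). [cite: JiaSverak2013, Lemma 2 (2.9) and its proof (arXiv:1201.1592 pp. 3–4)] -/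
theorem exists_window_pressure_bound :
    ∃ P₀ : ℝ≥0, ∀ {ν : ℝ} {u₀ : (EuclideanSpace ℝ (Fin 3)) → (EuclideanSpace ℝ (Fin 3))} {u : ℝ → (EuclideanSpace ℝ (Fin 3)) → (EuclideanSpace ℝ (Fin 3))} {p : ℝ → (EuclideanSpace ℝ (Fin 3)) → ℝ}
      (_hv : IsLocalLeraySolution ν u₀ u p) {G : ℝ → (EuclideanSpace ℝ (Fin 3)) → (EuclideanSpace ℝ (Fin 3)) →L[ℝ] (EuclideanSpace ℝ (Fin 3))}
      (_hG : HasWeakSpatialGradientOn (slab (EuclideanSpace ℝ (Fin 3)) (Ioi 0) isOpen_Ioi) u G)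
      {S t₁ t₂ : ℝ} (_h0 : 0 ≤ t₁) (_h12 : t₁ ≤ t₂) (_h2S : t₂ ≤ S) (_hδ1 : t₂ - t₁ ≤ 1) (y : (EuclideanSpace ℝ (Fin 3)))
      {c : ℝ → ℝ} (_hcm : AEStronglyMeasurable c (volume.restrict (Ioo 0 S)))
      (_hdec : ∀ᵐ z ∂(volume.restrict (Ioo 0 S ×ˢ ball y 3)),
        p z.1 z.2 - c z.1 = localPressureNear y 3 u z.1 z.2 + localPressureFar y 3 u z.1 z.2)
      {E D M : ℝ≥0∞} (_hMtop : M ≠ ⊤) (_hEM : E ≤ M) (_hDM : D ≤ M)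
      (_hE : ∀ᵐ t ∂(volume.restrict (Ioo t₁ t₂)), ∀ z : (EuclideanSpace ℝ (Fin 3)), ∫⁻ x in ball z 1, ‖u t x‖ₑ ^ 2 ≤ E)
      (_hD : ∀ z : (EuclideanSpace ℝ (Fin 3)),
        ∫⁻ w in Ioo t₁ t₂ ×ˢ ball z 1, ENNReal.ofReal (frobeniusNormSq (G w.1 w.2)) ≤ D),
      ∫⁻ z in Ioo t₁ t₂ ×ˢ ball y 3, ‖p z.1 z.2 - c z.1‖ₑ ^ (3 / 2 : ℝ) ≤
        P₀ * M ^ (3 / 2 : ℝ) * ENNReal.ofReal (t₂ - t₁) ^ (1 / 4 : ℝ) := by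
  obtain ⟨Cn, -, hCntop, hnear⟩ :=
    exists_lintegral_localPressureNear_le stein1970_normalisedPressure_ae_Lp_bound_holds
  obtain ⟨CK, hCK0, hCK⟩ := exists_abs_pressureKernel_sub_le
  obtain ⟨Kc₆, hKc₆⟩ := exists_lintegral_cube_window_le (2 * 3)
  -- ## constants
  set V1 : ℝ≥0∞ := volume (ball (0 : (EuclideanSpace ℝ (Fin 3))) 1) with hV1
  set N₆ : ℝ≥0∞ := V1⁻¹ * volume (ball (0 : (EuclideanSpace ℝ (Fin 3))) (2 * 3 + 1)) with hN₆
  set s2 : ℝ≥0∞ := (2 : ℝ≥0∞) ^ (1 / 2 : ℝ) with hs2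
  set cK : ℝ≥0∞ := ENNReal.ofReal (CK * 3) with hcK
  set τ₀ : ℝ≥0∞ := V1⁻¹ * (16 * ∫⁻ z in (ball (0 : (EuclideanSpace ℝ (Fin 3))) (2 * 3 - 1))ᶜ, RieszKernel.powKer 4 z)
    with hτ₀
  set V3 : ℝ≥0∞ := volume (ball (0 : (EuclideanSpace ℝ (Fin 3))) 3) with hV3
  set P₀ : ℝ≥0∞ := s2 * Cn * (2 * Kc₆ * N₆ ^ (3 / 2 : ℝ)) + s2 * ((cK * τ₀) ^ (3 / 2 : ℝ) * V3)
    with hP₀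
  -- ## finiteness of the constants
  have hV10 : V1 ≠ 0 := volume_unitBall_ne_zero
  have hV1inv : V1⁻¹ ≠ ⊤ := ENNReal.inv_ne_top.2 hV10
  have hN₆top : N₆ ≠ ⊤ := ENNReal.mul_ne_top hV1inv measure_ball_lt_top.ne
  have hs2top : s2 ≠ ⊤ := ENNReal.rpow_ne_top_of_nonneg (by norm_num) ENNReal.ofNat_ne_top
  have hτ₀top : τ₀ ≠ ⊤ := by
    refine ENNReal.mul_ne_top hV1inv (ENNReal.mul_ne_top (by norm_num) ?_)
    exact (RieszKernel.lintegral_compl_ball_powKer_lt_top (by norm_num) (by norm_num)).ne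
  have hP₀top : P₀ ≠ ⊤ := by
    refine ENNReal.add_ne_top.2 ⟨?_, ?_⟩
    · exact ENNReal.mul_ne_top (ENNReal.mul_ne_top hs2top hCntop)
        (ENNReal.mul_ne_top (ENNReal.mul_ne_top ENNReal.ofNat_ne_top ENNReal.coe_ne_top)
          (ENNReal.rpow_ne_top_of_nonneg (by norm_num) hN₆top))
    · refine ENNReal.mul_ne_top hs2top (ENNReal.mul_ne_top ?_ measure_ball_lt_top.ne)
      exact ENNReal.rpow_ne_top_of_nonneg (by norm_num)
        (ENNReal.mul_ne_top ENNReal.ofReal_ne_top hτ₀top)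
  refine ⟨P₀.toNNReal, ?_⟩
  intro ν u₀ u p hv G hG S t₁ t₂ h0 h12 h2S hδ1 y c hcm hdec E D M hMtop hEM hDM hE hD
  rw [ENNReal.coe_toNNReal hP₀top]
  -- ## names
  set δ' : ℝ≥0∞ := ENNReal.ofReal (t₂ - t₁) with hδ'
  set Y : ℝ≥0∞ := M ^ (3 / 2 : ℝ) * δ' ^ (1 / 4 : ℝ) with hY
  set μt : Measure ℝ := volume.restrict (Ioo t₁ t₂) with hμt
  have hδ'1 : δ' ≤ 1 := ENNReal.ofReal_le_one.2 hδ1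
  have hsubI : Ioo t₁ t₂ ⊆ Ioi (0 : ℝ) := fun t ht => lt_of_le_of_lt h0 ht.1
  -- ## measurability
  have hvm : AEStronglyMeasurable (uncurry u) (volume.restrict (Ioo t₁ t₂ ×ˢ (univ : Set (EuclideanSpace ℝ (Fin 3))))) :=
    hv.aestronglyMeasurable.mono_measure
      (Measure.restrict_mono (Set.prod_mono hsubI Subset.rfl) le_rfl)
  have hGm : AEStronglyMeasurable (uncurry G) (volume.restrict (Ioo t₁ t₂ ×ˢ (univ : Set (EuclideanSpace ℝ (Fin 3))))) := by
    have hGw : HasWeakSpatialGradientOn (slab (EuclideanSpace ℝ (Fin 3)) (Ioo t₁ t₂) isOpen_Ioo) u G :=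
      hG.mono (slab_mono hsubI)
    exact hGw.locallyIntegrableOn_grad.aestronglyMeasurable
  have hboxu : μt.prod (volume : Measure (EuclideanSpace ℝ (Fin 3))) = volume.restrict (Ioo t₁ t₂ ×ˢ (univ : Set (EuclideanSpace ℝ (Fin 3)))) := by
    conv_lhs => rw [← Measure.restrict_univ (μ := (volume : Measure (EuclideanSpace ℝ (Fin 3))))]
    rw [hμt, Measure.prod_restrict, ← Measure.volume_eq_prod]
  have hslice_meas : ∀ᵐ t ∂μt, AEStronglyMeasurable (u t) volume := by
    have h1 : AEStronglyMeasurable (uncurry u) (μt.prod (volume : Measure (EuclideanSpace ℝ (Fin 3)))) := by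
      rw [hboxu]; exact hvm
    exact h1.prodMk_left
  -- ## radius-6 bounds from the unit-ball bounds
  have hE₆ : ∀ᵐ t ∂μt, ∫⁻ x in ball y (2 * 3), ‖u t x‖ₑ ^ 2 ≤ N₆ * M := by
    filter_upwards [hslice_meas, hE] with t hmt hEt
    calc ∫⁻ x in ball y (2 * 3), ‖u t x‖ₑ ^ 2 ≤ V1⁻¹ * (E * volume (ball (0 : (EuclideanSpace ℝ (Fin 3))) (2 * 3 + 1))) :=
          setLIntegral_ball_le_of_forall_unitBall (hmt.enorm.pow_const 2) hEt y (2 * 3)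
      _ ≤ V1⁻¹ * (M * volume (ball (0 : (EuclideanSpace ℝ (Fin 3))) (2 * 3 + 1))) := by gcongr
      _ = N₆ * M := by rw [hN₆]; ring
  have hFG : AEMeasurable (fun w : ℝ × (EuclideanSpace ℝ (Fin 3)) => ENNReal.ofReal (frobeniusNormSq (G w.1 w.2)))
      (volume.restrict (Ioo t₁ t₂ ×ˢ (univ : Set (EuclideanSpace ℝ (Fin 3))))) :=
    (continuous_frobeniusNormSq'.comp_aestronglyMeasurable hGm).aemeasurable.ennreal_ofReal
  have hD₆ : ∫⁻ w in Ioo t₁ t₂ ×ˢ ball y (2 * 3), ENNReal.ofReal (frobeniusNormSq (G w.1 w.2)) ≤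
      N₆ * M := by
    calc ∫⁻ w in Ioo t₁ t₂ ×ˢ ball y (2 * 3), ENNReal.ofReal (frobeniusNormSq (G w.1 w.2))
        ≤ V1⁻¹ * (D * volume (ball (0 : (EuclideanSpace ℝ (Fin 3))) (2 * 3 + 1))) :=
          lintegral_box_ball_le_of_forall_unitBall hFG hD y (2 * 3)
      _ ≤ V1⁻¹ * (M * volume (ball (0 : (EuclideanSpace ℝ (Fin 3))) (2 * 3 + 1))) := by gcongr
      _ = N₆ * M := by rw [hN₆]; ring
  -- ## the cubic functional on the box of radius `6`
  have hN₆Mtop : N₆ * M ≠ ⊤ := ENNReal.mul_ne_top hN₆top hMtop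
  set CUBE₆ : ℝ≥0∞ := ∫⁻ z in Ioo t₁ t₂ ×ˢ ball y (2 * 3), ‖u z.1 z.2‖ₑ ^ (3 : ℕ) with hCUBE₆
  have hC₆ : CUBE₆ ≤ (2 * Kc₆ * N₆ ^ (3 / 2 : ℝ)) * Y := by
    have h := hKc₆ u G t₁ t₂ y (N₆ * M) h0 h12 hδ1 hN₆Mtop hG hE₆ hD₆
    refine h.trans (le_of_eq ?_)
    rw [hY, ENNReal.mul_rpow_of_nonneg _ _ (by norm_num : (0:ℝ) ≤ 3 / 2)]
    ring
  -- ## the gauged pressure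
  have h := lintegral_window_pressure_le hnear hCK0 hCK hv h0 h12 h2S y hcm hdec hE
  refine h.trans ?_
  have hTail : (cK * (V1⁻¹ * (E * (16 * ∫⁻ z in (ball (0 : (EuclideanSpace ℝ (Fin 3))) (2 * 3 - 1))ᶜ,
      RieszKernel.powKer 4 z)))) ^ (3 / 2 : ℝ) ≤ (cK * τ₀) ^ (3 / 2 : ℝ) * M ^ (3 / 2 : ℝ) := by
    rw [← ENNReal.mul_rpow_of_nonneg _ _ (by norm_num : (0:ℝ) ≤ 3 / 2)]
    refine ENNReal.rpow_le_rpow ?_ (by norm_num)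
    calc cK * (V1⁻¹ * (E * (16 * ∫⁻ z in (ball (0 : (EuclideanSpace ℝ (Fin 3))) (2 * 3 - 1))ᶜ, RieszKernel.powKer 4 z)))
        = cK * τ₀ * E := by rw [hτ₀]; ring
      _ ≤ cK * τ₀ * M := by gcongr
  have hδY : M ^ (3 / 2 : ℝ) * δ' ≤ Y := by
    rw [hY]
    gcongr
    conv_lhs => rw [← ENNReal.rpow_one δ']
    exact ENNReal.rpow_le_rpow_of_exponent_ge hδ'1 (by norm_num)
  calc s2 * Cn * CUBE₆ + s2 * ((cK * (V1⁻¹ * (E * (16 * ∫⁻ z in (ball (0 : (EuclideanSpace ℝ (Fin 3))) (2 * 3 - 1))ᶜ,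
          RieszKernel.powKer 4 z)))) ^ (3 / 2 : ℝ) * V3) * δ'
      ≤ s2 * Cn * ((2 * Kc₆ * N₆ ^ (3 / 2 : ℝ)) * Y) +
          s2 * (((cK * τ₀) ^ (3 / 2 : ℝ) * M ^ (3 / 2 : ℝ)) * V3) * δ' := by gcongr
    _ = s2 * Cn * (2 * Kc₆ * N₆ ^ (3 / 2 : ℝ)) * Y +
          s2 * ((cK * τ₀) ^ (3 / 2 : ℝ) * V3) * (M ^ (3 / 2 : ℝ) * δ') := by ring
    _ ≤ s2 * Cn * (2 * Kc₆ * N₆ ^ (3 / 2 : ℝ)) * Y +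
          s2 * ((cK * τ₀) ^ (3 / 2 : ℝ) * V3) * Y := by gcongr
    _ = P₀ * Y := by rw [hP₀]; ring
    _ = P₀ * M ^ (3 / 2 : ℝ) * δ' ^ (1 / 4 : ℝ) := by rw [hY]; ring

/-! ### The integer lattice of centres -/

/-- Every point of `ℝ³` is within distance `< 1` of an integer lattice point (round each
coordinate: the error has norm `≤ √3/2 < 1`). [folklore] -/
theorem exists_lattice_dist_lt (x : (EuclideanSpace ℝ (Fin 3))) :
    ∃ k : Fin 3 → ℤ, dist x ((WithLp.equiv 2 (Fin 3 → ℝ)).symm fun i => (k i : ℝ)) < 1 := by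
  refine ⟨fun i => round (x i), ?_⟩
  rw [EuclideanSpace.dist_eq]
  have hsum : ∑ i, dist (x i) (((WithLp.equiv 2 (Fin 3 → ℝ)).symm fun i => ((round (x i) : ℤ) : ℝ)) i) ^ 2
      ≤ 3 / 4 := by
    have hle : ∀ i, dist (x i) (((WithLp.equiv 2 (Fin 3 → ℝ)).symm
        fun i => ((round (x i) : ℤ) : ℝ)) i) ^ 2 ≤ 1 / 4 := fun i => by
      rw [show ((WithLp.equiv 2 (Fin 3 → ℝ)).symm fun i => ((round (x i) : ℤ) : ℝ)) i =
        ((round (x i) : ℤ) : ℝ) from rfl, Real.dist_eq]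
      have h := abs_sub_round (x i)
      have h0 := abs_nonneg (x i - round (x i))
      calc |x i - ↑(round (x i))| ^ 2 ≤ (1 / 2) ^ 2 := pow_le_pow_left₀ h0 h 2
        _ = 1 / 4 := by norm_num
    calc ∑ i, dist (x i) (((WithLp.equiv 2 (Fin 3 → ℝ)).symm fun i => ((round (x i) : ℤ) : ℝ)) i) ^ 2
        ≤ ∑ _i : Fin 3, (1 / 4 : ℝ) := Finset.sum_le_sum fun i _ => hle i
      _ = 3 / 4 := by simp; norm_num
  rw [Real.sqrt_lt' one_pos]
  linarith

/-- The unit ball about `x` lies in the closed ball of radius `2` about any point at distance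
`< 1` from `x`. [folklore] -/
theorem ball_subset_closedBall_two {x y : (EuclideanSpace ℝ (Fin 3))} (h : dist x y < 1) : ball x 1 ⊆ closedBall y 2 :=
  fun z hz => by
    rw [mem_closedBall]
    rw [mem_ball] at hz
    linarith [dist_triangle z x y]

/-- The unit ball about `x` lies in `B(0, ‖y‖ + 4)` for any `y` at distance `< 1` from `x`.
[folklore] -/
theorem ball_subset_ball_norm_add_four {x y : (EuclideanSpace ℝ (Fin 3))} (h : dist x y < 1) :
    ball x 1 ⊆ ball (0 : (EuclideanSpace ℝ (Fin 3))) (‖y‖ + 4) :=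
  fun z hz => by
    rw [mem_ball, dist_zero_right]
    rw [mem_ball] at hz
    have := dist_triangle z x y
    have h2 : ‖z‖ ≤ dist z y + ‖y‖ := by
      rw [dist_eq_norm]; linarith [norm_le_norm_add_norm_sub' z y, norm_sub_rev z y]
    linarith

/-! ### Boxes: endpoints, additivity -/

/-- **A bound at a.e. earlier time is a bound at the endpoint**: if
`∫∫_{(0,s')×B} g ≤ C` for a.e. `s' ∈ (0, s)`, then `∫∫_{(0,s)×B} g ≤ C` (the boxes over good
times `s' ↑ s` exhaust `(0,s) × B`; lower integrals are continuous along directed unions).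
[folklore] -/
theorem setLIntegral_prod_le_of_ae {B : Set (EuclideanSpace ℝ (Fin 3))} {g : ℝ × (EuclideanSpace ℝ (Fin 3)) → ℝ≥0∞} {s : ℝ} (hs : 0 < s)
    {C : ℝ≥0∞} (h : ∀ᵐ s' ∂(volume.restrict (Ioo 0 s)), ∫⁻ z in Ioo 0 s' ×ˢ B, g z ≤ C) :
    ∫⁻ z in Ioo 0 s ×ˢ B, g z ≤ C := by
  -- good times arbitrarily close to `s`
  have hgood : ∀ n : ℕ, ∃ t, t ∈ Ioo (s - s / (n + 2)) s ∧ ∫⁻ z in Ioo 0 t ×ˢ B, g z ≤ C := by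
    intro n
    have hn : (0 : ℝ) < n + 2 := by positivity
    have hdiv : s / (n + 2) ≤ s := div_le_self hs.le (by linarith)
    have hsub : Ioo (s - s / (n + 2)) s ⊆ Ioo 0 s := Ioo_subset_Ioo (by linarith) le_rfl
    have h1 := ae_restrict_of_ae_restrict_of_subset hsub h
    have h2 : ∀ᵐ s' ∂(volume.restrict (Ioo (s - s / (n + 2)) s)), s' ∈ Ioo (s - s / (n + 2)) s :=
      ae_restrict_mem measurableSet_Ioo
    haveI hne : (ae (volume.restrict (Ioo (s - s / (n + 2)) s))).NeBot := by
      rw [ae_neBot, Ne, Measure.restrict_eq_zero, Real.volume_Ioo, ENNReal.ofReal_eq_zero, not_le]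
      have : 0 < s / (n + 2) := div_pos hs hn
      linarith
    obtain ⟨t, ht⟩ := (h2.and h1).exists
    exact ⟨t, ht.1, ht.2⟩
  choose t ht using hgood
  -- every `m < s` is eventually below `t n`
  have hreach : ∀ m : ℝ, m < s → ∃ n : ℕ, m < t n := by
    intro m hm
    obtain ⟨n, hn⟩ := exists_nat_ge (s / (s - m))
    refine ⟨n, ?_⟩
    have hsm : 0 < s - m := by linarith
    have hn2 : s / (s - m) < (n : ℝ) + 2 := by linarith
    have hlt : s / ((n : ℝ) + 2) < s - m := by
      rw [div_lt_iff₀ (by positivity : (0 : ℝ) < n + 2)]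
      rw [div_lt_iff₀ hsm] at hn2
      linarith
    linarith [(ht n).1.1]
  have hdir : Directed (· ⊆ ·) (fun n => Ioo 0 (t n) ×ˢ B) := by
    intro i j
    obtain ⟨k, hk⟩ := hreach (max (t i) (t j)) (max_lt (ht i).1.2 (ht j).1.2)
    refine ⟨k, Set.prod_mono (Ioo_subset_Ioo le_rfl ?_) Subset.rfl,
      Set.prod_mono (Ioo_subset_Ioo le_rfl ?_) Subset.rfl⟩
    · exact ((le_max_left _ _).trans_lt hk).le
    · exact ((le_max_right _ _).trans_lt hk).le
  have hU : (⋃ n, Ioo 0 (t n) ×ˢ B) = Ioo 0 s ×ˢ B := by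
    rw [← Set.iUnion_prod_const]
    congr 1
    ext x
    simp only [mem_iUnion, mem_Ioo]
    constructor
    · rintro ⟨n, h1, h2⟩
      exact ⟨h1, h2.trans (ht n).1.2⟩
    · rintro ⟨h1, h2⟩
      obtain ⟨n, hn⟩ := hreach x h2
      exact ⟨n, h1, hn⟩
  rw [← hU, setLIntegral_iUnion_of_directed _ hdir]
  exact iSup_le fun n => (ht n).2

/-- A half-open time box carries the same lower integrals as the open one (the slice `{b} × B` is
null). [folklore] -/
theorem setLIntegral_prod_Ico_eq_Ioo (a b : ℝ) (B : Set (EuclideanSpace ℝ (Fin 3))) (g : ℝ × (EuclideanSpace ℝ (Fin 3)) → ℝ≥0∞) :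
    ∫⁻ z in Ico a b ×ˢ B, g z = ∫⁻ z in Ioo a b ×ˢ B, g z := by
  refine setLIntegral_congr ?_
  have hnull : volume (({a} : Set ℝ) ×ˢ (univ : Set (EuclideanSpace ℝ (Fin 3)))) = 0 := by
    rw [Measure.volume_eq_prod, Measure.prod_prod, Real.volume_singleton, zero_mul]
  refine (ae_eq_set).2 ⟨measure_mono_null (fun z hz => ?_) hnull, measure_mono_null (fun z hz => ?_) hnull⟩
  · have h1 : z.1 ∈ Ico a b := hz.1.1
    have h2 : z.1 ∉ Ioo a b := fun h' => hz.2 ⟨h', hz.1.2⟩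
    refine ⟨?_, mem_univ _⟩
    rw [mem_Ioo, not_and'] at h2
    have : ¬ a < z.1 := h2 h1.2
    exact mem_singleton_iff.2 (le_antisymm (not_lt.1 this) h1.1)
  · exact absurd (⟨Ioo_subset_Ico_self hz.1.1, hz.1.2⟩ : z ∈ Ico a b ×ˢ B) hz.2

/-- **Additivity of boxes in time**: `∫∫_{(a,c)×B} g ≤ ∫∫_{(a,b)×B} g + ∫∫_{(b,c)×B} g` for
`a ≤ b ≤ c`. [folklore] -/
theorem setLIntegral_prod_Ioo_le_add {a b c : ℝ} (B : Set (EuclideanSpace ℝ (Fin 3))) (g : ℝ × (EuclideanSpace ℝ (Fin 3)) → ℝ≥0∞) :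
    ∫⁻ z in Ioo a c ×ˢ B, g z ≤ (∫⁻ z in Ioo a b ×ˢ B, g z) + ∫⁻ z in Ioo b c ×ˢ B, g z := by
  have hsub : Ioo a c ×ˢ B ⊆ Ioo a b ×ˢ B ∪ Ico b c ×ˢ B := by
    rintro z ⟨⟨h1, h2⟩, h3⟩
    rcases lt_or_ge z.1 b with h | h
    · exact Or.inl ⟨⟨h1, h⟩, h3⟩
    · exact Or.inr ⟨⟨h, h2⟩, h3⟩
  calc ∫⁻ z in Ioo a c ×ˢ B, g z ≤ ∫⁻ z in Ioo a b ×ˢ B ∪ Ico b c ×ˢ B, g z := lintegral_mono_set hsub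
    _ ≤ (∫⁻ z in Ioo a b ×ˢ B, g z) + ∫⁻ z in Ico b c ×ˢ B, g z := lintegral_union_le _ _ _
    _ = (∫⁻ z in Ioo a b ×ˢ B, g z) + ∫⁻ z in Ioo b c ×ˢ B, g z := by
        rw [setLIntegral_prod_Ico_eq_Ioo]

/-- Restricting a lower integral over a box to the part of the box where the integrand can be
nonzero. [folklore] -/
theorem setLIntegral_prod_le_of_eq_zero_off {I : Set ℝ} {A S : Set (EuclideanSpace ℝ (Fin 3))} (hS : MeasurableSet S)
    {g : ℝ × (EuclideanSpace ℝ (Fin 3)) → ℝ≥0∞} (hg : ∀ z : ℝ × (EuclideanSpace ℝ (Fin 3)), z.2 ∉ S → g z = 0) :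
    ∫⁻ z in I ×ˢ A, g z ≤ ∫⁻ z in I ×ˢ S, g z := by
  have hind : ∀ z : ℝ × (EuclideanSpace ℝ (Fin 3)), g z = ((univ : Set ℝ) ×ˢ S).indicator g z := fun z => by
    by_cases hz : z.2 ∈ S
    · rw [indicator_of_mem (show z ∈ (univ : Set ℝ) ×ˢ S from ⟨mem_univ _, hz⟩)]
    · rw [indicator_of_notMem (fun h : z ∈ (univ : Set ℝ) ×ˢ S => hz h.2), hg z hz]
  calc ∫⁻ z in I ×ˢ A, g z = ∫⁻ z in I ×ˢ A, ((univ : Set ℝ) ×ˢ S).indicator g z :=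
        lintegral_congr fun z => hind z
    _ = ∫⁻ z in (univ : Set ℝ) ×ˢ S ∩ I ×ˢ A, g z := by
        rw [lintegral_indicator (MeasurableSet.univ.prod hS), Measure.restrict_restrict
          (MeasurableSet.univ.prod hS)]
    _ ≤ ∫⁻ z in I ×ˢ S, g z := lintegral_mono_set fun z hz => ⟨hz.2.1, hz.1.2⟩

/-! ### A measurable gauge for the pressure at a centre -/

/-- `(0, ∞) = ⋃ₙ (0, n+1)`. [folklore] -/
theorem iUnion_Ioo_zero_nat_succ : (⋃ n : ℕ, Ioo (0 : ℝ) (n + 1)) = Ioi 0 := by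
  ext x
  simp only [mem_iUnion, mem_Ioo, mem_Ioi]
  constructor
  · rintro ⟨n, h1, -⟩; exact h1
  · intro hx
    obtain ⟨n, hn⟩ := exists_nat_gt x
    exact ⟨n, hx, by linarith⟩

/-- **A measurable, horizon-independent gauge for the pressure at a centre** (Kang–Miura–Tsai
2021, Lemma 3.4, through the tree's `kangMiuraTsai_pressure_decomposition_holds` and
`exists_gauge_of_pressure_decomposition`, modified on a null set of times to be measurable): for a
local Leray solution `(u, p)` with `E²` datum and a centre `y` there is a measurable `c : ℝ → ℝ`,
in `L^{3/2}(0,T)` for every `T`, with `p - c = p_loc + p_far` a.e. on `(0,T) × B_3(y)` for every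
`T`, and `∫∫_{(0,T)×B_R} |p - c|^{3/2} < ∞` for all `T, R` (so that `(u, p - c)` is again a local
Leray solution, `IsLocalLeraySolution.sub_pressure`). [cite: KangMiuraTsai2020, Lemma 3.4 (the gauge c_{x₀,r}), arXiv:1812.10509 p. 8] -/
theorem exists_measurable_gauge {u₀ : (EuclideanSpace ℝ (Fin 3)) → (EuclideanSpace ℝ (Fin 3))} (hE2 : MemE2 u₀) (hdiv : IsWeaklyDivFree u₀)
    {u : ℝ → (EuclideanSpace ℝ (Fin 3)) → (EuclideanSpace ℝ (Fin 3))} {p : ℝ → (EuclideanSpace ℝ (Fin 3)) → ℝ} (hv : IsLocalLeraySolution 1 u₀ u p) (y : (EuclideanSpace ℝ (Fin 3))) :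
    ∃ c : ℝ → ℝ, Measurable c ∧
      (∀ T : ℝ, 0 < T → MemLp c (3 / 2 : ℝ≥0∞) (volume.restrict (Ioo 0 T))) ∧
      (∀ T : ℝ, 0 < T → ∀ᵐ z ∂(volume.restrict (Ioo 0 T ×ˢ ball y 3)),
        p z.1 z.2 - c z.1 = localPressureNear y 3 u z.1 z.2 + localPressureFar y 3 u z.1 z.2) ∧
      ∀ T R : ℝ, 0 < T → 0 < R →
        ∫⁻ z in Ioo 0 T ×ˢ ball (0 : (EuclideanSpace ℝ (Fin 3))) R, ‖p z.1 z.2 - c z.1‖ₑ ^ (3 / 2 : ℝ) < ⊤ := by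
  obtain ⟨c₀, hc₀⟩ := exists_gauge_of_pressure_decomposition kangMiuraTsai_pressure_decomposition_holds
    hE2 hdiv hv y (by norm_num : (0 : ℝ) < 3)
  -- a measurable modification on `(0, ∞)`
  have hae : AEMeasurable c₀ (volume.restrict (Ioi (0 : ℝ))) := by
    rw [← iUnion_Ioo_zero_nat_succ]
    exact (aemeasurable_iUnion_iff).2 fun n =>
      (hc₀ (n + 1) (by positivity)).1.aestronglyMeasurable.aemeasurable
  set c : ℝ → ℝ := hae.mk c₀ with hc
  have hcm : Measurable c := hae.measurable_mk
  have hcc : c₀ =ᵐ[volume.restrict (Ioi (0 : ℝ))] c := hae.ae_eq_mk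
  have hccT : ∀ T : ℝ, c₀ =ᵐ[volume.restrict (Ioo 0 T)] c := fun T =>
    ae_restrict_of_ae_restrict_of_subset Ioo_subset_Ioi_self hcc
  have hmem : ∀ T : ℝ, 0 < T → MemLp c (3 / 2 : ℝ≥0∞) (volume.restrict (Ioo 0 T)) := fun T hT =>
    (hc₀ T hT).1.ae_eq (hccT T)
  have hbox : ∀ (T : ℝ) (S : Set (EuclideanSpace ℝ (Fin 3))),
      (volume.restrict (Ioo 0 T)).prod (volume.restrict S) = volume.restrict (Ioo 0 T ×ˢ S) :=
    fun T S => by rw [Measure.prod_restrict, ← Measure.volume_eq_prod]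
  have hdec : ∀ T : ℝ, 0 < T → ∀ᵐ z ∂(volume.restrict (Ioo 0 T ×ˢ ball y 3)),
      p z.1 z.2 - c z.1 = localPressureNear y 3 u z.1 z.2 + localPressureFar y 3 u z.1 z.2 := by
    intro T hT
    have hfst : (fun z : ℝ × (EuclideanSpace ℝ (Fin 3)) => c₀ z.1) =ᵐ[(volume.restrict (Ioo 0 T)).prod (volume.restrict (ball y 3))]
        fun z => c z.1 :=
      Measure.QuasiMeasurePreserving.ae_eq Measure.quasiMeasurePreserving_fst (hccT T)
    rw [hbox] at hfst
    filter_upwards [(hc₀ T hT).2, hfst] with z h1 h2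
    rw [← h1, ← h2]
  refine ⟨c, hcm, hmem, hdec, fun T R hT hR => ?_⟩
  -- finiteness on `(0,T) × B_R`
  set S : Set (ℝ × (EuclideanSpace ℝ (Fin 3))) := Ioo 0 T ×ˢ ball (0 : (EuclideanSpace ℝ (Fin 3))) R with hS
  have hπm : AEStronglyMeasurable (uncurry p) (volume.restrict S) :=
    hv.aestronglyMeasurable_pressure.mono_measure
      (Measure.restrict_mono (Set.prod_mono Ioo_subset_Ioi_self (subset_univ _)) le_rfl)
  have hπS : AEMeasurable (fun z : ℝ × (EuclideanSpace ℝ (Fin 3)) => ‖p z.1 z.2‖ₑ ^ (3 / 2 : ℝ)) (volume.restrict S) :=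
    hπm.aemeasurable.enorm.pow_const _
  have hpt : ∀ z : ℝ × (EuclideanSpace ℝ (Fin 3)), ‖p z.1 z.2 - c z.1‖ₑ ^ (3 / 2 : ℝ) ≤
      (2 : ℝ≥0∞) ^ (1 / 2 : ℝ) * ‖p z.1 z.2‖ₑ ^ (3 / 2 : ℝ) +
        (2 : ℝ≥0∞) ^ (1 / 2 : ℝ) * ‖c z.1‖ₑ ^ (3 / 2 : ℝ) := fun z => by
    rw [← mul_add]; exact enorm_sub_rpow_threeHalves_le _ _
  have h1 : ∫⁻ z in S, ‖p z.1 z.2‖ₑ ^ (3 / 2 : ℝ) < ⊤ :=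
    (lintegral_mono_set (Set.prod_mono Subset.rfl ball_subset_closedBall)).trans_lt
      (hv.pressure T hT _ (isCompact_closedBall _ _))
  have h2 : ∫⁻ z in S, ‖c z.1‖ₑ ^ (3 / 2 : ℝ) < ⊤ := by
    rw [hS, lintegral_prod_of_time_only (g := fun t => ‖c t‖ₑ ^ (3 / 2 : ℝ))
      (hcm.enorm.pow_const _) (Ioo 0 T) (ball (0 : (EuclideanSpace ℝ (Fin 3))) R)]
    refine ENNReal.mul_lt_top ?_ measure_ball_lt_top
    have hm := (hmem T hT).eLpNorm_lt_top
    rw [eLpNorm_lt_top_iff_lintegral_rpow_enorm_lt_top (by norm_num)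
      (ENNReal.div_ne_top (by norm_num) (by norm_num))] at hm
    have e : ((3 / 2 : ℝ≥0∞)).toReal = (3 / 2 : ℝ) := by
      rw [ENNReal.toReal_div]; norm_num
    rw [e] at hm
    exact hm
  have s2top : (2 : ℝ≥0∞) ^ (1 / 2 : ℝ) ≠ ⊤ := ENNReal.rpow_ne_top_of_nonneg (by norm_num) ENNReal.ofNat_ne_top
  calc ∫⁻ z in S, ‖p z.1 z.2 - c z.1‖ₑ ^ (3 / 2 : ℝ)
      ≤ ∫⁻ z in S, (2 : ℝ≥0∞) ^ (1 / 2 : ℝ) * ‖p z.1 z.2‖ₑ ^ (3 / 2 : ℝ) +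
          (2 : ℝ≥0∞) ^ (1 / 2 : ℝ) * ‖c z.1‖ₑ ^ (3 / 2 : ℝ) := lintegral_mono hpt
    _ = (2 : ℝ≥0∞) ^ (1 / 2 : ℝ) * (∫⁻ z in S, ‖p z.1 z.2‖ₑ ^ (3 / 2 : ℝ)) +
          (2 : ℝ≥0∞) ^ (1 / 2 : ℝ) * ∫⁻ z in S, ‖c z.1‖ₑ ^ (3 / 2 : ℝ) := by
        rw [lintegral_add_left' (hπS.const_mul _), lintegral_const_mul'' _ hπS,
          lintegral_const_mul' _ _ s2top]
    _ < ⊤ := ENNReal.add_lt_top.2 ⟨ENNReal.mul_lt_top (lt_top_iff_ne_top.2 s2top) h1,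
          ENNReal.mul_lt_top (lt_top_iff_ne_top.2 s2top) h2⟩


/-! ### Arithmetic of the thresholds -/

/-- `x/4 + x/4 = x/2` through the coercion `ℝ≥0 → ℝ≥0∞`. [folklore] -/
theorem coe_quarter_add_quarter (x : ℝ≥0) :
    ((x / 4 : ℝ≥0) : ℝ≥0∞) + ((x / 4 : ℝ≥0) : ℝ≥0∞) = ((x / 2 : ℝ≥0) : ℝ≥0∞) := by
  rw [← ENNReal.coe_add]
  congr 1
  apply NNReal.eq
  push_cast
  ring

/-- `x/4 + x/2 ≤ x` through the coercion `ℝ≥0 → ℝ≥0∞`. [folklore] -/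
theorem coe_quarter_add_half_le (x : ℝ≥0) :
    ((x / 4 : ℝ≥0) : ℝ≥0∞) + ((x / 2 : ℝ≥0) : ℝ≥0∞) ≤ (x : ℝ≥0∞) := by
  rw [← ENNReal.coe_add, ENNReal.coe_le_coe, ← NNReal.coe_le_coe]
  push_cast
  linarith [x.coe_nonneg]

/-- `x/2 ≤ x` through the coercion `ℝ≥0 → ℝ≥0∞`. [folklore] -/
theorem coe_half_le (x : ℝ≥0) : ((x / 2 : ℝ≥0) : ℝ≥0∞) ≤ (x : ℝ≥0∞) := by
  rw [ENNReal.coe_le_coe, ← NNReal.coe_le_coe]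
  push_cast
  linarith [x.coe_nonneg]

/-- `x/4 ≤ x` through the coercion `ℝ≥0 → ℝ≥0∞`. [folklore] -/
theorem coe_quarter_le (x : ℝ≥0) : ((x / 4 : ℝ≥0) : ℝ≥0∞) ≤ (x : ℝ≥0∞) := by
  rw [ENNReal.coe_le_coe, ← NNReal.coe_le_coe]
  push_cast
  linarith [x.coe_nonneg]

/-- From `2d ≤ x/4 + x/2` to `d ≤ x/2`. [folklore] -/
theorem le_coe_half_of_two_mul_le (x : ℝ≥0) {d : ℝ≥0∞}
    (h : 2 * d ≤ ((x / 4 : ℝ≥0) : ℝ≥0∞) + ((x / 2 : ℝ≥0) : ℝ≥0∞)) : d ≤ ((x / 2 : ℝ≥0) : ℝ≥0∞) := by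
  rw [← ENNReal.coe_add, mul_comm] at h
  have h2 := (ENNReal.le_div_iff_mul_le (Or.inl two_ne_zero) (Or.inl ENNReal.ofNat_ne_top)).2 h
  refine h2.trans ?_
  rw [show (2 : ℝ≥0∞) = ((2 : ℝ≥0) : ℝ≥0∞) from rfl, ← ENNReal.coe_div two_ne_zero, ENNReal.coe_le_coe,
    ← NNReal.coe_le_coe]
  push_cast
  linarith [x.coe_nonneg]

/-- The window bound in closed form: with `s = σ⁴`,
`K₁ s m + K₂ m^{3/2} s^{1/4} = K₁ σ⁴ m + K₂ (m √m) σ` (as an identity of extended reals with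
nonnegative real data). [folklore] -/
theorem window_bound_cast (K₁ K₂ m σ : ℝ≥0) :
    (K₁ : ℝ≥0∞) * ENNReal.ofReal ((σ : ℝ) ^ 4) * (m : ℝ≥0∞) +
        (K₂ : ℝ≥0∞) * (m : ℝ≥0∞) ^ (3 / 2 : ℝ) * (ENNReal.ofReal ((σ : ℝ) ^ 4)) ^ (1 / 4 : ℝ) =
      ((K₁ * σ ^ 4 * m + K₂ * (m * NNReal.sqrt m) * σ : ℝ≥0) : ℝ≥0∞) := by
  have e1 : ENNReal.ofReal ((σ : ℝ) ^ 4) = ((σ ^ 4 : ℝ≥0) : ℝ≥0∞) := by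
    rw [← NNReal.coe_pow, ENNReal.ofReal_coe_nnreal]
  have e2 : ((σ ^ 4 : ℝ≥0) : ℝ≥0∞) ^ (1 / 4 : ℝ) = (σ : ℝ≥0∞) := by
    rw [← ENNReal.coe_rpow_of_nonneg _ (by norm_num)]
    congr 1
    rw [show (1 / 4 : ℝ) = ((4 : ℕ) : ℝ)⁻¹ by norm_num]
    exact NNReal.pow_rpow_inv_natCast σ (by norm_num)
  have e3 : (m : ℝ≥0∞) ^ (3 / 2 : ℝ) = ((m * NNReal.sqrt m : ℝ≥0) : ℝ≥0∞) := by
    rw [← ENNReal.coe_rpow_of_nonneg _ (by norm_num)]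
    congr 1
    rw [NNReal.sqrt_eq_rpow, show (3 / 2 : ℝ) = 1 + 1 / 2 by norm_num,
      NNReal.rpow_add' (by norm_num), NNReal.rpow_one]
  rw [e1, e2, e3]
  push_cast
  ring

/-- Monotonicity step of the smallness conditions: for `σ ≤ min(1, σ₀)`,
`K₁ σ⁴ m + K₂ (m√m) σ ≤ (K₁ m + K₂ m√m) σ₀`. [folklore] -/
theorem window_bound_le_of_le (K₁ K₂ m σ σ₀ : ℝ≥0) (hσ1 : σ ≤ 1) (hσ : σ ≤ σ₀) :
    K₁ * σ ^ 4 * m + K₂ * (m * NNReal.sqrt m) * σ ≤ (K₁ * m + K₂ * (m * NNReal.sqrt m)) * σ₀ := by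
  have h4 : σ ^ 4 ≤ σ₀ := (pow_le_of_le_one (by simp) hσ1 (by norm_num)).trans hσ
  calc K₁ * σ ^ 4 * m + K₂ * (m * NNReal.sqrt m) * σ
      ≤ K₁ * σ₀ * m + K₂ * (m * NNReal.sqrt m) * σ₀ := by gcongr
    _ = (K₁ * m + K₂ * (m * NNReal.sqrt m)) * σ₀ := by ring

/-- **Smallness on the later windows**: for `θ > 0` and finite a priori bounds `m` there is
`δ₀ ∈ (0, 1]` with `K₁ δ m + K₂ m^{3/2} δ^{1/4} ≤ θ/4` for all `0 ≤ δ ≤ δ₀`. [folklore] -/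
theorem exists_window_small (K₁ K₂ m θ : ℝ≥0) (hθ : 0 < θ) :
    ∃ δ₀ : ℝ, 0 < δ₀ ∧ δ₀ ≤ 1 ∧ ∀ δ : ℝ, 0 ≤ δ → δ ≤ δ₀ →
      (K₁ : ℝ≥0∞) * ENNReal.ofReal δ * (m : ℝ≥0∞) +
          (K₂ : ℝ≥0∞) * (m : ℝ≥0∞) ^ (3 / 2 : ℝ) * (ENNReal.ofReal δ) ^ (1 / 4 : ℝ) ≤
        ((θ / 4 : ℝ≥0) : ℝ≥0∞) := by
  set L : ℝ≥0 := K₁ * m + K₂ * (m * NNReal.sqrt m) + 1 with hL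
  have hL0 : 0 < L := by rw [hL]; positivity
  set σ₀ : ℝ≥0 := θ / 4 / L with hσ₀
  have hσ₀pos : 0 < σ₀ := by rw [hσ₀]; positivity
  set δ₀ : ℝ := min 1 ((σ₀ : ℝ) ^ 4) with hδ₀
  have hδ₀pos : 0 < δ₀ := lt_min one_pos (by positivity)
  refine ⟨δ₀, hδ₀pos, min_le_left _ _, fun δ hδ0 hδ => ?_⟩
  -- `δ = σ⁴`
  set σ : ℝ≥0 := ⟨δ ^ (1 / 4 : ℝ), Real.rpow_nonneg hδ0 _⟩ with hσ
  have hσδ : (σ : ℝ) ^ 4 = δ := by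
    show (δ ^ (1 / 4 : ℝ)) ^ 4 = δ
    rw [← Real.rpow_natCast, ← Real.rpow_mul hδ0]; norm_num
  have hσ1 : σ ≤ 1 := by
    rw [← NNReal.coe_le_coe]
    show δ ^ (1 / 4 : ℝ) ≤ 1
    exact Real.rpow_le_one hδ0 (hδ.trans (min_le_left _ _)) (by norm_num)
  have hσσ₀ : σ ≤ σ₀ := by
    rw [← NNReal.coe_le_coe]
    show δ ^ (1 / 4 : ℝ) ≤ (σ₀ : ℝ)
    have h1 : δ ≤ (σ₀ : ℝ) ^ 4 := hδ.trans (min_le_right _ _)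
    calc δ ^ (1 / 4 : ℝ) ≤ ((σ₀ : ℝ) ^ 4) ^ (1 / 4 : ℝ) := Real.rpow_le_rpow hδ0 h1 (by norm_num)
      _ = (σ₀ : ℝ) := by
          rw [← Real.rpow_natCast, ← Real.rpow_mul σ₀.coe_nonneg]; norm_num
  rw [← hσδ, window_bound_cast, ENNReal.coe_le_coe]
  refine (window_bound_le_of_le K₁ K₂ m σ σ₀ hσ1 hσσ₀).trans ?_
  rw [hσ₀, mul_div_assoc']
  rw [div_le_iff₀ hL0]
  calc (K₁ * m + K₂ * (m * NNReal.sqrt m)) * (θ / 4) ≤ L * (θ / 4) := by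
        gcongr; rw [hL]; exact le_self_add
    _ = θ / 4 * L := mul_comm _ _

/-- **Smallness on the initial windows**: `K₁ σ⁴ θ + K₂ (θ√θ) σ ≤ θ/4` once `8K₁σ⁴ ≤ 1` and
`8K₂σ√θ ≤ 1`. [folklore] -/
theorem window_bound_le_quarter (K₁ K₂ θ σ : ℝ≥0) (h1 : 8 * (K₁ * σ ^ 4) ≤ 1)
    (h2 : 8 * (K₂ * σ * NNReal.sqrt θ) ≤ 1) :
    K₁ * σ ^ 4 * θ + K₂ * (θ * NNReal.sqrt θ) * σ ≤ θ / 4 := by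
  rw [← NNReal.coe_le_coe] at h1 h2 ⊢
  push_cast at h1 h2 ⊢
  have hθ := θ.coe_nonneg
  have hσ := σ.coe_nonneg
  have hK₁ := K₁.coe_nonneg
  have e1 : (K₁ : ℝ) * (σ : ℝ) ^ 4 * θ ≤ θ / 8 := by
    have h3 := mul_le_mul_of_nonneg_right h1 hθ
    nlinarith [h3]
  have e2 : (K₂ : ℝ) * (θ * Real.sqrt θ) * σ ≤ θ / 8 := by
    have h3 := mul_le_mul_of_nonneg_right h2 hθ
    have : (K₂ : ℝ) * (θ * Real.sqrt θ) * σ = (K₂ * σ * Real.sqrt θ) * θ := by ring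
    rw [this]; nlinarith [h3]
  linarith

/-- The hypotheses of `window_bound_le_quarter` from the smallness of the time: if
`θ ≤ 8nα + 1`, `s = σ⁴ ≤ T`, `8K₁T ≤ 1` and `8⁴K₂⁴(128n² + 2) ε ≥ …`, precisely
`T ≤ ε`, `Tα² ≤ ε`, `8 K₁ ε ≤ 1`, `8⁴ K₂⁴ (128 n² + 2) ε ≤ 1`, then `8K₁σ⁴ ≤ 1` and
`8K₂σ√θ ≤ 1`. [folklore] -/
theorem small_hyps (K₁ K₂ n α η ε σ : ℝ≥0) {T s : ℝ} (hη : η ≤ 1) (hs0 : 0 ≤ s) (hsT : s ≤ T)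
    (hσ : (σ : ℝ) ^ 4 = s) (hT : T ≤ ε) (hTα : T * (α : ℝ) ^ 2 ≤ ε) (hε1 : 8 * K₁ * ε ≤ 1)
    (hε2 : 8 ^ 4 * K₂ ^ 4 * (128 * n ^ 2 + 2) * ε ≤ 1) :
    8 * (K₁ * σ ^ 4) ≤ 1 ∧ 8 * (K₂ * σ * NNReal.sqrt (8 * n * α + η)) ≤ 1 := by
  constructor
  · rw [← NNReal.coe_le_coe] at hε1 ⊢
    push_cast at hε1 ⊢
    rw [hσ]
    have := K₁.coe_nonneg
    nlinarith
  · -- fourth powers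
    have key : (8 * (K₂ * σ * NNReal.sqrt (8 * n * α + η))) ^ 4 ≤ 1 := by
      have e : (8 * (K₂ * σ * NNReal.sqrt (8 * n * α + η))) ^ 4 =
          8 ^ 4 * K₂ ^ 4 * σ ^ 4 * (8 * n * α + η) ^ 2 := by
        have hsq : NNReal.sqrt (8 * n * α + η) ^ 4 = (8 * n * α + η) ^ 2 := by
          rw [show (4 : ℕ) = 2 * 2 by norm_num, pow_mul, NNReal.sq_sqrt]
        calc (8 * (K₂ * σ * NNReal.sqrt (8 * n * α + η))) ^ 4
            = 8 ^ 4 * K₂ ^ 4 * σ ^ 4 * NNReal.sqrt (8 * n * α + η) ^ 4 := by ring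
          _ = _ := by rw [hsq]
      rw [e, ← NNReal.coe_le_coe]
      rw [← NNReal.coe_le_coe] at hε2
      push_cast at hε2 ⊢
      rw [hσ]
      have hK := K₂.coe_nonneg
      have hn := n.coe_nonneg
      have hα := α.coe_nonneg
      have hηc := η.coe_nonneg
      have hη1 : (η : ℝ) ≤ 1 := by exact_mod_cast hη
      have hs1 : 0 ≤ s := hs0
      -- `(8nα + η)² ≤ 128 n² α² + 2 η² ≤ 128 n² α² + 2`
      have hθ2 : ((8 : ℝ) * n * α + η) ^ 2 ≤ 128 * (n : ℝ) ^ 2 * (α : ℝ) ^ 2 + 2 := by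
        nlinarith [sq_nonneg ((8 : ℝ) * n * α - η)]
      have h3 : s * ((8 : ℝ) * n * α + η) ^ 2 ≤ (128 * (n : ℝ) ^ 2 + 2) * (ε : ℝ) := by
        calc s * ((8 : ℝ) * n * α + η) ^ 2 ≤ s * (128 * (n : ℝ) ^ 2 * (α : ℝ) ^ 2 + 2) := by
              exact mul_le_mul_of_nonneg_left hθ2 hs1
          _ = 128 * (n : ℝ) ^ 2 * (s * (α : ℝ) ^ 2) + 2 * s := by ring
          _ ≤ 128 * (n : ℝ) ^ 2 * (ε : ℝ) + 2 * (ε : ℝ) := by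
              have h4 : s * (α : ℝ) ^ 2 ≤ ε := by nlinarith
              have h5 : s ≤ ε := hsT.trans hT
              nlinarith
          _ = (128 * (n : ℝ) ^ 2 + 2) * (ε : ℝ) := by ring
      calc (8 : ℝ) ^ 4 * (K₂ : ℝ) ^ 4 * s * (8 * (n : ℝ) * (α : ℝ) + (η : ℝ)) ^ 2
          = 8 ^ 4 * (K₂ : ℝ) ^ 4 * (s * (8 * (n : ℝ) * α + η) ^ 2) := by ring
        _ ≤ 8 ^ 4 * (K₂ : ℝ) ^ 4 * ((128 * (n : ℝ) ^ 2 + 2) * (ε : ℝ)) := by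
            exact mul_le_mul_of_nonneg_left h3 (by positivity)
        _ = 8 ^ 4 * (K₂ : ℝ) ^ 4 * (128 * (n : ℝ) ^ 2 + 2) * (ε : ℝ) := by ring
        _ ≤ 1 := hε2
    exact (pow_le_one_iff_of_nonneg (by simp) (by norm_num)).1 key


/-! ### From the test functions to unit balls -/

/-- The unit-ball energy at a centre `z` is dominated by the `φ_y`-weighted energy for any `y`
at distance `< 1` from `z` (`φ_y = 1` on `B̄_2(y) ⊇ B_1(z)`). [folklore] -/
theorem lintegral_ball_le_lintegral_mul_cutoff {f : (EuclideanSpace ℝ (Fin 3)) → ℝ≥0∞} {z y : (EuclideanSpace ℝ (Fin 3))} (h : dist z y < 1) :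
    ∫⁻ x in ball z 1, f x ≤ ∫⁻ x, f x * ENNReal.ofReal (radialCutoff 2 3 (y - x)) := by
  calc ∫⁻ x in ball z 1, f x = ∫⁻ x in ball z 1, f x * ENNReal.ofReal (radialCutoff 2 3 (y - x)) := by
        refine setLIntegral_congr_fun measurableSet_ball fun x hx => ?_
        rw [testFn_eq_one (ball_subset_closedBall_two h hx), ENNReal.ofReal_one, mul_one]
    _ ≤ ∫⁻ x, f x * ENNReal.ofReal (radialCutoff 2 3 (y - x)) := setLIntegral_le_lintegral _ _

/-- The unit-ball dissipation on a time window at a centre `z` is dominated by the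
`φ_y`-weighted dissipation over `B(0, ‖y‖ + 4)` for any `y` at distance `< 1` from `z`. [folklore] -/
theorem lintegral_box_ball_le_box_mul_cutoff {g : ℝ × (EuclideanSpace ℝ (Fin 3)) → ℝ≥0∞} {z y : (EuclideanSpace ℝ (Fin 3))} (h : dist z y < 1)
    (a b : ℝ) :
    ∫⁻ w in Ioo a b ×ˢ ball z 1, g w ≤
      ∫⁻ w in Ioo a b ×ˢ ball (0 : (EuclideanSpace ℝ (Fin 3))) (‖y‖ + 4), g w * ENNReal.ofReal (radialCutoff 2 3 (y - w.2)) := by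
  calc ∫⁻ w in Ioo a b ×ˢ ball z 1, g w
      = ∫⁻ w in Ioo a b ×ˢ ball z 1, g w * ENNReal.ofReal (radialCutoff 2 3 (y - w.2)) := by
        refine setLIntegral_congr_fun (measurableSet_Ioo.prod measurableSet_ball) fun w hw => ?_
        rw [testFn_eq_one (ball_subset_closedBall_two h hw.2), ENNReal.ofReal_one, mul_one]
    _ ≤ ∫⁻ w in Ioo a b ×ˢ ball (0 : (EuclideanSpace ℝ (Fin 3))) (‖y‖ + 4), g w * ENNReal.ofReal (radialCutoff 2 3 (y - w.2)) :=
        lintegral_mono_set (Set.prod_mono Subset.rfl (ball_subset_ball_norm_add_four h))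

/-! ### The core: the discrete continuation argument at a fixed threshold -/

/-- **The core of the a priori estimate (unit scale, fixed threshold).** Let `(u, p)` be a local
Leray solution with `E²` datum `u₀` and weak gradient `G`; let `K₁, K₂` bound the flux of the
local energy inequality on every time window as in `exists_window_flux_le`; let `c_y` be
measurable gauges for the pressure at every centre (`exists_measurable_gauge`). Let
`0 < T ≤ 1/2` and `θ > 0` be such that (i) `K₁ s θ + K₂ θ^{3/2} s^{1/4} ≤ θ/4` for all
`s ∈ [0, T]` (the smallness of the time, from `T ≤ ε₀ min{α⁻², 1}`) and (ii)
`∫ |u₀|² φ_y ≤ θ/4` for all `y` (the size of the datum). Then the unit-ball energies of `u(t)`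
are `≤ θ` for a.e. `t ∈ (0, T)` and the unit-ball dissipations on `(0, T)` are `≤ θ/2`.
This is Jia–Šverák's "continuation in `λ`" (proof of Lemma 2: "From the above estimate for
`A(λ)`, the lemma follows easily by the usual continuation in `λ` argument") made discrete: on a
grid `s_k = kT/n` fine enough that the flux over one step, bounded through the (finite, class)
uniformly local bounds of the solution, is `≤ θ/4`, the bound `e_y + 2d_y ≤ θ/4 + θ/2` propagates
from `(0, s_k)` to `(0, s_{k+1})` by the local energy inequality from the initial time
(`IsLocalLeraySolution.ae_lintegral_sq_mul_add_grad_le_datum_add`) tested with `φ_y` at the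
integer lattice of centres `y`. [cite: JiaSverak2013, proof of Lemma 2 (arXiv:1201.1592 pp. 3–4)] -/
theorem core_bounds
    {u₀ : (EuclideanSpace ℝ (Fin 3)) → (EuclideanSpace ℝ (Fin 3))} {u : ℝ → (EuclideanSpace ℝ (Fin 3)) → (EuclideanSpace ℝ (Fin 3))} {p : ℝ → (EuclideanSpace ℝ (Fin 3)) → ℝ} {G : ℝ → (EuclideanSpace ℝ (Fin 3)) → (EuclideanSpace ℝ (Fin 3)) →L[ℝ] (EuclideanSpace ℝ (Fin 3))}
    (hv : IsLocalLeraySolution 1 u₀ u p) (hE2 : MemE2 u₀)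
    (hG : HasWeakSpatialGradientOn (slab (EuclideanSpace ℝ (Fin 3)) (Ioi 0) isOpen_Ioi) u G)
    {K₁ K₂ : ℝ≥0}
    (hflux : ∀ {S t₁ t₂ : ℝ} (_h0 : 0 ≤ t₁) (_h12 : t₁ ≤ t₂) (_h2S : t₂ ≤ S) (_hδ1 : t₂ - t₁ ≤ 1)
      (y : (EuclideanSpace ℝ (Fin 3))) {c : ℝ → ℝ} (_hcm : AEStronglyMeasurable c (volume.restrict (Ioo 0 S)))
      (_hdec : ∀ᵐ z ∂(volume.restrict (Ioo 0 S ×ˢ ball y 3)),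
        p z.1 z.2 - c z.1 = localPressureNear y 3 u z.1 z.2 + localPressureFar y 3 u z.1 z.2)
      {E D M : ℝ≥0∞} (_hMtop : M ≠ ⊤) (_hEM : E ≤ M) (_hDM : D ≤ M)
      (_hE : ∀ᵐ t ∂(volume.restrict (Ioo t₁ t₂)), ∀ z : (EuclideanSpace ℝ (Fin 3)), ∫⁻ x in ball z 1, ‖u t x‖ₑ ^ 2 ≤ E)
      (_hD : ∀ z : (EuclideanSpace ℝ (Fin 3)),
        ∫⁻ w in Ioo t₁ t₂ ×ˢ ball z 1, ENNReal.ofReal (frobeniusNormSq (G w.1 w.2)) ≤ D),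
      ∫⁻ z in Ioo t₁ t₂ ×ˢ ball y 3,
          ‖‖u z.1 z.2‖ ^ 2 * Δ (fun w => radialCutoff 2 3 (y - w)) z.2 +
            (‖u z.1 z.2‖ ^ 2 + 2 * (p z.1 z.2 - c z.1)) *
              ⟪u z.1 z.2, gradient (fun w => radialCutoff 2 3 (y - w)) z.2⟫‖ₑ ≤
        K₁ * ENNReal.ofReal (t₂ - t₁) * M + K₂ * M ^ (3 / 2 : ℝ) * ENNReal.ofReal (t₂ - t₁) ^ (1 / 4 : ℝ))
    (cg : (EuclideanSpace ℝ (Fin 3)) → ℝ → ℝ) (hcgm : ∀ y, Measurable (cg y))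
    (hcgdec : ∀ y, ∀ T : ℝ, 0 < T → ∀ᵐ z ∂(volume.restrict (Ioo 0 T ×ˢ ball y 3)),
        p z.1 z.2 - cg y z.1 = localPressureNear y 3 u z.1 z.2 + localPressureFar y 3 u z.1 z.2)
    (hcgfin : ∀ y, ∀ T R : ℝ, 0 < T → 0 < R →
        ∫⁻ z in Ioo 0 T ×ˢ ball (0 : (EuclideanSpace ℝ (Fin 3))) R, ‖p z.1 z.2 - cg y z.1‖ₑ ^ (3 / 2 : ℝ) < ⊤)
    {T : ℝ} (hT : 0 < T) (hT1 : T ≤ 1 / 2) {θ : ℝ≥0} (hθ : 0 < θ)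
    (hA : ∀ s : ℝ, 0 ≤ s → s ≤ T →
      (K₁ : ℝ≥0∞) * ENNReal.ofReal s * (θ : ℝ≥0∞) +
          (K₂ : ℝ≥0∞) * (θ : ℝ≥0∞) ^ (3 / 2 : ℝ) * (ENNReal.ofReal s) ^ (1 / 4 : ℝ) ≤
        ((θ / 4 : ℝ≥0) : ℝ≥0∞))
    (ha : ∀ y : (EuclideanSpace ℝ (Fin 3)), ∫⁻ x, ‖u₀ x‖ₑ ^ 2 * ENNReal.ofReal (radialCutoff 2 3 (y - x)) ≤
      ((θ / 4 : ℝ≥0) : ℝ≥0∞)) :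
    (∀ᵐ t ∂(volume.restrict (Ioo 0 T)), ∀ z : (EuclideanSpace ℝ (Fin 3)), ∫⁻ x in ball z 1, ‖u t x‖ₑ ^ 2 ≤ (θ : ℝ≥0∞)) ∧
    ∀ z : (EuclideanSpace ℝ (Fin 3)), ∫⁻ w in Ioo 0 T ×ˢ ball z 1, ENNReal.ofReal (frobeniusNormSq (G w.1 w.2)) ≤
      ((θ / 2 : ℝ≥0) : ℝ≥0∞) := by
  -- ## names
  set L : (Fin 3 → ℤ) → (EuclideanSpace ℝ (Fin 3)) := fun k => (WithLp.equiv 2 (Fin 3 → ℝ)).symm fun i => (k i : ℝ) with hL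
  set e : (EuclideanSpace ℝ (Fin 3)) → ℝ → ℝ≥0∞ := fun y t => ∫⁻ x, ‖u t x‖ₑ ^ 2 * ENNReal.ofReal (radialCutoff 2 3 (y - x))
    with he
  set d : (EuclideanSpace ℝ (Fin 3)) → ℝ → ℝ≥0∞ := fun y s => ∫⁻ z in Ioo 0 s ×ˢ ball (0 : (EuclideanSpace ℝ (Fin 3))) (‖y‖ + 4),
    ENNReal.ofReal (frobeniusNormSq (G z.1 z.2)) * ENNReal.ofReal (radialCutoff 2 3 (y - z.2)) with hd
  set F : (EuclideanSpace ℝ (Fin 3)) → ℝ × (EuclideanSpace ℝ (Fin 3)) → ℝ≥0∞ := fun y z =>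
    ‖‖u z.1 z.2‖ ^ 2 * Δ (fun w => radialCutoff 2 3 (y - w)) z.2 +
      (‖u z.1 z.2‖ ^ 2 + 2 * (p z.1 z.2 - cg y z.1)) *
        ⟪u z.1 z.2, gradient (fun w => radialCutoff 2 3 (y - w)) z.2⟫‖ₑ with hF
  set R : (EuclideanSpace ℝ (Fin 3)) → ℝ → ℝ → ℝ≥0∞ := fun y a b => ∫⁻ z in Ioo a b ×ˢ ball y 3, F y z with hR
  set θ' : ℝ≥0∞ := (θ : ℝ≥0∞) with hθ'
  set θ4 : ℝ≥0∞ := ((θ / 4 : ℝ≥0) : ℝ≥0∞) with hθ4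
  set θ2 : ℝ≥0∞ := ((θ / 2 : ℝ≥0) : ℝ≥0∞) with hθ2
  have hT1' : T ≤ 1 := hT1.trans (by norm_num)
  have hcgAEm : ∀ y, AEStronglyMeasurable (cg y) (volume.restrict (Ioo 0 2)) := fun y =>
    (hcgm y).aestronglyMeasurable
  -- ## the a priori (class) bounds of the solution on `(0, 1)`
  obtain ⟨A₁, hA₁⟩ := hv.uniformLocalEnergy 1 one_pos
  rw [one_pow] at hA₁
  obtain ⟨G', hG', hG'b⟩ := hv.uniformLocalGradient
  obtain ⟨A₂, hA₂⟩ := hG'b 1 one_pos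
  simp only [one_pow] at hA₂
  have hGG' : ∀ᵐ z ∂(volume.restrict (Ioi (0 : ℝ) ×ˢ (univ : Set (EuclideanSpace ℝ (Fin 3))))), uncurry G z = uncurry G' z :=
    hG.ae_eq hG'
  have hA₂G : ∀ x₀ : (EuclideanSpace ℝ (Fin 3)), ∫⁻ z in Ioo 0 1 ×ˢ ball x₀ 1, ENNReal.ofReal (frobeniusNormSq (G z.1 z.2)) ≤ A₂ := by
    intro x₀
    have hsub : Ioo (0 : ℝ) 1 ×ˢ ball x₀ 1 ⊆ Ioi 0 ×ˢ univ := Set.prod_mono Ioo_subset_Ioi_self (subset_univ _)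
    have h1 := ae_restrict_of_ae_restrict_of_subset hsub hGG'
    calc ∫⁻ z in Ioo 0 1 ×ˢ ball x₀ 1, ENNReal.ofReal (frobeniusNormSq (G z.1 z.2))
        = ∫⁻ z in Ioo 0 1 ×ˢ ball x₀ 1, ENNReal.ofReal (frobeniusNormSq (G' z.1 z.2)) := by
          refine lintegral_congr_ae ?_
          filter_upwards [h1] with z hz
          have hz' : G z.1 z.2 = G' z.1 z.2 := hz
          rw [hz']
      _ ≤ A₂ := hA₂ x₀
  set Mb : ℝ≥0 := max A₁ A₂ with hMb
  -- ## smallness on short windows and the grid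
  obtain ⟨δ₀, hδ₀, hδ₀1, hB⟩ := exists_window_small K₁ K₂ Mb θ hθ
  set n : ℕ := ⌈T / δ₀⌉₊ with hn
  have hnpos : 0 < n := Nat.ceil_pos.2 (div_pos hT hδ₀)
  have hnR : (0 : ℝ) < n := by exact_mod_cast hnpos
  set δ : ℝ := T / n with hδ
  have hδpos : 0 < δ := div_pos hT hnR
  have hδδ₀ : δ ≤ δ₀ := by
    rw [hδ, div_le_iff₀ hnR]
    have h1 : T / δ₀ ≤ n := Nat.le_ceil _
    rw [div_le_iff₀ hδ₀] at h1
    linarith [mul_comm δ₀ (n : ℝ)]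
  have hδ1 : δ ≤ 1 := hδδ₀.trans hδ₀1
  have hnδ : (n : ℝ) * δ = T := by rw [hδ]; field_simp
  -- ## the local energy inequality from `t = 0`, tested with `φ_y`, gauge `c_y`
  have hEI : ∀ y : (EuclideanSpace ℝ (Fin 3)), ∀ᵐ s' ∂(volume.restrict (Ioo 0 1)),
      e y s' + 2 * d y s' ≤ (∫⁻ x, ‖u₀ x‖ₑ ^ 2 * ENNReal.ofReal (radialCutoff 2 3 (y - x))) +
        ∫⁻ z in Ioo 0 s' ×ˢ ball (0 : (EuclideanSpace ℝ (Fin 3))) (‖y‖ + 4), F y z := by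
    intro y
    have hvy : IsLocalLeraySolution 1 u₀ u (fun t x => p t x - cg y t) :=
      hv.sub_pressure (hcgm y) (hcgfin y)
    have hu3 : IntegrableOn (fun z : ℝ × (EuclideanSpace ℝ (Fin 3)) => ‖u z.1 z.2‖ ^ 3) (Ioo 0 2 ×ˢ ball (0 : (EuclideanSpace ℝ (Fin 3))) (‖y‖ + 4))
        volume :=
      (hv.integrableOn_cube_block_zero two_pos (isCompact_closedBall 0 (‖y‖ + 4))).mono_set
        (Set.prod_mono Subset.rfl ball_subset_closedBall)
    have h := hvy.ae_lintegral_sq_mul_add_grad_le_datum_add hE2.aestronglyMeasurable hG two_pos hu3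
      (contDiff_testFn y) (tsupport_testFn_subset_ball y) (testFn_nonneg y)
    rw [show (2 : ℝ) / 2 = 1 by norm_num] at h
    exact h
  -- the flux integrand vanishes off `B̄_3(y)`: restriction of the flux to `(0,s') × B_3(y)`
  have hFR : ∀ (y : (EuclideanSpace ℝ (Fin 3))) (s' : ℝ), ∫⁻ z in Ioo 0 s' ×ˢ ball (0 : (EuclideanSpace ℝ (Fin 3))) (‖y‖ + 4), F y z ≤ R y 0 s' := by
    intro y s'
    have h1 : ∫⁻ z in Ioo 0 s' ×ˢ ball (0 : (EuclideanSpace ℝ (Fin 3))) (‖y‖ + 4), F y z ≤ ∫⁻ z in Ioo 0 s' ×ˢ closedBall y 3, F y z := by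
      refine setLIntegral_prod_le_of_eq_zero_off measurableSet_closedBall fun z hz => ?_
      simp only [hF]
      rw [laplacian_testFn_eq_zero hz, gradient_testFn_eq_zero hz, inner_zero_right, mul_zero,
        mul_zero, add_zero, enorm_zero]
    exact h1.trans (setLIntegral_prod_closedBall_eq _ _ _ _).le
  -- ## the induction over the grid
  have hgrid : ∀ k : ℕ, k ≤ n →
      (∀ᵐ t ∂(volume.restrict (Ioo 0 ((k : ℝ) * δ))), ∀ κ : Fin 3 → ℤ, e (L κ) t ≤ θ') ∧
      (∀ κ : Fin 3 → ℤ, d (L κ) ((k : ℝ) * δ) ≤ θ2) := by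
    intro k
    induction k with
    | zero =>
      intro _
      refine ⟨?_, fun κ => ?_⟩
      · simp only [Nat.cast_zero, zero_mul, Ioo_self, Measure.restrict_empty, ae_zero, eventually_bot]
      · simp only [hd, Nat.cast_zero, zero_mul, Ioo_self, Set.empty_prod, Measure.restrict_empty,
          lintegral_zero_measure, zero_le]
    | succ k ih =>
      intro hk
      have ihk := ih (Nat.le_of_succ_le hk)
      set sk : ℝ := (k : ℝ) * δ with hsk_def
      set sk1 : ℝ := ((k + 1 : ℕ) : ℝ) * δ with hsk1_def
      have hsk0 : 0 ≤ sk := by rw [hsk_def]; positivity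
      have hwin : sk1 - sk = δ := by rw [hsk1_def, hsk_def]; push_cast; ring
      have hsk : sk ≤ sk1 := by linarith
      have hsk1T : sk1 ≤ T := by
        rw [hsk1_def, ← hnδ]
        have : ((k + 1 : ℕ) : ℝ) ≤ n := by exact_mod_cast hk
        exact mul_le_mul_of_nonneg_right this hδpos.le
      have hskT : sk ≤ T := hsk.trans hsk1T
      have hsk1pos : 0 < sk1 := by rw [hsk1_def]; positivity
      -- unit-ball bounds on `(0, sk)` from the induction hypothesis
      have HE : ∀ᵐ t ∂(volume.restrict (Ioo 0 sk)), ∀ z : (EuclideanSpace ℝ (Fin 3)), ∫⁻ x in ball z 1, ‖u t x‖ₑ ^ 2 ≤ θ' := by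
        filter_upwards [ihk.1] with t ht z
        obtain ⟨κ, hκ⟩ := exists_lattice_dist_lt z
        exact (lintegral_ball_le_lintegral_mul_cutoff hκ).trans (ht κ)
      have HD : ∀ z : (EuclideanSpace ℝ (Fin 3)), ∫⁻ w in Ioo 0 sk ×ˢ ball z 1, ENNReal.ofReal (frobeniusNormSq (G w.1 w.2)) ≤ θ' := by
        intro z
        obtain ⟨κ, hκ⟩ := exists_lattice_dist_lt z
        exact (lintegral_box_ball_le_box_mul_cutoff hκ 0 sk).trans ((ihk.2 κ).trans (coe_half_le θ))
      -- the flux over `(0, sk)`: the smallness of the time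
      have hR1 : ∀ y : (EuclideanSpace ℝ (Fin 3)), R y 0 sk ≤ θ4 := by
        intro y
        have h := hflux (S := 2) le_rfl hsk0 (by linarith) (by linarith) y (hcgAEm y) (hcgdec y 2 two_pos)
          (E := θ') (D := θ') (M := θ') ENNReal.coe_ne_top le_rfl le_rfl HE HD
        rw [sub_zero] at h
        exact h.trans (hA sk hsk0 hskT)
      -- the flux over `(sk, sk1)`: the smallness of the step
      have hR2 : ∀ y : (EuclideanSpace ℝ (Fin 3)), R y sk sk1 ≤ θ4 := by
        intro y
        have hE' : ∀ᵐ t ∂(volume.restrict (Ioo sk sk1)), ∀ z : (EuclideanSpace ℝ (Fin 3)),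
            ∫⁻ x in ball z 1, ‖u t x‖ₑ ^ 2 ≤ (A₁ : ℝ≥0∞) :=
          ae_restrict_of_ae_restrict_of_subset (Ioo_subset_Ioo hsk0 (hsk1T.trans hT1')) hA₁
        have hD' : ∀ z : (EuclideanSpace ℝ (Fin 3)), ∫⁻ w in Ioo sk sk1 ×ˢ ball z 1,
            ENNReal.ofReal (frobeniusNormSq (G w.1 w.2)) ≤ (A₂ : ℝ≥0∞) := fun z =>
          (lintegral_mono_set (Set.prod_mono (Ioo_subset_Ioo hsk0 (hsk1T.trans hT1')) Subset.rfl)).trans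
            (hA₂G z)
        have h := hflux (S := 2) hsk0 hsk (by linarith) (by rw [hwin]; exact hδ1) y (hcgAEm y)
          (hcgdec y 2 two_pos) (E := (A₁ : ℝ≥0∞)) (D := (A₂ : ℝ≥0∞)) (M := (Mb : ℝ≥0∞))
          ENNReal.coe_ne_top (ENNReal.coe_le_coe.2 (le_max_left _ _))
          (ENNReal.coe_le_coe.2 (le_max_right _ _)) hE' hD'
        rw [hwin] at h
        exact h.trans (hB δ hδpos.le hδδ₀)
      have hRsum : ∀ y : (EuclideanSpace ℝ (Fin 3)), R y 0 sk1 ≤ θ2 := fun y =>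
        (setLIntegral_prod_Ioo_le_add (b := sk) _ _).trans (by
          rw [hθ2, ← coe_quarter_add_quarter]
          exact add_le_add (hR1 y) (hR2 y))
      -- the local energy inequality on `(0, sk1)`
      have hmain : ∀ y : (EuclideanSpace ℝ (Fin 3)), ∀ᵐ s' ∂(volume.restrict (Ioo 0 sk1)), e y s' + 2 * d y s' ≤ θ4 + θ2 := by
        intro y
        have h1 := ae_restrict_of_ae_restrict_of_subset (Ioo_subset_Ioo le_rfl (hsk1T.trans hT1')) (hEI y)
        have h2 : ∀ᵐ s' ∂(volume.restrict (Ioo 0 sk1)), s' ∈ Ioo 0 sk1 := ae_restrict_mem measurableSet_Ioo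
        filter_upwards [h1, h2] with s' hs' hs'mem
        calc e y s' + 2 * d y s'
            ≤ (∫⁻ x, ‖u₀ x‖ₑ ^ 2 * ENNReal.ofReal (radialCutoff 2 3 (y - x))) +
                ∫⁻ z in Ioo 0 s' ×ˢ ball (0 : (EuclideanSpace ℝ (Fin 3))) (‖y‖ + 4), F y z := hs'
          _ ≤ θ4 + R y 0 sk1 := add_le_add (ha y) ((hFR y s').trans
              (lintegral_mono_set (Set.prod_mono (Ioo_subset_Ioo le_rfl hs'mem.2.le) Subset.rfl)))
          _ ≤ θ4 + θ2 := add_le_add le_rfl (hRsum y)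
      refine ⟨?_, fun κ => ?_⟩
      · rw [hsk1_def] at hmain
        refine ae_all_iff.2 fun κ => ?_
        filter_upwards [hmain (L κ)] with t ht
        exact (le_self_add.trans ht).trans (coe_quarter_add_half_le θ)
      · refine setLIntegral_prod_le_of_ae hsk1pos ?_
        filter_upwards [hmain (L κ)] with s' hs'
        exact le_coe_half_of_two_mul_le θ (le_add_self.trans hs')
  -- ## conclusion at `s_n = T`
  obtain ⟨h1, h2⟩ := hgrid n le_rfl
  rw [hnδ] at h1 h2
  refine ⟨?_, fun z => ?_⟩
  · filter_upwards [h1] with t ht z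
    obtain ⟨κ, hκ⟩ := exists_lattice_dist_lt z
    exact (lintegral_ball_le_lintegral_mul_cutoff hκ).trans (ht κ)
  · obtain ⟨κ, hκ⟩ := exists_lattice_dist_lt z
    exact (lintegral_box_ball_le_box_mul_cutoff hκ 0 T).trans (h2 κ)

/-! ### The a priori estimate at unit scale -/

/-- `x^{3/2} = x √x` through the coercion `ℝ≥0 → ℝ≥0∞`. [folklore] -/
theorem coe_rpow_threeHalves (x : ℝ≥0) :
    (x : ℝ≥0∞) ^ (3 / 2 : ℝ) = ((x * NNReal.sqrt x : ℝ≥0) : ℝ≥0∞) := by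
  rw [← ENNReal.coe_rpow_of_nonneg _ (by norm_num)]
  congr 1
  rw [NNReal.sqrt_eq_rpow, show (3 / 2 : ℝ) = 1 + 1 / 2 by norm_num,
    NNReal.rpow_add' (by norm_num), NNReal.rpow_one]

/-- `(8nα)^{3/2} ≤ 24 n^{3/2} α^{3/2}` (`√8 ≤ 3`). [folklore] -/
theorem eight_mul_threeHalves_le (n α : ℝ≥0) :
    8 * n * α * NNReal.sqrt (8 * n * α) ≤ 24 * (n * NNReal.sqrt n) * (α * NNReal.sqrt α) := by
  have h8 : NNReal.sqrt 8 ≤ 3 := by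
    rw [show (3 : ℝ≥0) = NNReal.sqrt 9 by
      rw [show (9 : ℝ≥0) = 3 ^ 2 by norm_num, NNReal.sqrt_sq]]
    exact NNReal.sqrt_le_sqrt.2 (by norm_num)
  rw [NNReal.sqrt_mul, NNReal.sqrt_mul]
  calc 8 * n * α * (NNReal.sqrt 8 * NNReal.sqrt n * NNReal.sqrt α)
      ≤ 8 * n * α * (3 * NNReal.sqrt n * NNReal.sqrt α) := by gcongr
    _ = 24 * (n * NNReal.sqrt n) * (α * NNReal.sqrt α) := by ring

/-- The `φ_y`-weighted integral is at most the integral over `B_4(y)` (`0 ≤ φ_y ≤ 1`, `φ_y = 0`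
off `B̄_3(y)`). [folklore] -/
theorem lintegral_mul_cutoff_le_setLIntegral_ball (f : (EuclideanSpace ℝ (Fin 3)) → ℝ≥0∞) (y : (EuclideanSpace ℝ (Fin 3))) :
    ∫⁻ x, f x * ENNReal.ofReal (radialCutoff 2 3 (y - x)) ≤ ∫⁻ x in ball y 4, f x := by
  rw [← lintegral_indicator measurableSet_ball]
  refine lintegral_mono fun x => ?_
  by_cases hx : x ∈ ball y 4
  · rw [indicator_of_mem hx]
    calc f x * ENNReal.ofReal (radialCutoff 2 3 (y - x)) ≤ f x * 1 := by
          gcongr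
          exact ENNReal.ofReal_le_one.2 (testFn_le_one y x)
      _ = f x := mul_one _
  · have hx' : x ∉ closedBall y 3 := fun h => hx (closedBall_subset_ball (by norm_num) h)
    have h0 : radialCutoff 2 3 (y - x) = 0 := by
      refine testFn_eq_zero ?_
      rw [mem_closedBall, not_le] at hx'
      exact hx'.le
    rw [h0, ENNReal.ofReal_zero, mul_zero]
    exact bot_le

/-- **Jia–Šverák's Lemma 2 at unit radius** (`R = 1`; the general radius follows by the
Navier–Stokes scaling, `jia_sverak_2013_lemma_2_holds`): there are absolute `ε₀ ∈ (0, 1]` and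
`C` such that for every weakly divergence-free `u₀ ∈ E²` with `∫_{B_1(x₀)} |u₀|² ≤ 2α` for all
`x₀`, every local Leray solution `(u, p)` with datum `u₀`, every weak spatial gradient `G` of `u`,
and every `0 < T ≤ ε₀` with `Tα² ≤ ε₀`: `∫_{B_1(x₀)} |u(t)|² ≤ 2Cα` for a.e. `t ∈ (0,T)` and all
`x₀`, `∫∫_{(0,T)×B_1(x₀)} |G|² ≤ Cα`, and at every centre a measurable gauge `c` with
`∫∫_{(0,T)×B_1(x₀)} |p - c|^{3/2} ≤ Cα^{3/2}`. Proof: the core estimate `core_bounds` with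
thresholds `θ = 8nα + η`, `η ↓ 0` (`n = |B_1|⁻¹|B_5|`, so that `∫|u₀|²φ_y ≤ 2nα = θ/4 - η/4`), the
smallness `K₁sθ + K₂θ^{3/2}s^{1/4} ≤ θ/4` for `s ≤ T` coming from `T ≤ ε₀`, `Tα² ≤ ε₀`
(`small_hyps`, `window_bound_le_quarter`); the pressure bound is `exists_window_pressure_bound`
on `(0, T)` with `M = 8nα`. [cite: JiaSverak2013, Lemma 2 with (2.7), (2.9) and its proof (arXiv:1201.1592 pp. 3–4)] -/
theorem apriori_unit_scale :
    ∃ ε₀ : ℝ≥0, 0 < ε₀ ∧ ε₀ ≤ 1 ∧ ∃ C : ℝ≥0,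
    ∀ (u₀ : (EuclideanSpace ℝ (Fin 3)) → (EuclideanSpace ℝ (Fin 3))) (u : ℝ → (EuclideanSpace ℝ (Fin 3)) → (EuclideanSpace ℝ (Fin 3))) (p : ℝ → (EuclideanSpace ℝ (Fin 3)) → ℝ) (G : ℝ → (EuclideanSpace ℝ (Fin 3)) → (EuclideanSpace ℝ (Fin 3)) →L[ℝ] (EuclideanSpace ℝ (Fin 3)))
      (α : ℝ≥0) (T : ℝ),
      IsWeaklyDivFree u₀ → MemE2 u₀ → IsLocalLeraySolution 1 u₀ u p →
      HasWeakSpatialGradientOn (slab (EuclideanSpace ℝ (Fin 3)) (Ioi 0) isOpen_Ioi) u G →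
      (∀ x₀ : (EuclideanSpace ℝ (Fin 3)), ∫⁻ x in ball x₀ 1, ‖u₀ x‖ₑ ^ 2 ≤ 2 * (α : ℝ≥0∞)) →
      0 < T → T ≤ (ε₀ : ℝ) → T * (α : ℝ) ^ 2 ≤ (ε₀ : ℝ) →
      (∀ᵐ t ∂(volume.restrict (Ioo 0 T)), ∀ x₀ : (EuclideanSpace ℝ (Fin 3)),
          ∫⁻ x in ball x₀ 1, ‖u t x‖ₑ ^ 2 ≤ 2 * ((C * α : ℝ≥0) : ℝ≥0∞)) ∧
      (∀ x₀ : (EuclideanSpace ℝ (Fin 3)), ∫⁻ z in Ioo 0 T ×ˢ ball x₀ 1, ENNReal.ofReal (frobeniusNormSq (G z.1 z.2)) ≤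
          ((C * α : ℝ≥0) : ℝ≥0∞)) ∧
      ∀ x₀ : (EuclideanSpace ℝ (Fin 3)), ∃ c : ℝ → ℝ, Measurable c ∧
        ∫⁻ z in Ioo 0 T ×ˢ ball x₀ 1, ‖p z.1 z.2 - c z.1‖ₑ ^ (3 / 2 : ℝ) ≤
          ((C * (α * NNReal.sqrt α) : ℝ≥0) : ℝ≥0∞) := by
  obtain ⟨K₁, K₂, hK⟩ := exists_window_flux_le
  obtain ⟨P₀, hP⟩ := exists_window_pressure_bound
  -- the covering number of radius `4`
  set N : ℝ≥0∞ := (volume (ball (0 : (EuclideanSpace ℝ (Fin 3))) 1))⁻¹ * volume (ball (0 : (EuclideanSpace ℝ (Fin 3))) (4 + 1)) with hN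
  have hNtop : N ≠ ⊤ :=
    ENNReal.mul_ne_top (ENNReal.inv_ne_top.2 volume_unitBall_ne_zero) measure_ball_lt_top.ne
  set n₅ : ℝ≥0 := N.toNNReal with hn₅
  have hn₅N : (n₅ : ℝ≥0∞) = N := ENNReal.coe_toNNReal hNtop
  -- ## the constants
  set ε₀ : ℝ≥0 := min (1 / 2) (min (1 / (8 * K₁ + 1)) (1 / (8 ^ 4 * K₂ ^ 4 * (128 * n₅ ^ 2 + 2) + 1)))
    with hε₀
  have hε₀pos : 0 < ε₀ := by rw [hε₀]; positivity
  have hε₀half : ε₀ ≤ 1 / 2 := min_le_left _ _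
  have hε1 : 8 * K₁ * ε₀ ≤ 1 := by
    have h1 : ε₀ ≤ 1 / (8 * K₁ + 1) := (min_le_right _ _).trans (min_le_left _ _)
    calc 8 * K₁ * ε₀ ≤ (8 * K₁ + 1) * (1 / (8 * K₁ + 1)) := by gcongr; exact le_self_add
      _ = 1 := mul_one_div_cancel (by positivity)
  have hε2 : 8 ^ 4 * K₂ ^ 4 * (128 * n₅ ^ 2 + 2) * ε₀ ≤ 1 := by
    have h1 : ε₀ ≤ 1 / (8 ^ 4 * K₂ ^ 4 * (128 * n₅ ^ 2 + 2) + 1) :=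
      (min_le_right _ _).trans (min_le_right _ _)
    calc 8 ^ 4 * K₂ ^ 4 * (128 * n₅ ^ 2 + 2) * ε₀
        ≤ (8 ^ 4 * K₂ ^ 4 * (128 * n₅ ^ 2 + 2) + 1) * (1 / (8 ^ 4 * K₂ ^ 4 * (128 * n₅ ^ 2 + 2) + 1)) := by
          gcongr; exact le_self_add
      _ = 1 := mul_one_div_cancel (by positivity)
  set C : ℝ≥0 := max (4 * n₅) (24 * P₀ * (n₅ * NNReal.sqrt n₅)) with hC
  refine ⟨ε₀, hε₀pos, hε₀half.trans (by norm_num), C, ?_⟩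
  intro u₀ u p G α T hdiv hE2 hv hG hα hT hTε hTα
  have hT1 : T ≤ 1 / 2 := hTε.trans (by exact_mod_cast hε₀half)
  have hT1' : T ≤ 1 := hT1.trans (by norm_num)
  -- ## gauges at every centre
  have hg : ∀ y : (EuclideanSpace ℝ (Fin 3)), ∃ c : ℝ → ℝ, Measurable c ∧
      (∀ T : ℝ, 0 < T → MemLp c (3 / 2 : ℝ≥0∞) (volume.restrict (Ioo 0 T))) ∧
      (∀ T : ℝ, 0 < T → ∀ᵐ z ∂(volume.restrict (Ioo 0 T ×ˢ ball y 3)),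
        p z.1 z.2 - c z.1 = localPressureNear y 3 u z.1 z.2 + localPressureFar y 3 u z.1 z.2) ∧
      ∀ T R : ℝ, 0 < T → 0 < R →
        ∫⁻ z in Ioo 0 T ×ˢ ball (0 : (EuclideanSpace ℝ (Fin 3))) R, ‖p z.1 z.2 - c z.1‖ₑ ^ (3 / 2 : ℝ) < ⊤ :=
    fun y => exists_measurable_gauge hE2 hdiv hv y
  choose cg hcgm hcgL hcgdec hcgfin using hg
  -- ## the datum: `∫ |u₀|² φ_y ≤ 2 n₅ α`
  have ha0 : ∀ y : (EuclideanSpace ℝ (Fin 3)), ∫⁻ x, ‖u₀ x‖ₑ ^ 2 * ENNReal.ofReal (radialCutoff 2 3 (y - x)) ≤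
      ((2 * n₅ * α : ℝ≥0) : ℝ≥0∞) := by
    intro y
    calc ∫⁻ x, ‖u₀ x‖ₑ ^ 2 * ENNReal.ofReal (radialCutoff 2 3 (y - x))
        ≤ ∫⁻ x in ball y 4, ‖u₀ x‖ₑ ^ 2 := lintegral_mul_cutoff_le_setLIntegral_ball _ y
      _ ≤ (volume (ball (0 : (EuclideanSpace ℝ (Fin 3))) 1))⁻¹ * (2 * (α : ℝ≥0∞) * volume (ball (0 : (EuclideanSpace ℝ (Fin 3))) (4 + 1))) :=
          setLIntegral_ball_le_of_forall_unitBall (hE2.aestronglyMeasurable.enorm.pow_const 2) hα y 4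
      _ = 2 * N * α := by rw [hN]; ring
      _ = ((2 * n₅ * α : ℝ≥0) : ℝ≥0∞) := by rw [← hn₅N]; push_cast; ring
  -- ## the core estimate at the thresholds `θ_m = 8 n₅ α + 1/(m+1)`
  have hcore : ∀ m : ℕ,
      (∀ᵐ t ∂(volume.restrict (Ioo 0 T)), ∀ z : (EuclideanSpace ℝ (Fin 3)),
        ∫⁻ x in ball z 1, ‖u t x‖ₑ ^ 2 ≤ ((8 * n₅ * α + 1 / (m + 1) : ℝ≥0) : ℝ≥0∞)) ∧
      ∀ z : (EuclideanSpace ℝ (Fin 3)), ∫⁻ w in Ioo 0 T ×ˢ ball z 1, ENNReal.ofReal (frobeniusNormSq (G w.1 w.2)) ≤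
        (((8 * n₅ * α + 1 / (m + 1)) / 2 : ℝ≥0) : ℝ≥0∞) := by
    intro m
    set η : ℝ≥0 := 1 / (m + 1) with hη
    have hηpos : 0 < η := by rw [hη]; positivity
    have hη1 : η ≤ 1 := by
      rw [hη, div_le_iff₀ (by positivity), one_mul]
      exact le_add_self
    set θ : ℝ≥0 := 8 * n₅ * α + η with hθ
    have hθpos : 0 < θ := by rw [hθ]; positivity
    refine core_bounds hv hE2 hG (hK hv hG) cg hcgm hcgdec hcgfin hT hT1 hθpos ?_ ?_
    · -- smallness of the time
      intro s hs0 hsT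
      set σ : ℝ≥0 := ⟨s ^ (1 / 4 : ℝ), Real.rpow_nonneg hs0 _⟩ with hσ
      have hσs : (σ : ℝ) ^ 4 = s := by
        show (s ^ (1 / 4 : ℝ)) ^ 4 = s
        rw [← Real.rpow_natCast, ← Real.rpow_mul hs0]; norm_num
      rw [show s = (σ : ℝ) ^ 4 from hσs.symm, window_bound_cast, ENNReal.coe_le_coe]
      obtain ⟨h1, h2⟩ := small_hyps K₁ K₂ n₅ α η ε₀ σ hη1 hs0 hsT hσs hTε hTα hε1 hε2
      exact window_bound_le_quarter K₁ K₂ θ σ h1 h2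
    · -- size of the datum
      intro y
      refine (ha0 y).trans (ENNReal.coe_le_coe.2 ?_)
      rw [hθ, ← NNReal.coe_le_coe]
      push_cast
      linarith [η.coe_nonneg]
  -- ## `η → 0`
  have hE : ∀ᵐ t ∂(volume.restrict (Ioo 0 T)), ∀ z : (EuclideanSpace ℝ (Fin 3)),
      ∫⁻ x in ball z 1, ‖u t x‖ₑ ^ 2 ≤ ((8 * n₅ * α : ℝ≥0) : ℝ≥0∞) := by
    have h := ae_all_iff.2 fun m => (hcore m).1
    filter_upwards [h] with t ht z
    refine ENNReal.le_of_forall_pos_le_add fun ε hε _ => ?_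
    obtain ⟨m, hm⟩ := exists_nat_one_div_lt hε
    calc ∫⁻ x in ball z 1, ‖u t x‖ₑ ^ 2 ≤ ((8 * n₅ * α + 1 / (m + 1) : ℝ≥0) : ℝ≥0∞) := ht m z
      _ = ((8 * n₅ * α : ℝ≥0) : ℝ≥0∞) + ((1 / (m + 1) : ℝ≥0) : ℝ≥0∞) := ENNReal.coe_add _ _
      _ ≤ ((8 * n₅ * α : ℝ≥0) : ℝ≥0∞) + ε := by gcongr
  have hD : ∀ z : (EuclideanSpace ℝ (Fin 3)), ∫⁻ w in Ioo 0 T ×ˢ ball z 1, ENNReal.ofReal (frobeniusNormSq (G w.1 w.2)) ≤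
      ((4 * n₅ * α : ℝ≥0) : ℝ≥0∞) := by
    intro z
    refine ENNReal.le_of_forall_pos_le_add fun ε hε _ => ?_
    obtain ⟨m, hm⟩ := exists_nat_one_div_lt hε
    calc ∫⁻ w in Ioo 0 T ×ˢ ball z 1, ENNReal.ofReal (frobeniusNormSq (G w.1 w.2))
        ≤ (((8 * n₅ * α + 1 / (m + 1)) / 2 : ℝ≥0) : ℝ≥0∞) := (hcore m).2 z
      _ ≤ ((4 * n₅ * α : ℝ≥0) : ℝ≥0∞) + ((1 / (m + 1) : ℝ≥0) : ℝ≥0∞) := by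
          rw [← ENNReal.coe_add, ENNReal.coe_le_coe, ← NNReal.coe_le_coe]
          push_cast
          have : (0 : ℝ) ≤ 1 / (m + 1) := by positivity
          linarith
      _ ≤ ((4 * n₅ * α : ℝ≥0) : ℝ≥0∞) + ε := by gcongr
  -- ## the constants of the statement
  have hC1 : 4 * n₅ ≤ C := le_max_left _ _
  have hC2 : 24 * P₀ * (n₅ * NNReal.sqrt n₅) ≤ C := le_max_right _ _
  refine ⟨?_, fun x₀ => ?_, fun x₀ => ?_⟩
  · filter_upwards [hE] with t ht x₀
    refine (ht x₀).trans ?_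
    rw [show (2 : ℝ≥0∞) = ((2 : ℝ≥0) : ℝ≥0∞) from rfl, ← ENNReal.coe_mul, ENNReal.coe_le_coe]
    calc 8 * n₅ * α = 2 * (4 * n₅ * α) := by ring
      _ ≤ 2 * (C * α) := by gcongr
  · refine (hD x₀).trans (ENNReal.coe_le_coe.2 ?_)
    calc 4 * n₅ * α = (4 * n₅) * α := by ring
      _ ≤ C * α := by gcongr
  · -- the pressure at the centre `x₀`, gauge `c_{x₀}`
    refine ⟨cg x₀, hcgm x₀, ?_⟩
    have hM : ((8 * n₅ * α : ℝ≥0) : ℝ≥0∞) ≠ ⊤ := ENNReal.coe_ne_top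
    have hDM : ((4 * n₅ * α : ℝ≥0) : ℝ≥0∞) ≤ ((8 * n₅ * α : ℝ≥0) : ℝ≥0∞) := by
      refine ENNReal.coe_le_coe.2 ?_
      calc 4 * n₅ * α ≤ 4 * n₅ * α + 4 * n₅ * α := le_self_add
        _ = 8 * n₅ * α := by ring
    have h := hP hv hG (S := 2) le_rfl hT.le (by linarith) (by linarith) x₀
      ((hcgm x₀).aestronglyMeasurable) (hcgdec x₀ 2 two_pos) hM le_rfl hDM hE hD
    rw [sub_zero] at h
    calc ∫⁻ z in Ioo 0 T ×ˢ ball x₀ 1, ‖p z.1 z.2 - cg x₀ z.1‖ₑ ^ (3 / 2 : ℝ)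
        ≤ ∫⁻ z in Ioo 0 T ×ˢ ball x₀ 3, ‖p z.1 z.2 - cg x₀ z.1‖ₑ ^ (3 / 2 : ℝ) :=
          lintegral_mono_set (Set.prod_mono Subset.rfl (ball_subset_ball (by norm_num)))
      _ ≤ (P₀ : ℝ≥0∞) * ((8 * n₅ * α : ℝ≥0) : ℝ≥0∞) ^ (3 / 2 : ℝ) * ENNReal.ofReal T ^ (1 / 4 : ℝ) := h
      _ ≤ (P₀ : ℝ≥0∞) * ((8 * n₅ * α : ℝ≥0) : ℝ≥0∞) ^ (3 / 2 : ℝ) * 1 := by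
          gcongr
          exact ENNReal.rpow_le_one (ENNReal.ofReal_le_one.2 hT1') (by norm_num)
      _ = ((P₀ * (8 * n₅ * α * NNReal.sqrt (8 * n₅ * α)) : ℝ≥0) : ℝ≥0∞) := by
          rw [mul_one, coe_rpow_threeHalves, ← ENNReal.coe_mul]
      _ ≤ ((C * (α * NNReal.sqrt α) : ℝ≥0) : ℝ≥0∞) := by
          refine ENNReal.coe_le_coe.2 ?_
          calc P₀ * (8 * n₅ * α * NNReal.sqrt (8 * n₅ * α))
              ≤ P₀ * (24 * (n₅ * NNReal.sqrt n₅) * (α * NNReal.sqrt α)) :=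
                mul_le_mul_of_nonneg_left (eight_mul_threeHalves_le n₅ α) (by simp)
            _ = (24 * P₀ * (n₅ * NNReal.sqrt n₅)) * (α * NNReal.sqrt α) := by ring
            _ ≤ C * (α * NNReal.sqrt α) := by gcongr

/-! ### The Navier–Stokes scaling: from radius `R` to radius `1` -/

/-- `(R⁻¹)² · ((R⁻¹)³)⁻¹ = R` in `ℝ≥0∞` (`R > 0`). [folklore] -/
theorem ofReal_inv_sq_mul_inv_cube {R : ℝ} (hR : 0 < R) :
    ENNReal.ofReal R⁻¹ ^ 2 * ENNReal.ofReal (R⁻¹ ^ 3)⁻¹ = ENNReal.ofReal R := by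
  rw [← ENNReal.ofReal_pow (by positivity), ← ENNReal.ofReal_mul (by positivity)]
  congr 1
  field_simp


/-- **The tail of the unit-ball energies of an `E²` field**: for `a ∈ E²` and `δ > 0` there is
`ρ ≥ 0` such that `∫_{B(x₁,1)∖B(0,R)} |a|² ≤ δ` for all `x₁` whenever `R ≥ ρ + 1` (far centres by
the decay of `a`, near centres because the unit ball then lies inside `B(0,R)`; the same lemma as
the tree's `MemE2.exists_forall_lintegral_ball_diff_le`, repeated here to keep the imports light).
[folklore] -/
theorem memE2_tail {a : (EuclideanSpace ℝ (Fin 3)) → (EuclideanSpace ℝ (Fin 3))} (ha : MemE2 a) {δ : ℝ≥0∞} (hδ : 0 < δ) :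
    ∃ ρ : ℝ, 0 ≤ ρ ∧ ∀ R : ℝ, ρ + 1 ≤ R → ∀ x₁ : (EuclideanSpace ℝ (Fin 3)),
      ∫⁻ x in ball x₁ 1 \ ball (0 : (EuclideanSpace ℝ (Fin 3))) R, ‖a x‖ₑ ^ 2 ≤ δ := by
  have hev : ∀ᶠ x₁ in cocompact (EuclideanSpace ℝ (Fin 3)), ∫⁻ x in ball x₁ 1, ‖a x‖ₑ ^ 2 ≤ δ :=
    (ENNReal.tendsto_nhds_zero.1 ha.decay) δ hδ
  obtain ⟨r, hr⟩ := (mem_cocompact_iff_closedBall_compl_subset (0 : (EuclideanSpace ℝ (Fin 3)))).1 hev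
  refine ⟨max r 0, le_max_right _ _, fun R hR x₁ => ?_⟩
  by_cases hx₁ : x₁ ∈ closedBall (0 : (EuclideanSpace ℝ (Fin 3))) r
  · have hsub : ball x₁ 1 ⊆ ball (0 : (EuclideanSpace ℝ (Fin 3))) R := fun y hy => by
      rw [mem_ball, dist_zero_right]
      rw [mem_closedBall, dist_zero_right] at hx₁
      rw [mem_ball, dist_eq_norm] at hy
      calc ‖y‖ = ‖(y - x₁) + x₁‖ := by rw [sub_add_cancel]
        _ ≤ ‖y - x₁‖ + ‖x₁‖ := norm_add_le _ _
        _ < 1 + r := by linarith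
        _ ≤ R := by linarith [le_max_left r 0]
    have hempty : ball x₁ 1 \ ball (0 : (EuclideanSpace ℝ (Fin 3))) R ⊆ (∅ : Set (EuclideanSpace ℝ (Fin 3))) := fun y hy => (hy.2 (hsub hy.1)).elim
    exact (lintegral_mono_set hempty).trans (by simp)
  · exact (lintegral_mono_set fun y hy => hy.1).trans (hr hx₁)

/-- **`E²` is invariant under the Navier–Stokes scaling of data** `u₀ ↦ R u₀(R ·)`, `R > 0`.
[folklore] -/
theorem memE2_rescale {u₀ : (EuclideanSpace ℝ (Fin 3)) → (EuclideanSpace ℝ (Fin 3))} (h : MemE2 u₀) {R : ℝ} (hR : 0 < R) :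
    MemE2 (fun y => R • u₀ (0 + R • y)) := by
  have hmap := map_space_affine_volume hR (0 : (EuclideanSpace ℝ (Fin 3)))
  have hqmp : Measure.QuasiMeasurePreserving (fun y : (EuclideanSpace ℝ (Fin 3)) => (0 : (EuclideanSpace ℝ (Fin 3))) + R • y) volume volume := by
    refine ⟨(measurable_const_add (0 : (EuclideanSpace ℝ (Fin 3)))).comp (measurable_const_smul R), ?_⟩
    rw [hmap]
    exact Measure.smul_absolutelyContinuous
  -- the energy of the rescaled datum on unit balls
  have hball : ∀ y : (EuclideanSpace ℝ (Fin 3)), ∫⁻ x in ball y 1, ‖R • u₀ (0 + R • x)‖ₑ ^ 2 =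
      ENNReal.ofReal (R ^ 2) * ENNReal.ofReal (R ^ Module.finrank ℝ (EuclideanSpace ℝ (Fin 3)))⁻¹ *
        ∫⁻ x in ball (0 + R • y) (R * 1), ‖u₀ x‖ₑ ^ 2 := by
    intro y
    have e1 : ∀ x, ‖R • u₀ (0 + R • x)‖ₑ ^ 2 = ENNReal.ofReal (R ^ 2) * ‖u₀ (0 + R • x)‖ₑ ^ 2 := by
      intro x
      rw [enorm_smul, mul_pow, Real.enorm_eq_ofReal_abs, abs_of_pos hR, ENNReal.ofReal_pow hR.le]
    simp_rw [e1]
    rw [lintegral_const_mul' _ _ ENNReal.ofReal_ne_top, ← space_affine_preimage_ball_self hR 0 y 1,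
      setLIntegral_preimage_comp_space_affine hR 0 (fun x => ‖u₀ x‖ₑ ^ 2), mul_assoc]
  obtain ⟨C, hC⟩ := h.uniformlyLocal
  set V1 : ℝ≥0∞ := volume (ball (0 : (EuclideanSpace ℝ (Fin 3))) 1) with hV1
  have hV1inv : V1⁻¹ ≠ ⊤ := ENNReal.inv_ne_top.2 volume_unitBall_ne_zero
  set K : ℝ≥0∞ := ENNReal.ofReal (R ^ 2) * ENNReal.ofReal (R ^ Module.finrank ℝ (EuclideanSpace ℝ (Fin 3)))⁻¹ with hK
  have hKtop : K ≠ ⊤ := ENNReal.mul_ne_top ENNReal.ofReal_ne_top ENNReal.ofReal_ne_top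
  refine ⟨(h.aestronglyMeasurable.comp_quasiMeasurePreserving hqmp).const_smul R, ?_, ?_⟩
  · -- uniformly local
    set C' : ℝ≥0∞ := K * (V1⁻¹ * (C * volume (ball (0 : (EuclideanSpace ℝ (Fin 3))) (R * 1 + 1)))) with hC'
    have hC'top : C' ≠ ⊤ := ENNReal.mul_ne_top hKtop
      (ENNReal.mul_ne_top hV1inv (ENNReal.mul_ne_top ENNReal.coe_ne_top measure_ball_lt_top.ne))
    refine ⟨C'.toNNReal, fun y => ?_⟩
    rw [ENNReal.coe_toNNReal hC'top, hball, hC']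
    gcongr
    exact setLIntegral_ball_le_of_forall_unitBall (h.aestronglyMeasurable.enorm.pow_const 2) hC _ _
  · -- decay
    rw [ENNReal.tendsto_nhds_zero]
    intro ε hε
    have hKV : K * (V1⁻¹ * volume (ball (0 : (EuclideanSpace ℝ (Fin 3))) (R * 1 + 1))) ≠ ⊤ :=
      ENNReal.mul_ne_top hKtop (ENNReal.mul_ne_top hV1inv measure_ball_lt_top.ne)
    obtain ⟨δ, hδpos, hδ⟩ : ∃ δ : ℝ≥0∞, 0 < δ ∧
        K * (V1⁻¹ * volume (ball (0 : (EuclideanSpace ℝ (Fin 3))) (R * 1 + 1))) * δ ≤ ε := by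
      rcases eq_or_ne (K * (V1⁻¹ * volume (ball (0 : (EuclideanSpace ℝ (Fin 3))) (R * 1 + 1)))) 0 with h0 | h0
      · exact ⟨1, one_pos, by rw [h0, zero_mul]; exact bot_le⟩
      · refine ⟨ε / (K * (V1⁻¹ * volume (ball (0 : (EuclideanSpace ℝ (Fin 3))) (R * 1 + 1)))),
          ENNReal.div_pos hε.ne' hKV, ?_⟩
        rw [ENNReal.mul_div_cancel h0 hKV]
    obtain ⟨ρ, hρ0, hρ⟩ := memE2_tail h hδpos
    rw [Filter.eventually_iff_exists_mem]
    refine ⟨(closedBall (0 : (EuclideanSpace ℝ (Fin 3))) ((ρ + 1 + R) / R))ᶜ, (isCompact_closedBall _ _).compl_mem_cocompact,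
      fun y hy => ?_⟩
    rw [mem_compl_iff, mem_closedBall, dist_zero_right, not_le] at hy
    have hyR : ρ + 1 + R < R * ‖y‖ := by rwa [div_lt_iff₀ hR, mul_comm] at hy
    -- the ball `B(Ry, R)` misses `B(0, ρ + 1)`
    have hdisj : ball (0 + R • y) (R * 1) ⊆ (ball (0 : (EuclideanSpace ℝ (Fin 3))) (ρ + 1))ᶜ := by
      intro x hx hx0
      rw [mem_ball, dist_eq_norm] at hx
      rw [mem_ball, dist_zero_right] at hx0
      have h1 : ‖(0 : (EuclideanSpace ℝ (Fin 3))) + R • y‖ = R * ‖y‖ := by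
        rw [zero_add, norm_smul, Real.norm_eq_abs, abs_of_pos hR]
      have h2 : ‖(0 : (EuclideanSpace ℝ (Fin 3))) + R • y‖ ≤ ‖x‖ + ‖x - (0 + R • y)‖ := by
        calc ‖(0 : (EuclideanSpace ℝ (Fin 3))) + R • y‖ = ‖x - (x - (0 + R • y))‖ := by rw [sub_sub_cancel]
          _ ≤ ‖x‖ + ‖x - (0 + R • y)‖ := norm_sub_le _ _
      linarith
    -- the truncated datum has unit-ball energies `≤ δ`
    set g : (EuclideanSpace ℝ (Fin 3)) → ℝ≥0∞ := (ball (0 : (EuclideanSpace ℝ (Fin 3))) (ρ + 1))ᶜ.indicator fun x => ‖u₀ x‖ₑ ^ 2 with hg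
    have hgm : AEMeasurable g volume :=
      (h.aestronglyMeasurable.enorm.pow_const 2).indicator measurableSet_ball.compl
    have hgunit : ∀ x₁ : (EuclideanSpace ℝ (Fin 3)), ∫⁻ x in ball x₁ 1, g x ≤ δ := fun x₁ => by
      rw [hg, lintegral_indicator measurableSet_ball.compl, Measure.restrict_restrict
        measurableSet_ball.compl, Set.inter_comm, ← Set.sdiff_eq]
      exact hρ (ρ + 1) le_rfl x₁
    calc ∫⁻ x in ball y 1, ‖R • u₀ (0 + R • x)‖ₑ ^ 2
        = K * ∫⁻ x in ball (0 + R • y) (R * 1), ‖u₀ x‖ₑ ^ 2 := by rw [hball, hK]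
      _ = K * ∫⁻ x in ball (0 + R • y) (R * 1), g x := by
          congr 1
          refine setLIntegral_congr_fun measurableSet_ball fun x hx => ?_
          rw [hg, indicator_of_mem (hdisj hx)]
      _ ≤ K * (V1⁻¹ * (δ * volume (ball (0 : (EuclideanSpace ℝ (Fin 3))) (R * 1 + 1)))) := by
          gcongr
          exact setLIntegral_ball_le_of_forall_unitBall hgm hgunit _ _
      _ = K * (V1⁻¹ * volume (ball (0 : (EuclideanSpace ℝ (Fin 3))) (R * 1 + 1))) * δ := by ring
      _ ≤ ε := hδ

/-- `R⁴` bookkeeping: `((R⁻¹R⁻¹)²) · ((R²)⁻¹(R⁻¹)³)⁻¹ = R` in `ℝ≥0∞` (`R > 0`). [folklore] -/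
theorem ofReal_gradient_scaling {R : ℝ} (hR : 0 < R) :
    ENNReal.ofReal ((R⁻¹ * R⁻¹) ^ 2) * ENNReal.ofReal ((R ^ 2)⁻¹ * R⁻¹ ^ 3)⁻¹ = ENNReal.ofReal R := by
  rw [← ENNReal.ofReal_mul (by positivity)]
  congr 1
  field_simp

/-- `R²` bookkeeping: `‖(R⁻¹)²‖ₑ^{3/2} · ((R²)⁻¹(R⁻¹)³)⁻¹ = R²` in `ℝ≥0∞` (`R > 0`). [folklore] -/
theorem enorm_pressure_scaling {R : ℝ} (hR : 0 < R) :
    ‖(R⁻¹ ^ 2 : ℝ)‖ₑ ^ (3 / 2 : ℝ) * ENNReal.ofReal ((R ^ 2)⁻¹ * R⁻¹ ^ 3)⁻¹ = ENNReal.ofReal (R ^ 2) := by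
  have h1 : ‖(R⁻¹ ^ 2 : ℝ)‖ₑ ^ (3 / 2 : ℝ) = ENNReal.ofReal (R⁻¹ ^ 3) := by
    rw [Real.enorm_eq_ofReal_abs, abs_of_nonneg (by positivity),
      ENNReal.ofReal_rpow_of_nonneg (by positivity) (by norm_num)]
    congr 1
    rw [← Real.rpow_natCast _ 2, ← Real.rpow_mul (by positivity), ← Real.rpow_natCast _ 3]
    norm_num
  rw [h1, ← ENNReal.ofReal_mul (by positivity)]
  congr 1
  field_simp

/-- The `ℝ≥0` algebra of the pressure constant: `ρ² · C (α/ρ)^{3/2} = C α^{3/2} ρ^{1/2}`. [folklore] -/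
theorem pressure_constant_rescale (C α ρ : ℝ≥0) (hρ : ρ ≠ 0) :
    ρ ^ 2 * (C * (α / ρ * NNReal.sqrt (α / ρ))) = C * (α * NNReal.sqrt α) * NNReal.sqrt ρ := by
  have hs : NNReal.sqrt ρ ≠ 0 := fun h => hρ (NNReal.sqrt_eq_zero.1 h)
  rw [NNReal.sqrt_div]
  have key : ρ ^ 2 = ρ * (NNReal.sqrt ρ * NNReal.sqrt ρ) := by rw [NNReal.mul_self_sqrt, sq]
  rw [key]
  field_simp

end JiaSverak2013

open JiaSverak2013 in
/-- **Jia–Šverák 2013, Lemma 2 (Lemarié-Rieusset's a priori estimate for Leray solutions),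
proved**: the named fact `jia_sverak_2013_lemma_2` holds. The unit-radius statement
`JiaSverak2013.apriori_unit_scale` is transported to radius `R` by the Navier–Stokes scaling
`u ↦ R u(R² t, R x)`, `p ↦ R² p(R² t, R x)`, `u₀ ↦ R u₀(R x)`, `∇u ↦ R² (∇u)(R² t, R x)`
(`IsLocalLeraySolution.stRescale`, `HasWeakSpatialGradientOn.stRescale`,
`IsWeaklyDivFree.nsRescaleData`, `JiaSverak2013.memE2_rescale`), under which
`sup_{x₀} ∫_{B_R(x₀)} |u₀|² = R · sup_y ∫_{B_1(y)} |ũ₀|²`, the time `T` becomes `T/R²` and the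
three conclusions scale back with the factors `R`, `R`, `R²` respectively, which is exactly the
printed dependence `λ ≤ ε₀ min{α⁻²R², 1}`, `Cα`, `Cα^{3/2}R^{1/2}`.
[cite: JiaSverak2013, Lemma 2 with (2.7), (2.9) and the Remark (arXiv:1201.1592 pp. 3–4)] [cite: KangMiuraTsai2020, Lemma 3.5 (3.5)–(3.7)] -/
theorem jia_sverak_2013_lemma_2_holds : jia_sverak_2013_lemma_2 := by
  obtain ⟨ε₀, hε₀, hε₀1, C, hC⟩ := apriori_unit_scale
  refine ⟨ε₀, hε₀, hε₀1, C, ?_⟩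
  intro u₀ u p G α R T hdiv hE2 hv hG hR hα hT hTR hTα
  -- ## the rescaled solution `w(s, y) = R u(R² s, R y)`
  set β : ℝ := R ^ 2 with hβ
  have hβRR : β = R * R := by rw [hβ, sq]
  have hβpos : 0 < β := by positivity
  set w₀ : EuclideanSpace ℝ (Fin 3) → EuclideanSpace ℝ (Fin 3) := fun y => R • u₀ (0 + R • y) with hw₀
  set w : ℝ → EuclideanSpace ℝ (Fin 3) → EuclideanSpace ℝ (Fin 3) :=
    R • stPull β R 0 (0 : EuclideanSpace ℝ (Fin 3)) u with hw
  set q : ℝ → EuclideanSpace ℝ (Fin 3) → ℝ := (R ^ 2) • stPull β R 0 (0 : EuclideanSpace ℝ (Fin 3)) p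
    with hq
  set H : ℝ → EuclideanSpace ℝ (Fin 3) → EuclideanSpace ℝ (Fin 3) →L[ℝ] EuclideanSpace ℝ (Fin 3) :=
    (R * R) • stPull β R 0 (0 : EuclideanSpace ℝ (Fin 3)) G with hH
  have hwv : IsLocalLeraySolution 1 w₀ w q := by
    have h := hv.stRescale hR hR hβRR 0
    rw [show R * 1 / R = (1 : ℝ) by field_simp] at h
    exact h
  have hdivw : IsWeaklyDivFree w₀ := by
    have h := hdiv.nsRescaleData hR
    have e : nsRescaleData R u₀ = w₀ := by
      funext y
      simp [nsRescaleData, hw₀]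
    rw [e] at h
    exact h
  have hE2w : MemE2 w₀ := memE2_rescale hE2 hR
  have hHw : HasWeakSpatialGradientOn (slab (EuclideanSpace ℝ (Fin 3)) (Ioi 0) isOpen_Ioi) w H := by
    have h := hG.stRescale R hβpos hR 0 (0 : EuclideanSpace ℝ (Fin 3))
    rw [stPreimage_slab_Ioi_of_pos hβpos] at h
    exact h
  -- ## the rescaled size, time
  set ρ : ℝ≥0 := R.toNNReal with hρ
  have hρpos : 0 < ρ := Real.toNNReal_pos.2 hR
  have hρne : ρ ≠ 0 := hρpos.ne'
  have hρR : (ρ : ℝ) = R := Real.coe_toNNReal _ hR.le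
  have hρE : ENNReal.ofReal R = (ρ : ℝ≥0∞) := rfl
  set α' : ℝ≥0 := α / ρ with hα'
  have hα'R : (α' : ℝ) = α / R := by rw [hα', NNReal.coe_div, hρR]
  set T' : ℝ := T / R ^ 2 with hT'
  have hT'pos : 0 < T' := by positivity
  have hT'ε : T' ≤ (ε₀ : ℝ) := by rwa [hT', div_le_iff₀ hβpos]
  have hT'α : T' * (α' : ℝ) ^ 2 ≤ (ε₀ : ℝ) := by
    have hR4 : (0 : ℝ) < R ^ 4 := by positivity
    rw [hα'R, hT', div_pow, div_mul_div_comm, show R ^ 2 * R ^ 2 = R ^ 4 by ring, div_le_iff₀ hR4]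
    exact hTα
  have h3 : Module.finrank ℝ (EuclideanSpace ℝ (Fin 3)) = 3 := finrank_euclideanSpace_fin
  have hα'w : ∀ y : EuclideanSpace ℝ (Fin 3), ∫⁻ x in ball y 1, ‖w₀ x‖ₑ ^ 2 ≤ 2 * (α' : ℝ≥0∞) := by
    intro y
    have e1 : ∀ x, ‖w₀ x‖ₑ ^ 2 = ENNReal.ofReal (R ^ 2) * ‖u₀ (0 + R • x)‖ₑ ^ 2 := by
      intro x
      rw [hw₀]
      dsimp only
      rw [enorm_smul, mul_pow, Real.enorm_eq_ofReal_abs, abs_of_pos hR, ENNReal.ofReal_pow hR.le]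
    simp_rw [e1]
    rw [lintegral_const_mul' _ _ ENNReal.ofReal_ne_top, ← space_affine_preimage_ball_self hR 0 y 1,
      setLIntegral_preimage_comp_space_affine hR 0 (fun x => ‖u₀ x‖ₑ ^ 2), h3]
    calc ENNReal.ofReal (R ^ 2) * (ENNReal.ofReal (R ^ 3)⁻¹ *
          ∫⁻ x in ball (0 + R • y) (R * 1), ‖u₀ x‖ₑ ^ 2)
        ≤ ENNReal.ofReal (R ^ 2) * (ENNReal.ofReal (R ^ 3)⁻¹ * (2 * (α : ℝ≥0∞))) := by
          gcongr
          rw [mul_one]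
          exact hα _
      _ = ENNReal.ofReal (R ^ 2 * (R ^ 3)⁻¹) * (2 * (α : ℝ≥0∞)) := by
          rw [ENNReal.ofReal_mul (by positivity)]; ring
      _ = (ρ : ℝ≥0∞)⁻¹ * (2 * (α : ℝ≥0∞)) := by
          rw [show R ^ 2 * (R ^ 3)⁻¹ = R⁻¹ by field_simp, ENNReal.ofReal_inv_of_pos hR, hρE]
      _ = 2 * (α' : ℝ≥0∞) := by
          rw [hα', ENNReal.coe_div hρne, div_eq_mul_inv]; ring
  obtain ⟨hEw, hDw, hPw⟩ := hC w₀ w q H α' T' hdivw hE2w hwv hHw hα'w hT'pos hT'ε hT'α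
  -- ## back to `(u, p)`: `u` is the rescaling of `w` by `R⁻¹`
  set β' : ℝ := (R ^ 2)⁻¹ with hβ'
  set γ' : ℝ := R⁻¹ with hγ'
  have hβ'pos : 0 < β' := by positivity
  have hγ'pos : 0 < γ' := by positivity
  have hγ'R : γ' * R = 1 := by rw [hγ', inv_mul_cancel₀ hR.ne']
  have hβ'T : β' * T = T' := by rw [hβ', hT']; field_simp
  have hu_back : ∀ t x, u t x = R⁻¹ • w (0 + β' * t) (0 + γ' • x) := by
    intro t x
    rw [hw, smul_stPull_apply, smul_smul, inv_mul_cancel₀ hR.ne', one_smul, zero_add, zero_add,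
      zero_add, zero_add, smul_smul, show R * γ' = 1 by rw [hγ', mul_inv_cancel₀ hR.ne'], one_smul,
      show β * (β' * t) = t by rw [hβ', ← mul_assoc, mul_inv_cancel₀ hβpos.ne', one_mul]]
  refine ⟨?_, fun x₀ => ?_, fun x₀ => ?_⟩
  · -- (E): the energy on balls of radius `R`
    have h1 : ∀ᵐ s ∂(volume.restrict (Ioo (0 + β' * 0) (0 + β' * T))), ∀ y : EuclideanSpace ℝ (Fin 3),
        ∫⁻ x in ball y 1, ‖w s x‖ₑ ^ 2 ≤ 2 * ((C * α' : ℝ≥0) : ℝ≥0∞) := by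
      rw [mul_zero, add_zero, zero_add, hβ'T]
      exact hEw
    filter_upwards [ae_restrict_Ioo_comp_time_affine hβ'pos 0 0 T h1] with t ht x₀
    have e1 : ∀ x, ‖u t x‖ₑ ^ 2 = ENNReal.ofReal R⁻¹ ^ 2 * ‖w (0 + β' * t) (0 + γ' • x)‖ₑ ^ 2 := by
      intro x
      rw [hu_back t x, enorm_smul, mul_pow, Real.enorm_eq_ofReal_abs, abs_of_pos (inv_pos.2 hR)]
    calc ∫⁻ x in ball x₀ R, ‖u t x‖ₑ ^ 2
        = ENNReal.ofReal R⁻¹ ^ 2 * ∫⁻ x in ball x₀ R, ‖w (0 + β' * t) (0 + γ' • x)‖ₑ ^ 2 := by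
          simp_rw [e1]
          rw [lintegral_const_mul' _ _ (ENNReal.pow_ne_top ENNReal.ofReal_ne_top)]
      _ = ENNReal.ofReal R⁻¹ ^ 2 * (ENNReal.ofReal (γ' ^ 3)⁻¹ *
            ∫⁻ y in ball (0 + γ' • x₀) (γ' * R), ‖w (0 + β' * t) y‖ₑ ^ 2) := by
          rw [← space_affine_preimage_ball_self hγ'pos 0 x₀ R,
            setLIntegral_preimage_comp_space_affine hγ'pos 0 (fun y => ‖w (0 + β' * t) y‖ₑ ^ 2), h3]
      _ ≤ ENNReal.ofReal R⁻¹ ^ 2 * (ENNReal.ofReal (γ' ^ 3)⁻¹ * (2 * ((C * α' : ℝ≥0) : ℝ≥0∞))) := by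
          gcongr
          rw [hγ'R]
          exact ht _
      _ = ENNReal.ofReal R * (2 * ((C * α' : ℝ≥0) : ℝ≥0∞)) := by
          rw [← mul_assoc, hγ', ofReal_inv_sq_mul_inv_cube hR]
      _ = 2 * ((C * α : ℝ≥0) : ℝ≥0∞) := by
          rw [hρE, hα', show (2 : ℝ≥0∞) = ((2 : ℝ≥0) : ℝ≥0∞) from rfl, ← ENNReal.coe_mul,
            ← ENNReal.coe_mul, ← ENNReal.coe_mul]
          congr 1
          field_simp
  · -- (D): the dissipation on `(0,T) × B_R(x₀)`
    have hG_back : (γ' * γ') • stPull β' γ' 0 (0 : EuclideanSpace ℝ (Fin 3)) H = G := by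
      funext t x
      have e1 : β * (β' * t) = t := by rw [hβ', ← mul_assoc, mul_inv_cancel₀ hβpos.ne', one_mul]
      have e2 : (0 : EuclideanSpace ℝ (Fin 3)) + R • ((0 : EuclideanSpace ℝ (Fin 3)) + γ' • x) = x := by
        rw [zero_add, zero_add, smul_smul, show R * γ' = 1 by rw [hγ', mul_inv_cancel₀ hR.ne'], one_smul]
      have e3 : γ' * γ' * (R * R) = 1 := by rw [hγ']; field_simp
      simp only [hH, Pi.smul_apply, stPull_apply]
      rw [e2]
      simp only [zero_add]
      rw [e1, smul_smul, e3, one_smul]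
    have key := setLIntegral_frobeniusNormSq_stRescale hβ'pos hγ'pos 0 (0 : EuclideanSpace ℝ (Fin 3))
      (γ' * γ') H (Ioo 0 (β' * T) ×ˢ ball (0 + γ' • x₀) (γ' * R))
    rw [stAffine_preimage_Ioo_prod_ball hβ'pos hγ'pos, hG_back, h3] at key
    rw [key]
    calc ENNReal.ofReal ((γ' * γ') ^ 2) * ENNReal.ofReal (β' * γ' ^ 3)⁻¹ *
          ∫⁻ z in Ioo 0 (β' * T) ×ˢ ball (0 + γ' • x₀) (γ' * R), ENNReal.ofReal (frobeniusNormSq (H z.1 z.2))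
        ≤ ENNReal.ofReal ((γ' * γ') ^ 2) * ENNReal.ofReal (β' * γ' ^ 3)⁻¹ * ((C * α' : ℝ≥0) : ℝ≥0∞) := by
          gcongr
          rw [hβ'T, hγ'R]
          exact hDw _
      _ = ENNReal.ofReal R * ((C * α' : ℝ≥0) : ℝ≥0∞) := by
          rw [hγ', hβ', ofReal_gradient_scaling hR]
      _ = ((C * α : ℝ≥0) : ℝ≥0∞) := by
          rw [hρE, hα', ← ENNReal.coe_mul]
          congr 1
          field_simp
  · -- (P): the gauged pressure on `(0,T) × B_R(x₀)`
    obtain ⟨c', hc'm, hc'⟩ := hPw (0 + γ' • x₀)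
    refine ⟨fun t => γ' ^ 2 * c' (0 + β' * t), ?_, ?_⟩
    · exact (hc'm.comp ((measurable_const_mul β').const_add 0)).const_mul _
    set Q' : ℝ → EuclideanSpace ℝ (Fin 3) → ℝ := fun s y => q s y - c' s with hQ'
    have hQ_back : ∀ z : ℝ × EuclideanSpace ℝ (Fin 3),
        ((γ' ^ 2) • stPull β' γ' 0 (0 : EuclideanSpace ℝ (Fin 3)) Q') z.1 z.2 =
          p z.1 z.2 - γ' ^ 2 * c' (0 + β' * z.1) := by
      intro z
      have e1 : β * (β' * z.1) = z.1 := by rw [hβ', ← mul_assoc, mul_inv_cancel₀ hβpos.ne', one_mul]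
      have e2 : (0 : EuclideanSpace ℝ (Fin 3)) + R • ((0 : EuclideanSpace ℝ (Fin 3)) + γ' • z.2) = z.2 := by
        rw [zero_add, zero_add, smul_smul, show R * γ' = 1 by rw [hγ', mul_inv_cancel₀ hR.ne'], one_smul]
      have e3 : γ' ^ 2 * R ^ 2 = 1 := by rw [hγ']; field_simp
      simp only [hQ', hq, Pi.smul_apply, stPull_apply, smul_eq_mul]
      rw [e2]
      simp only [zero_add]
      rw [e1, mul_sub, ← mul_assoc, e3, one_mul]
    have key := setLIntegral_enorm_rpow_stRescale hβ'pos hγ'pos 0 (0 : EuclideanSpace ℝ (Fin 3))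
      (γ' ^ 2) Q' (Ioo 0 (β' * T) ×ˢ ball (0 + γ' • x₀) (γ' * R)) (by norm_num : (0 : ℝ) ≤ 3 / 2)
    rw [stAffine_preimage_Ioo_prod_ball hβ'pos hγ'pos, h3] at key
    simp_rw [hQ_back] at key
    rw [key]
    calc ‖γ' ^ 2‖ₑ ^ (3 / 2 : ℝ) * ENNReal.ofReal (β' * γ' ^ 3)⁻¹ *
          ∫⁻ z in Ioo 0 (β' * T) ×ˢ ball (0 + γ' • x₀) (γ' * R), ‖Q' z.1 z.2‖ₑ ^ (3 / 2 : ℝ)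
        ≤ ‖γ' ^ 2‖ₑ ^ (3 / 2 : ℝ) * ENNReal.ofReal (β' * γ' ^ 3)⁻¹ *
            ((C * (α' * NNReal.sqrt α') : ℝ≥0) : ℝ≥0∞) := by
          gcongr
          rw [hβ'T, hγ'R]
          exact hc'
      _ = ENNReal.ofReal (R ^ 2) * ((C * (α' * NNReal.sqrt α') : ℝ≥0) : ℝ≥0∞) := by
          rw [hγ', hβ', enorm_pressure_scaling hR]
      _ = ((C * (α * NNReal.sqrt α) * NNReal.sqrt R.toNNReal : ℝ≥0) : ℝ≥0∞) := by
          rw [ENNReal.ofReal_pow hR.le, hρE, ← ENNReal.coe_pow, ← ENNReal.coe_mul, hα', ← hρ]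
          congr 1
          exact pressure_constant_rescale C α ρ hρne

end Literature.Analysis.FluidPDE

end
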